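/-
Literature/AlgebraicGeometry/ComplexMultiplication/AbelianNonCyclicDegreeFourTimesPrimeCMTypes.lean — pub-hodgecm2 (COR-CM), KEPT Literature lane
lit-deligne-3 gen 63, file F63b.  THEOREMS ONLY (no `def`, no named fact, no `sorry`, no instance, no notation; D-0026 net debt 0).  HC_CM is NOT proved.
-/
import Literature.AlgebraicGeometry.ComplexMultiplication.CyclicTwoPowerTimesPrimeCMTypes
import Literature.AlgebraicGeometry.Pohlmann1968.CorankOneCMTypePowersHodgeConjecture
import Literature.AlgebraicGeometry.Pohlmann1968.CMFieldImprimitiveTypeDegreeLeTwentyTwoHodgeConjecture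
import HarnessLib

/-!
# ABELIAN CM fields of degree `4p` with NON-CYCLIC Galois group (`≅ ℤ/2 × ℤ/2p`, `p` an odd prime): a primitive CM type is
# killed by AT MOST ONE odd character, a quadratic one — Kubota corank `≤ 1`; the trichotomy for every abelian variety with
# complex multiplication by such a field (`ℚ(ζ₂₁), ℚ(ζ₂₈), ℚ(ζ₃₆), ℚ(ζ₄₂)`: `p = 3`; `ℚ(ζ₃₃), ℚ(ζ₄₄), ℚ(ζ₆₆)`: `p = 5`)

Topic `Literature/AlgebraicGeometry/ComplexMultiplication`; cell `pub-hodgecm2` (COR-CM), KEPT Literature lane lit-deligne-3 (gen 63,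
file F63b; companion of `CyclicTwoPowerTimesPrimeCMTypes`, the CYCLIC case).  KERNEL ONLY: theorems, no `def`, no named fact, no
instance, no notation (D-0014 / D-0026 net debt 0).  HC_CM is NOT proved here or anywhere in the lane; the degenerate branch below is
CONDITIONAL on Weil's question and says so in its statement.

## Mathematics

Let `K` be a CM field, abelian over `ℚ`, `[K:ℚ] = 4p` with `p` an odd prime, whose Galois group `G` is NOT cyclic.  Then
`G = ⟨ρ⟩ × ⟨s⟩ × ⟨τ⟩ ≅ ℤ/2 × ℤ/2 × ℤ/p` with `ρ` complex conjugation, `s` a second involution and `τ` of order `p`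
(`exists_frame_of_not_isCyclic`; e.g. `(ℤ/21)ˣ, (ℤ/28)ˣ, (ℤ/36)ˣ ≅ ℤ/2 × ℤ/6`, `(ℤ/33)ˣ, (ℤ/44)ˣ ≅ ℤ/2 × ℤ/10`).  A CM type read
on `G` (`T = {g | φ₀ ∘ g⁻¹ ∈ Φ}`, `T ⊔ ρT = G`) is a pair of sign functions `ε₀, ε₁ : ℤ/p → {±1}` (`τ^c ∈ T` iff `ε₀(c) = 1`,
`sτ^c ∈ T` iff `ε₁(c) = 1`), and for an ODD character `χ` (`χ(ρ) = −1`; these are the `2p` characters counted by Kubota's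
Lemma 2) `χ(T) = Σ_c (ε₀(c) + χ(s) ε₁(c)) χ(τ)^c` (`sum_char_eq_sum_sign`; Hazama's (4.1) / Prop. 4.1, there for `ℤ/2n`).

* §1 (group level).  **If `χ(τ) ≠ 1` (order `2p`) and `χ(T) = 0`, then `T` is stable under `s` or under `ρs`**
  (`isStableUnder_or_of_sum_eq_zero`): `χ(τ)` is a primitive `p`-th root of unity, the only rational relation among
  `1, ζ, …, ζ^{p−1}` is the constant one (tree `CyclotomicGaussian.eq_of_sum_mul_pow_eq_zero`), so `ε₀(c) + χ(s)ε₁(c)` is constant,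
  whence `ε₀ε₁` is constant — the `ℤ/2 × ℤ/2p` analogue of Hazama's Lemma 4.6.1 (`S₁` = types stable under `ℤ/2p` or `ℤ/2q`).
  **The two quadratic odd characters (`χ(τ) = 1`, `χ(s) = ±1`) do not both vanish** (`not_sum_eq_zero_and_of_quadratic`: their sum
  is `2 Σ_c ε₀(c)`, `p` odd — the analogue of Hazama's Prop. 4.2).  Hence on a type with no non-trivial stabiliser **at most ONE
  odd character vanishes, and it is quadratic** (`eq_of_sum_eq_zero_of_primitive`).
* §2 (number fields).  By Shimura §8.2 Prop. 26 / Hazama Prop. 2.3 (tree `CyclicTwoOddPrimes.isPrimitive_iff`) primitive ⟺ no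
  stabiliser, and by Kubota's Lemma 2 (tree `typeRank_add_ncard_oddCharacters_vanishing`, `two_mul_ncard_oddCharacters_eq_card`)
  `rank + #{vanishing odd χ} = 2p + 1`: **every primitive CM type has rank `2p` or `2p + 1`, i.e. corank `≤ 1`**
  (`finrank_div_two_le_cmTypeRank_of_isPrimitive`, `cmTypeRank_eq_or_of_isPrimitive`).  Rank `2p` does occur: Dodson's Theorem
  3.2.1 with `(k, l) = (p, 2)` ("there exist simple degenerate Abelian varieties of dimension `n` and rank `n − l + 2`",
  `Gal(K/ℚ) = ⟨ρ⟩ × ℤ_n`, `n = 2p`) — not re-proved here.  The hypothesis `[K:ℚ]/2 ≤ cmTypeRank Φ` of the tree's `CorankOne*`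
  files is thereby DISCHARGED for these fields, giving for every realisation `(A, ι, θ)` of a primitive type (`A` simple, `dim A = 2p`)
  **Gordon's dichotomy 5.13 in dimension `2p`** (`hodgeConjectureFor_pow_or_weilType_of_isPrimitive`): either `Φ` is nondegenerate
  and `B•(Aⁿ) ⊗ ℂ = D•(Aⁿ) ⊗ ℂ`, Hodge conjecture for all `Aⁿ`, unconditionally; or `Φ` has rank `2p`, `K ⊇ k = ℚ(√-d)` with
  multiplicities `(p,p)`, `(A, ι√-d)` is of Weil type, `Bᵠ(A) = Dᵠ(A)` (`⊗ ℂ`) for `q ≠ p`, `Bᵖ(A) ⊗ ℂ = Dᵖ ⊗ ℂ ⊔ W_k ⊗ ℂ` (van Geemen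
  6.12's shape), and HC for `A` and all `Aⁿ` follows from the algebraicity of the rational `(p,p)` classes of the ONE Weil plane `W_k`.
* §3 (imprimitive types, ANY CM field of degree `4p`, ANY prime `p`).  A non-primitive type is induced from a primitive type of a CM
  subfield of degree `2`, `4` or `2p` (even divisors), nondegenerate by Kubota / Ribet's Examples 3.7 / the Tankeev–Ribet–Yanai prime
  theorem; so `B•(Aⁿ) ⊗ ℂ = D•(Aⁿ) ⊗ ℂ` and HC hold for every power of every realisation (`hodgeConjectureFor_pow_of_not_isPrimitive`,
  `…_of_not_isSimple`) — extending the tree's `…_of_finrank_le_twentyTwo` beyond degree `22` for this degree shape.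
* §6 (gen 63 append) EXISTENCE: Dodson's type `{1, sτ} ∪ {ρτ^c : c ≠ 0} ∪ {ρsτ^c : c ≠ 1}` is primitive and killed by the
  quadratic odd character with kernel `⟨τ, ρs⟩` (`exists_isCMTypeWith_primitive_sum_eq_zero`); hence every such `K` has a primitive
  type of rank EXACTLY `2p` (`exists_isPrimitive_cmTypeRank_eq`) and simple `2p`-folds of Weil type with `Bᵖ ≠ Dᵖ`
  (`exists_realisation_isSimple_weilType`, Shimura's existence theorem); `ℚ(ζ₂₁)`, `ℚ(ζ₃₃)`, `ℚ(ζ₄₄)` instances.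
* §7 (gen 63 append) EVERY ABELIAN CM FIELD OF DEGREE `4p` (cyclic OR not — an abelian group of order `4p` is `ℤ/4p` or `ℤ/2 × ℤ/2p`):
  corank `≤ 1`, the trichotomy, `Bᵐ(A) = Dᵐ(A)` for `m ≠ p`, HC for all powers outside the Weil-type branch, every `ℚ(ζ_q)` with `φ(q) = 4p`
  (`…_of_finrank_eq`, `…_of_isCyclotomicExtension_of_totient_eq`; the cyclic case is the lane's `CyclicTwoPowerTimesPrimeCMTypes`, `k = 1`).
* §8 (gen 63 append) THE CENSUS (Hazama's Thm. 4.8 (vi) analogue): the dictionary `T ↦ (A₀, A₁)` (`census_dictionary`: every pair of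
  subsets of `ℤ/p` is a CM type; not primitive ⟺ `A₁ ∈ {A₀, A₀ᶜ}`; primitive degenerate ⟺ `|A₀| = |A₁|` or `|A₀| + |A₁| = p`) and the
  counts `4^p = 2^{p+1} + 2·(C(2p,p) − 2^p) + (4^p − 2·C(2p,p))` (`census_card`, `census`, `census_of_isCyclotomicExtension`;
  `ℚ(ζ₂₁)`: `64 = 16 + 24 + 24`; `ℚ(ζ₃₃)`, `ℚ(ζ₄₄)`: `1024 = 64 + 440 + 520`).
* §4 the TRICHOTOMY for every abelian variety with CM by `K` (`hodgeClassSpan_pow_eq_or_weilType`) and its unconditional shadow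
  `hodgeClassSpan_eq_divisorClassesSpan_of_ne` (`Bᵐ(A) ⊗ ℂ = Dᵐ(A) ⊗ ℂ` for all `m ≠ p`, any type, any realisation); §5 the
  cyclotomic fields `ℚ(ζ_q)` with `(ℤ/q)ˣ` non-cyclic of order `4p` (Mathlib `ZMod.not_isCyclic_units_of_mul_coprime`,
  `isCyclic_units_four_mul_iff`, `isCyclic_units_two_mul_iff_of_odd`): `q = 21, 28, 36, 42` (`p = 3`, abelian `6`-folds) and
  `q = 33, 44, 66` (`p = 5`, abelian `10`-folds — levels of `φ(N) ≤ 22` beyond the `φ ≤ 16` tables).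

## References

* T. Kubota, *On the field extension by complex multiplication*, Trans. AMS 118 (1965) [Kubota1965], §2 (p. 115), §4 Lemma 2.
* F. Hazama, *Hodge cycles on abelian varieties with complex multiplication by cyclic CM-fields*, J. Math. Sci. Univ. Tokyo 10
  (2003) [Hazama2003CyclicCM], Prop. 2.1, 2.3, §4 (4.1), Prop. 4.1–4.3, Lemma 4.6.1, Thm. 4.8 (the CYCLIC `ℤ/2pq` case; §1 here is
  its `ℤ/2 × ℤ/2p` analogue).
* B. Dodson, *The structure of Galois groups of CM-fields*, Trans. AMS 283 (1984) [Dodson1984], §1.1, §3.2.1 Theorem; *On the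
  Mumford–Tate group of an abelian variety with complex multiplication*, J. Algebra 109 (1987) [Dodson1987], Thm. 1.0, §1.1.
* B. B. Gordon, *A survey of the Hodge conjecture for abelian varieties* [Gordon1999HodgeAVSurvey], 5.13, Thm. 6.3–6.4, §9.2–9.5.
* B. van Geemen, *An introduction to the Hodge conjecture for abelian varieties*, LNM 1594 (1994) [vanGeemen1994HodgeAV], 1.1, 4.7,
  Thm. 4.11, Thm. 6.12; J. S. Milne (2020) [Milne2020HodgeClassesAV], Thm. 1.
* K. Ribet, *Division fields of abelian varieties with complex multiplication* (1980) [Ribet1980], §3 (3.7); H. Yanai (1985) [Yanai1985],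
  §4; M. Streng, thesis (2010) [Streng2010], Ch. I Lemma 3.5; G. Shimura, *Abelian Varieties with Complex Multiplication and Modular
  Functions* (1998) [Shimura1998], §8.2 Prop. 26, §18.2; L. Washington, *Introduction to Cyclotomic Fields* (1997) [Washington1997], Ch. 2.

PRESEARCH (lane rule): the statement "`Gal(K/ℚ) ≅ ℤ/2 × ℤ/2p` ⟹ every primitive type has corank `≤ 1`, killed only by a quadratic
odd character" was not found as printed (corpus hybrid/vector + galaxy, queries «degenerate CM-type», «non-cyclic CM», the statement
in prose); the ingredients are Kubota's Lemma 2, Hazama's §4 method for `ℤ/2n`, Dodson's Thm. 3.2.1 (existence of rank `2p`).  It is an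
elementary consequence, recorded here as the lane's own theorem with those citations (Dodson's Thm. 3.2.1 — type `f = (1^l, 0^l, …, 0^l)`
on `⟨ρ⟩ × ℤ_n`, `n = kl`, rank `n − l + 2` — at `n = 2p`, `(k, l) = (p, 2)` is the rank-`2p` case of `cmTypeRank_eq_or_of_isPrimitive`).

HONEST REGISTER.  Unconditional: §1, the corank bound, `Bᵐ(A) = Dᵐ(A)` (`⊗ ℂ`) off the middle degree for every `A`, HC for all
powers of the non-simple `A` and of the simple `A` of nondegenerate type.  CONDITIONAL (stated as an implication, hypothesis explicit):
HC for the simple `A` of rank-`2p` type, on the algebraicity of the Weil classes of one `2p`-dimensional Weil-type pair `(A, ι√-d)` —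
Weil's open question (van Geemen 1.1); for `p = 2` this is Markman's theorem (tree, octic file), for `p ≥ 3` OPEN.  No statement of
this file asserts HC_CM.
-/

noncomputable section

open scoped BigOperators IsMulCommutative
open Polynomial

namespace Literature.AlgebraicGeometry.ComplexMultiplication.NonCyclicFourTimesPrime

open Literature.NumberTheory.ComplexMultiplication
open Literature.NumberTheory.ComplexMultiplication.CyclicCMType (IsStableUnder rho_mul_mem_iff sum_char_eq_zero_of_stable)
open Literature.NumberTheory.NumberFields.CyclotomicGaussian (eq_of_sum_mul_pow_eq_zero)

/-! ## §1 The group `⟨ρ⟩ × ⟨s⟩ × ⟨τ⟩ ≅ ℤ/2 × ℤ/2 × ℤ/p` -/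

section Group

variable {G : Type*} [CommGroup G] [Fintype G] [DecidableEq G] {ρ s τ : G} {p : ℕ}

omit [DecidableEq G] in
/-- **A finite commutative group of order `4p` (`p` an odd prime) which is NOT cyclic satisfies `g^{2p} = 1` for all `g`**: an element
of order `4` times an element of order `p` would generate. [folklore] -/
private theorem pow_two_mul_eq_one_of_not_isCyclic [hp : Fact p.Prime] (hp2 : p ≠ 2) (hG : Fintype.card G = 4 * p)
    (hnc : ¬ IsCyclic G) (g : G) : g ^ (2 * p) = 1 := by
  obtain ⟨t, ht⟩ := exists_prime_orderOf_dvd_card (G := G) p (by rw [hG]; exact dvd_mul_left p 4)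
  -- no element of order `4`
  have h4 : ∀ x : G, orderOf x ≠ 4 := by
    intro x hx
    have hcop : Nat.Coprime (orderOf x) (orderOf t) := by
      rw [hx, ht, show (4 : ℕ) = 2 ^ 2 by norm_num]
      exact ((Nat.coprime_primes Nat.prime_two hp.out).2 hp2.symm).pow_left 2
    have hxt : orderOf (x * t) = Nat.card G := by
      rw [(Commute.all x t).orderOf_mul_eq_mul_orderOf_of_coprime hcop, hx, ht, Nat.card_eq_fintype_card, hG]
    exact hnc (isCyclic_of_orderOf_eq_card (x * t) hxt)
  have hd : orderOf g ∣ 4 * p := hG ▸ orderOf_dvd_card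
  obtain ⟨d₁, d₂, hd₁, hd₂, hdeq⟩ := dvd_mul.1 hd
  have hd₂pos : 0 < d₂ := Nat.pos_of_dvd_of_pos hd₂ hp.out.pos
  have hd₁' : d₁ ∣ 2 := by
    have hd₁le : d₁ ≤ 4 := Nat.le_of_dvd (by norm_num) hd₁
    interval_cases d₁
    · simp at hd₁
    · norm_num
    · norm_num
    · norm_num at hd₁
    · exfalso
      apply h4 (g ^ d₂)
      rw [orderOf_pow' g hd₂pos.ne', hdeq, Nat.gcd_mul_left_left, Nat.mul_div_cancel _ hd₂pos]
  have hdvd : orderOf g ∣ 2 * p := hdeq ▸ mul_dvd_mul hd₁' hd₂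
  exact orderOf_dvd_iff_pow_eq_one.1 hdvd

omit [DecidableEq G] in
/-- **In a non-cyclic commutative group of order `4p` there is an involution `s ∉ {1, ρ}`** next to any given involution `ρ`: else
`G = P ∪ ρP` with `P` the `p`-torsion, a `p`-group of order `≤ p`. [folklore] -/
private theorem exists_involution_ne [hp : Fact p.Prime] (hp2 : p ≠ 2) (hG : Fintype.card G = 4 * p) (hnc : ¬ IsCyclic G)
    (hρ1 : ρ ≠ 1) (hρ2 : ρ * ρ = 1) : ∃ s : G, s * s = 1 ∧ s ≠ 1 ∧ s ≠ ρ := by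
  have hexp := pow_two_mul_eq_one_of_not_isCyclic hp2 hG hnc
  by_contra hcon
  push Not at hcon
  -- `ρ^p = ρ`
  have hoρ : orderOf ρ = 2 := orderOf_eq_prime (by rw [pow_two, hρ2]) hρ1
  have hρp : ρ ^ p = ρ := by
    rw [← pow_mod_orderOf ρ p, hoρ, Nat.odd_iff.1 (hp.out.odd_of_ne_two hp2), pow_one]
  -- the `p`-torsion subgroup
  set P : Subgroup G := (powMonoidHom p : G →* G).ker with hP
  have hmemP : ∀ g : G, g ∈ P ↔ g ^ p = 1 := fun g => by
    rw [hP, MonoidHom.mem_ker, powMonoidHom_apply]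
  have hcover : ∀ g : G, g ∈ (P : Set G) ∪ (fun x => ρ * x) '' (P : Set G) := by
    intro g
    have hv : g ^ p * g ^ p = 1 := by rw [← pow_add, ← two_mul, hexp]
    by_cases hg : g ^ p = 1
    · exact Or.inl ((hmemP g).2 hg)
    · refine Or.inr ⟨ρ * g, (hmemP _).2 ?_, by beta_reduce; rw [← mul_assoc, hρ2, one_mul]⟩
      rw [mul_pow, hρp, hcon (g ^ p) hv hg, hρ2]
  -- `|P| = p^n ∣ 4p` with `n ≤ 1`
  have hPgrp : IsPGroup p P := fun x => ⟨1, by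
    have hx := (hmemP x.1).1 x.2
    rw [pow_one]
    exact Subtype.ext (by simpa using hx)⟩
  obtain ⟨n, hn⟩ := IsPGroup.iff_card.1 hPgrp
  have hPdvd : Nat.card P ∣ 4 * p := by
    have h := Subgroup.card_subgroup_dvd_card P
    rwa [show Nat.card G = 4 * p by rw [Nat.card_eq_fintype_card, hG]] at h
  have hPle : Nat.card P ≤ p := by
    rw [hn] at hPdvd ⊢
    rcases Nat.lt_or_ge n 2 with hn2 | hn2
    · interval_cases n
      · simpa using hp.out.one_lt.le
      · simp
    · exfalso
      have h2 : p ^ 2 ∣ 4 * p := (pow_dvd_pow p hn2).trans hPdvd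
      rw [pow_two] at h2
      have h3 : p ∣ 4 := (Nat.mul_dvd_mul_iff_right hp.out.pos).1 h2
      have h4 : p ≤ 4 := Nat.le_of_dvd (by norm_num) h3
      have h5 := hp.out.two_le
      interval_cases p
      · exact hp2 rfl
      · exact absurd h3 (by norm_num)
      · exact absurd hp.out (by norm_num)
  -- count: `4p = |G| ≤ |P| + |ρP| ≤ 2p`
  have hcount : Nat.card G ≤ Nat.card P + Nat.card P := by
    have h1 : (Set.univ : Set G) ⊆ (P : Set G) ∪ (fun x => ρ * x) '' (P : Set G) := fun g _ => hcover g
    calc Nat.card G = (Set.univ : Set G).ncard := (Set.ncard_univ G).symm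
      _ ≤ ((P : Set G) ∪ (fun x => ρ * x) '' (P : Set G)).ncard := Set.ncard_le_ncard h1
      _ ≤ (P : Set G).ncard + ((fun x => ρ * x) '' (P : Set G)).ncard := Set.ncard_union_le _ _
      _ ≤ (P : Set G).ncard + (P : Set G).ncard :=
          Nat.add_le_add_left (Set.ncard_image_le (s := (P : Set G)) (Set.toFinite _)) _
      _ = Nat.card P + Nat.card P := rfl
  rw [Nat.card_eq_fintype_card, hG] at hcount
  have := hp.out.pos
  omega

omit [Fintype G] [DecidableEq G] in
/-- `ρ^p = ρ`, `s^p = s` and the like: powers of an involution reduce mod `2` (`p` odd). [folklore] -/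
private theorem pow_mul_eq_pow_of_mul_self_eq_one {x : G} (hx : x * x = 1) [hp : Fact p.Prime] (hp2 : p ≠ 2) (n : ℕ) :
    x ^ (n * p) = x ^ n := by
  have hodd : p % 2 = 1 := Nat.odd_iff.1 (hp.out.odd_of_ne_two hp2)
  by_cases hx1 : x = 1
  · rw [hx1, one_pow, one_pow]
  · have ho : orderOf x = 2 := orderOf_eq_prime (by rw [pow_two, hx]) hx1
    rw [← pow_mod_orderOf x (n * p), ho, Nat.mul_mod, hodd, mul_one, Nat.mod_mod, ← ho, pow_mod_orderOf]

omit [Fintype G] [DecidableEq G] in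
/-- The `2`-part of the coordinates is injective: `ρ^a s^i` (`a, i ∈ {0,1}`) are four distinct elements when `s ∉ {1, ρ}`, `ρ ≠ 1`.
[folklore] -/
private theorem two_part_injective (hρ1 : ρ ≠ 1) (hρ2 : ρ * ρ = 1) (hs1 : s ≠ 1) (hsρ : s ≠ ρ) {a a' i i' : ℕ}
    (ha : a < 2) (ha' : a' < 2) (hi : i < 2) (hi' : i' < 2)
    (h : ρ ^ a * s ^ i = ρ ^ a' * s ^ i') : a = a' ∧ i = i' := by
  have hρs1 : ρ * s ≠ 1 := fun h' => hsρ (by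
    have := congrArg (ρ * ·) h'
    simp only [← mul_assoc, hρ2, one_mul, mul_one] at this
    exact this)
  have hρss : ρ * s ≠ s := fun h' => hρ1 (by simpa using h')
  have hρsρ : ρ * s ≠ ρ := fun h' => hs1 (by simpa using h')
  interval_cases a <;> interval_cases a' <;> interval_cases i <;> interval_cases i' <;>
    simp only [pow_zero, pow_one, one_mul, mul_one] at h <;>
    first
    | exact ⟨rfl, rfl⟩
    | exact absurd h hs1.symm
    | exact absurd h hs1
    | exact absurd h hρ1.symm
    | exact absurd h hρ1
    | exact absurd h hsρ
    | exact absurd h hsρ.symm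
    | exact absurd h hρs1.symm
    | exact absurd h hρs1
    | exact absurd h hρss.symm
    | exact absurd h hρss
    | exact absurd h hρsρ.symm
    | exact absurd h hρsρ

omit [DecidableEq G] in
/-- **The coordinates `(a, i, c) ↦ ρ^a s^i τ^c` on `ℤ/2 × ℤ/2 × ℤ/p` enumerate `G` bijectively** (`|G| = 4p`, `ρ, s` involutions,
`s ∉ {1, ρ}`, `τ` of order `p`). [folklore] -/
private theorem coord_bijective [hp : Fact p.Prime] (hp2 : p ≠ 2) (hG : Fintype.card G = 4 * p) (hρ1 : ρ ≠ 1)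
    (hρ2 : ρ * ρ = 1) (hs1 : s ≠ 1) (hs2 : s * s = 1) (hsρ : s ≠ ρ) (hτ : orderOf τ = p) :
    Function.Bijective (fun z : Fin 2 × Fin 2 × ZMod p => ρ ^ (z.1 : ℕ) * (s ^ (z.2.1 : ℕ) * τ ^ z.2.2.val)) := by
  rw [Fintype.bijective_iff_injective_and_card]
  refine ⟨?_, by simp [Fintype.card_prod, Fintype.card_fin, ZMod.card, hG]; ring⟩
  rintro ⟨a, i, c⟩ ⟨a', i', c'⟩ h
  simp only at h
  have hτp : τ ^ p = 1 := by rw [← hτ]; exact pow_orderOf_eq_one τ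
  -- raise to the `p`-th power: the `τ`-parts die, the involutions survive
  have key : ∀ (a i : Fin 2) (c : ZMod p), (ρ ^ (a : ℕ) * (s ^ (i : ℕ) * τ ^ c.val)) ^ p = ρ ^ (a : ℕ) * s ^ (i : ℕ) := by
    intro a i c
    rw [mul_pow, mul_pow, ← pow_mul, ← pow_mul, pow_right_comm τ c.val p, hτp, one_pow, mul_one,
      pow_mul_eq_pow_of_mul_self_eq_one hρ2 hp2, pow_mul_eq_pow_of_mul_self_eq_one hs2 hp2]
  have h1 : ρ ^ (a : ℕ) * s ^ (i : ℕ) = ρ ^ (a' : ℕ) * s ^ (i' : ℕ) := by rw [← key a i c, ← key a' i' c', h]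
  obtain ⟨ha, hi⟩ := two_part_injective hρ1 hρ2 hs1 hsρ a.isLt a'.isLt i.isLt i'.isLt h1
  have ha' : a = a' := Fin.ext ha
  have hi' : i = i' := Fin.ext hi
  subst ha' hi'
  have h2 : τ ^ c.val = τ ^ c'.val := mul_left_cancel (mul_left_cancel h)
  rw [pow_eq_pow_iff_modEq, hτ] at h2
  rw [ZMod.val_injective p (Nat.ModEq.eq_of_lt_of_lt h2 c.val_lt c'.val_lt)]


omit [Fintype G] [DecidableEq G] in
/-- Character values in the coordinates: `χ(ρ^a s^i τ^c) = χ(ρ)^a χ(s)^i χ(τ)^c`. [folklore] -/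
private theorem char_coord (χ : AddChar (Additive G) ℂ) (a i c : ℕ) :
    χ (Additive.ofMul (ρ ^ a * (s ^ i * τ ^ c))) =
      χ (Additive.ofMul ρ) ^ a * (χ (Additive.ofMul s) ^ i * χ (Additive.ofMul τ) ^ c) := by
  rw [ofMul_mul, ofMul_mul, AddChar.map_add_eq_mul, AddChar.map_add_eq_mul, ofMul_pow, ofMul_pow, ofMul_pow,
    AddChar.map_nsmul_eq_pow, AddChar.map_nsmul_eq_pow, AddChar.map_nsmul_eq_pow]

omit [Fintype G] [DecidableEq G] in
/-- A `p`-th root of unity, `p` prime, is `1` or a primitive `p`-th root of unity. [folklore] -/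
private theorem isPrimitiveRoot_of_pow_prime_eq_one' (hp : p.Prime) {β : ℂ} (hβ : β ^ p = 1) (hβ1 : β ≠ 1) :
    IsPrimitiveRoot β p := by
  haveI := Fact.mk hp
  rw [← orderOf_eq_prime hβ hβ1]
  exact IsPrimitiveRoot.orderOf β

/-- **The character sum of a CM type in coordinates** (Hazama's (4.1) for `⟨ρ⟩ × ⟨s⟩ × ⟨τ⟩`): for an ODD character `χ`
(`χ(ρ) = −1`), `χ(T) = Σ_{c ∈ ℤ/p} (ε₀(c) + χ(s) ε₁(c)) χ(τ)^c` with `ε₀(c), ε₁(c) = ±1` according as `τ^c ∈ T`, `sτ^c ∈ T` or not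
(`ρ τ^c ∈ T` exactly when `τ^c ∉ T`, contributing `−χ(τ^c)`). [cite: Hazama2003CyclicCM, §4 (4.1) and Prop. 4.1] [cite: Kubota1965, §4 Lemma 2] -/
theorem sum_char_eq_sum_sign [hp : Fact p.Prime] (hp2 : p ≠ 2) (hG : Fintype.card G = 4 * p) (hρ1 : ρ ≠ 1)
    (hρ2 : ρ * ρ = 1) (hs1 : s ≠ 1) (hs2 : s * s = 1) (hsρ : s ≠ ρ) (hτ : orderOf τ = p) {T : Finset G}
    (hT : IsCMTypeWith ρ (T : Set G)) (χ : AddChar (Additive G) ℂ) (hχ : χ (Additive.ofMul ρ) = -1) :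
    ∑ t ∈ T, χ (Additive.ofMul t) = ∑ c : ZMod p,
      (((if τ ^ c.val ∈ T then 1 else -1 : ℤ) : ℂ) +
          χ (Additive.ofMul s) * ((if s * τ ^ c.val ∈ T then 1 else -1 : ℤ) : ℂ)) * χ (Additive.ofMul τ) ^ c.val := by
  set e : Fin 2 × Fin 2 × ZMod p → G := fun z => ρ ^ (z.1 : ℕ) * (s ^ (z.2.1 : ℕ) * τ ^ z.2.2.val) with he
  have hbij : Function.Bijective e := coord_bijective hp2 hG hρ1 hρ2 hs1 hs2 hsρ hτ
  have hρmem : ∀ g : G, ρ * g ∈ T ↔ g ∉ T := rho_mul_mem_iff hT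
  have h1 : ∑ t ∈ T, χ (Additive.ofMul t) = ∑ g : G, if g ∈ T then χ (Additive.ofMul g) else 0 := by
    rw [← Finset.sum_filter, Finset.filter_mem_eq_inter, Finset.univ_inter]
  have h2 : (∑ g : G, if g ∈ T then χ (Additive.ofMul g) else 0) =
      ∑ z : Fin 2 × Fin 2 × ZMod p, if e z ∈ T then χ (Additive.ofMul (e z)) else 0 :=
    (Fintype.sum_bijective e hbij (fun z => if e z ∈ T then χ (Additive.ofMul (e z)) else 0)
      (fun g => if g ∈ T then χ (Additive.ofMul g) else 0) fun _ => rfl).symm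
  rw [h1, h2, Fintype.sum_prod_type, Fin.sum_univ_two, Fintype.sum_prod_type, Fintype.sum_prod_type, Fin.sum_univ_two,
    Fin.sum_univ_two, ← Finset.sum_add_distrib, ← Finset.sum_add_distrib, ← Finset.sum_add_distrib]
  refine Finset.sum_congr rfl fun c _ => ?_
  have h00 : e (0, 0, c) = τ ^ c.val := by simp [he]
  have h01 : e (0, 1, c) = s * τ ^ c.val := by simp [he]
  have h10 : e (1, 0, c) = ρ * τ ^ c.val := by simp [he]
  have h11 : e (1, 1, c) = ρ * (s * τ ^ c.val) := by simp [he]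
  have hχpow : ∀ (g : G) (n : ℕ), χ (Additive.ofMul (g ^ n)) = χ (Additive.ofMul g) ^ n := fun g n => by
    rw [ofMul_pow, AddChar.map_nsmul_eq_pow]
  have hχmul : ∀ g h : G, χ (Additive.ofMul (g * h)) = χ (Additive.ofMul g) * χ (Additive.ofMul h) := fun g h => by
    rw [ofMul_mul, AddChar.map_add_eq_mul]
  rw [h00, h01, h10, h11]
  by_cases hm0 : τ ^ c.val ∈ T <;> by_cases hm1 : s * τ ^ c.val ∈ T
  · rw [if_pos hm0, if_pos hm1, if_neg (fun h => (hρmem _).1 h hm0), if_neg (fun h => (hρmem _).1 h hm1), if_pos hm0,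
      if_pos hm1, hχmul, hχpow]
    push_cast; ring
  · rw [if_pos hm0, if_neg hm1, if_neg (fun h => (hρmem _).1 h hm0), if_pos ((hρmem _).2 hm1), if_pos hm0, if_neg hm1,
      hχmul, hχmul, hχ, hχpow]
    push_cast; ring
  · rw [if_neg hm0, if_pos hm1, if_pos ((hρmem _).2 hm0), if_neg (fun h => (hρmem _).1 h hm1), if_neg hm0, if_pos hm1,
      hχmul, hχmul, hχ, hχpow]
    push_cast; ring
  · rw [if_neg hm0, if_neg hm1, if_pos ((hρmem _).2 hm0), if_pos ((hρmem _).2 hm1), if_neg hm0, if_neg hm1, hχmul, hχmul,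
      hχmul, hχ, hχpow]
    push_cast; ring

/-- The `±1` bookkeeping behind Prop. 4.3/4.4: for signs `e₀ e₁ e₀' e₁' σ = ±1`, `e₀ + σ e₁ = e₀' + σ e₁'` forces `e₀ e₁ = e₀' e₁'`.
[folklore] -/
private theorem sign_prod_eq_of_sum_eq {e₀ e₁ e₀' e₁' σ : ℤ} (h₀ : e₀ = 1 ∨ e₀ = -1) (h₁ : e₁ = 1 ∨ e₁ = -1)
    (h₀' : e₀' = 1 ∨ e₀' = -1) (h₁' : e₁' = 1 ∨ e₁' = -1) (hσ : σ = 1 ∨ σ = -1)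
    (h : e₀ + σ * e₁ = e₀' + σ * e₁') : e₀ * e₁ = e₀' * e₁' := by
  rcases h₀ with rfl | rfl <;> rcases h₁ with rfl | rfl <;> rcases h₀' with rfl | rfl <;> rcases h₁' with rfl | rfl <;>
    rcases hσ with rfl | rfl <;> omega

/-- `±1` bookkeeping: for signs `a b`, `ab = 1 ⟹ b = a` and `ab = −1 ⟹ b = −a`. [folklore] -/
private theorem sign_eq_or_eq_neg_of_mul {a b : ℤ} (ha : a = 1 ∨ a = -1) (hb : b = 1 ∨ b = -1) :
    (a * b = 1 → b = a) ∧ (a * b = -1 → b = -a) := by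
  rcases ha with rfl | rfl <;> rcases hb with rfl | rfl <;> constructor <;> intro h <;> omega

omit [DecidableEq G] in
/-- Every element of `G` is `τ^c`, `sτ^c`, `ρτ^c` or `ρsτ^c`. [folklore] -/
private theorem exists_eq_coord [hp : Fact p.Prime] (hp2 : p ≠ 2) (hG : Fintype.card G = 4 * p) (hρ1 : ρ ≠ 1)
    (hρ2 : ρ * ρ = 1) (hs1 : s ≠ 1) (hs2 : s * s = 1) (hsρ : s ≠ ρ) (hτ : orderOf τ = p) (g : G) :
    ∃ c : ZMod p, (g = τ ^ c.val ∨ g = s * τ ^ c.val) ∨ (ρ * g = τ ^ c.val ∨ ρ * g = s * τ ^ c.val) := by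
  obtain ⟨⟨a, i, c⟩, rfl⟩ := (coord_bijective hp2 hG hρ1 hρ2 hs1 hs2 hsρ hτ).2 g
  refine ⟨c, ?_⟩
  obtain ⟨a, ha⟩ := a
  obtain ⟨i, hi⟩ := i
  dsimp only
  interval_cases a <;> interval_cases i
  · left; left; rw [pow_zero, pow_zero, one_mul, one_mul]
  · left; right; rw [pow_zero, pow_one, one_mul]
  · right; left; rw [pow_one, pow_zero, one_mul, ← mul_assoc, hρ2, one_mul]
  · right; right; rw [pow_one, pow_one, ← mul_assoc, hρ2, one_mul]

omit [Fintype G] [DecidableEq G] in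
/-- Stability under `u` may be tested on a half system `R` (`R ∪ ρR = G`): on `ρr` it follows from `r` (`ρg ∈ T ⟺ g ∉ T`).
[cite: Hazama2003CyclicCM, Prop. 2.3] -/
private theorem isStableUnder_of_forall {T : Finset G} (hT : IsCMTypeWith ρ (T : Set G)) {u : G} (R : G → Prop)
    (hR : ∀ g : G, R g ∨ R (ρ * g)) (h : ∀ r : G, R r → (r ∈ T ↔ u * r ∈ T)) : IsStableUnder T u := by
  have hρmem : ∀ g : G, ρ * g ∈ T ↔ g ∉ T := rho_mul_mem_iff hT
  intro g
  rcases hR g with hg | hg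
  · exact h g hg
  · have h' := h (ρ * g) hg
    rw [mul_left_comm, hρmem, hρmem, not_iff_not] at h'
    exact h'

/-- **KEY LEMMA (Hazama's Prop. 4.3 ∕ Lemma 4.6.1 for `ℤ/2 × ℤ/2p`).  An ODD character `χ` of `G = ⟨ρ⟩ × ⟨s⟩ × ⟨τ⟩` which is
NON-TRIVIAL on `τ` (i.e. of order `2p`) and vanishes on a CM type `T` forces `T` to be STABLE under `s` or under `ρs`** — in
either case under an element `≠ 1`.  Proof: `χ(T) = Σ_c (ε₀(c) + χ(s) ε₁(c)) χ(τ)^c` with `χ(τ)` a primitive `p`-th root of unity,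
so the integers `ε₀(c) + χ(s) ε₁(c)` are all equal (the only rational relation among `1, ζ, …, ζ^{p−1}`), whence the products
`ε₀(c) ε₁(c)` are constant: `+1` means `sT = T`, `−1` means `ρsT = T`. [cite: Hazama2003CyclicCM, Prop. 4.3, Lemma 4.6.1 and Prop. 2.3]
[cite: Kubota1965, §4 Lemma 2] -/
theorem isStableUnder_or_of_sum_eq_zero [hp : Fact p.Prime] (hp2 : p ≠ 2) (hG : Fintype.card G = 4 * p) (hρ1 : ρ ≠ 1)
    (hρ2 : ρ * ρ = 1) (hs1 : s ≠ 1) (hs2 : s * s = 1) (hsρ : s ≠ ρ) (hτ : orderOf τ = p) {T : Finset G}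
    (hT : IsCMTypeWith ρ (T : Set G)) (χ : AddChar (Additive G) ℂ) (hχ : χ (Additive.ofMul ρ) = -1)
    (hχτ : χ (Additive.ofMul τ) ≠ 1) (h0 : ∑ t ∈ T, χ (Additive.ofMul t) = 0) :
    IsStableUnder T s ∨ IsStableUnder T (ρ * s) := by
  have hρmem : ∀ g : G, ρ * g ∈ T ↔ g ∉ T := rho_mul_mem_iff hT
  -- `χ(s) = ±1`, `χ(τ)` a primitive `p`-th root of unity
  have hσ2 : χ (Additive.ofMul s) * χ (Additive.ofMul s) = 1 := by
    rw [← AddChar.map_add_eq_mul, ← ofMul_mul, hs2, ofMul_one, AddChar.map_zero_eq_one]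
  have hσ : χ (Additive.ofMul s) = 1 ∨ χ (Additive.ofMul s) = -1 := mul_self_eq_one_iff.1 hσ2
  have hζp : χ (Additive.ofMul τ) ^ p = 1 := by
    rw [← AddChar.map_nsmul_eq_pow, ← ofMul_pow, ← hτ, pow_orderOf_eq_one, ofMul_one, AddChar.map_zero_eq_one]
  have hζ : IsPrimitiveRoot (χ (Additive.ofMul τ)) p := isPrimitiveRoot_of_pow_prime_eq_one' hp.out hζp hχτ
  obtain ⟨σZ, hσZ, hσZ'⟩ : ∃ σZ : ℤ, (σZ = 1 ∨ σZ = -1) ∧ (σZ : ℂ) = χ (Additive.ofMul s) := by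
    rcases hσ with h | h
    · exact ⟨1, Or.inl rfl, by rw [h, Int.cast_one]⟩
    · exact ⟨-1, Or.inr rfl, by rw [h, Int.cast_neg, Int.cast_one]⟩
  -- the signs
  set ε₀ : ZMod p → ℤ := fun c => if τ ^ c.val ∈ T then 1 else -1 with hε₀_def
  set ε₁ : ZMod p → ℤ := fun c => if s * τ ^ c.val ∈ T then 1 else -1 with hε₁_def
  have hε₀pm : ∀ c, ε₀ c = 1 ∨ ε₀ c = -1 := fun c => by simp only [hε₀_def]; split_ifs <;> simp
  have hε₁pm : ∀ c, ε₁ c = 1 ∨ ε₁ c = -1 := fun c => by simp only [hε₁_def]; split_ifs <;> simp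
  have hmem₀ : ∀ c, τ ^ c.val ∈ T ↔ ε₀ c = 1 := fun c => by simp only [hε₀_def]; split_ifs with h <;> simp [h]
  have hmem₁ : ∀ c, s * τ ^ c.val ∈ T ↔ ε₁ c = 1 := fun c => by simp only [hε₁_def]; split_ifs with h <;> simp [h]
  -- the sum: `Σ_c (ε₀(c) + σ ε₁(c)) ζ^c = 0`
  have hsum := sum_char_eq_sum_sign hp2 hG hρ1 hρ2 hs1 hs2 hsρ hτ hT χ hχ
  rw [h0] at hsum
  have hsum' : ∑ c : ZMod p, ((ε₀ c + σZ * ε₁ c : ℤ) : ℂ) * χ (Additive.ofMul τ) ^ c.val = 0 := by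
    rw [hsum]
    refine Finset.sum_congr rfl fun c _ => ?_
    simp only [hε₀_def, hε₁_def]
    push_cast
    rw [hσZ']
  have hconst : ∀ c, ε₀ c + σZ * ε₁ c = ε₀ 0 + σZ * ε₁ 0 := by
    have h := eq_of_sum_mul_pow_eq_zero hζ (fun c => ((ε₀ c + σZ * ε₁ c : ℤ) : ℚ)) (by push_cast at hsum' ⊢; exact hsum')
    intro c; exact_mod_cast h c
  have hprod : ∀ c, ε₀ c * ε₁ c = ε₀ 0 * ε₁ 0 := fun c =>
    sign_prod_eq_of_sum_eq (hε₀pm c) (hε₁pm c) (hε₀pm 0) (hε₁pm 0) hσZ (hconst c)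
  have hforms := exists_eq_coord hp2 hG hρ1 hρ2 hs1 hs2 hsρ hτ
  have hR : ∀ g : G, (∃ c : ZMod p, g = τ ^ c.val ∨ g = s * τ ^ c.val) ∨
      ∃ c : ZMod p, ρ * g = τ ^ c.val ∨ ρ * g = s * τ ^ c.val := fun g => by
    obtain ⟨c, h | h⟩ := hforms g
    · exact Or.inl ⟨c, h⟩
    · exact Or.inr ⟨c, h⟩
  rcases hε₀pm 0 with h00 | h00 <;> rcases hε₁pm 0 with h10 | h10 <;> rw [h00, h10] at hprod <;> norm_num at hprod
  -- four cases according to the signs at `c = 0`; products `+1`: `ε₁ = ε₀` (stable under `s`); `−1`: `ε₁ = −ε₀` (under `ρs`)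
  case inl.inl | inr.inr =>
    have heq : ∀ c, ε₁ c = ε₀ c := fun c => ((sign_eq_or_eq_neg_of_mul (hε₀pm c) (hε₁pm c)).1 (hprod c))
    left
    refine isStableUnder_of_forall hT (fun g => ∃ c : ZMod p, g = τ ^ c.val ∨ g = s * τ ^ c.val) hR fun r hr => ?_
    obtain ⟨c, rfl | rfl⟩ := hr
    · rw [hmem₀, hmem₁, heq]
    · rw [← mul_assoc, hs2, one_mul, hmem₀, hmem₁, heq]
  case inl.inr | inr.inl =>
    have heq : ∀ c, ε₁ c = -ε₀ c := fun c => ((sign_eq_or_eq_neg_of_mul (hε₀pm c) (hε₁pm c)).2 (hprod c))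
    right
    refine isStableUnder_of_forall hT (fun g => ∃ c : ZMod p, g = τ ^ c.val ∨ g = s * τ ^ c.val) hR fun r hr => ?_
    obtain ⟨c, rfl | rfl⟩ := hr
    · rw [mul_assoc, hρmem, hmem₀, hmem₁, heq]
      rcases hε₀pm c with h | h <;> rw [h] <;> norm_num
    · rw [mul_assoc, ← mul_assoc s s, hs2, one_mul, hρmem, hmem₀, hmem₁, heq]
      rcases hε₀pm c with h | h <;> rw [h] <;> norm_num

/-- **Prop. 4.2 for `ℤ/2 × ℤ/2p`: the two QUADRATIC odd characters (`χ(τ) = 1`, `χ(s) = ±1`) do not BOTH vanish on a CM type**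
(their sum `2 Σ_c ε₀(c)` is twice a sum of `p` — odd — signs). [cite: Hazama2003CyclicCM, Prop. 4.2] [cite: Kubota1965, §4 Lemma 2] -/
theorem not_sum_eq_zero_and_of_quadratic [hp : Fact p.Prime] (hp2 : p ≠ 2) (hG : Fintype.card G = 4 * p) (hρ1 : ρ ≠ 1)
    (hρ2 : ρ * ρ = 1) (hs1 : s ≠ 1) (hs2 : s * s = 1) (hsρ : s ≠ ρ) (hτ : orderOf τ = p) {T : Finset G}
    (hT : IsCMTypeWith ρ (T : Set G)) (χ χ' : AddChar (Additive G) ℂ) (hχ : χ (Additive.ofMul ρ) = -1)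
    (hχ' : χ' (Additive.ofMul ρ) = -1) (hχτ : χ (Additive.ofMul τ) = 1) (hχ'τ : χ' (Additive.ofMul τ) = 1)
    (hχs : χ (Additive.ofMul s) = 1) (hχ's : χ' (Additive.ofMul s) = -1) :
    ¬ (∑ t ∈ T, χ (Additive.ofMul t) = 0 ∧ ∑ t ∈ T, χ' (Additive.ofMul t) = 0) := by
  rintro ⟨h0, h0'⟩
  set ε₀ : ZMod p → ℤ := fun c => if τ ^ c.val ∈ T then 1 else -1 with hε₀_def
  set ε₁ : ZMod p → ℤ := fun c => if s * τ ^ c.val ∈ T then 1 else -1 with hε₁_def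
  have hsum := sum_char_eq_sum_sign hp2 hG hρ1 hρ2 hs1 hs2 hsρ hτ hT χ hχ
  have hsum' := sum_char_eq_sum_sign hp2 hG hρ1 hρ2 hs1 hs2 hsρ hτ hT χ' hχ'
  rw [h0, hχτ, hχs] at hsum
  rw [h0', hχ'τ, hχ's] at hsum'
  simp only [one_pow, mul_one, one_mul] at hsum hsum'
  -- `Σ (ε₀ + ε₁) = 0`, `Σ (ε₀ − ε₁) = 0` ⟹ `Σ ε₀ = 0`
  have hA : (∑ c : ZMod p, (ε₀ c : ℂ)) = 0 := by
    have h : (∑ c : ZMod p, ((ε₀ c : ℂ) + (ε₁ c : ℂ))) + ∑ c : ZMod p, ((ε₀ c : ℂ) + -1 * (ε₁ c : ℂ)) = 0 := by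
      rw [← hsum, ← hsum', add_zero]
    rw [← Finset.sum_add_distrib] at h
    have h2 : ∑ c : ZMod p, (2 : ℂ) * (ε₀ c : ℂ) = 0 := by
      rw [← h]; exact Finset.sum_congr rfl fun c _ => by ring
    rw [← Finset.mul_sum] at h2
    exact (mul_eq_zero.1 h2).resolve_left two_ne_zero
  have hZ : (∑ c : ZMod p, ε₀ c) = 0 := by exact_mod_cast hA
  have h2 : ∀ c, ε₀ c = 2 * (if τ ^ c.val ∈ T then (1 : ℤ) else 0) - 1 := fun c => by
    simp only [hε₀_def]; split_ifs <;> norm_num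
  rw [Finset.sum_congr rfl (fun c _ => h2 c), Finset.sum_sub_distrib, ← Finset.mul_sum, Finset.sum_const,
    Finset.card_univ, ZMod.card, nsmul_eq_mul, mul_one] at hZ
  have hdvd : (2 : ℤ) ∣ (p : ℤ) := ⟨_, (sub_eq_zero.1 hZ).symm⟩
  have hdvd' : 2 ∣ p := by exact_mod_cast hdvd
  exact hp2 ((hp.out.eq_one_or_self_of_dvd 2 hdvd').resolve_left (by norm_num)).symm

/-- **For a type with NO non-trivial stabiliser (a PRIMITIVE type), every vanishing odd character is trivial on `τ`** (hence
quadratic): the order-`2p` characters kill only imprimitive types. [cite: Hazama2003CyclicCM, Prop. 2.3 and Thm. 4.8 (iii)–(v)] -/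
theorem char_tau_eq_one_of_sum_eq_zero_of_primitive [hp : Fact p.Prime] (hp2 : p ≠ 2) (hG : Fintype.card G = 4 * p)
    (hρ1 : ρ ≠ 1) (hρ2 : ρ * ρ = 1) (hs1 : s ≠ 1) (hs2 : s * s = 1) (hsρ : s ≠ ρ) (hτ : orderOf τ = p) {T : Finset G}
    (hT : IsCMTypeWith ρ (T : Set G)) (hprim : ∀ u : G, u ≠ 1 → ¬ IsStableUnder T u) (χ : AddChar (Additive G) ℂ)
    (hχ : χ (Additive.ofMul ρ) = -1) (h0 : ∑ t ∈ T, χ (Additive.ofMul t) = 0) : χ (Additive.ofMul τ) = 1 := by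
  by_contra hχτ
  rcases isStableUnder_or_of_sum_eq_zero hp2 hG hρ1 hρ2 hs1 hs2 hsρ hτ hT χ hχ hχτ h0 with h | h
  · exact hprim s hs1 h
  · refine hprim (ρ * s) (fun h1 => hsρ ?_) h
    have := congrArg (ρ * ·) h1
    simp only [← mul_assoc, hρ2, one_mul, mul_one] at this
    exact this

/-- **… and at most ONE odd character vanishes on a primitive type** (two distinct odd characters trivial on `τ` take the values
`+1, −1` at `s`, and the two quadratic odd characters do not both vanish). [cite: Hazama2003CyclicCM, Prop. 4.2 and Thm. 4.8]
[cite: Kubota1965, §4 Lemma 2] -/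
theorem eq_of_sum_eq_zero_of_primitive [hp : Fact p.Prime] (hp2 : p ≠ 2) (hG : Fintype.card G = 4 * p) (hρ1 : ρ ≠ 1)
    (hρ2 : ρ * ρ = 1) (hs1 : s ≠ 1) (hs2 : s * s = 1) (hsρ : s ≠ ρ) (hτ : orderOf τ = p) {T : Finset G}
    (hT : IsCMTypeWith ρ (T : Set G)) (hprim : ∀ u : G, u ≠ 1 → ¬ IsStableUnder T u) (χ χ' : AddChar (Additive G) ℂ)
    (hχ : χ (Additive.ofMul ρ) = -1) (hχ' : χ' (Additive.ofMul ρ) = -1) (h0 : ∑ t ∈ T, χ (Additive.ofMul t) = 0)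
    (h0' : ∑ t ∈ T, χ' (Additive.ofMul t) = 0) : χ = χ' := by
  have hτ1 := char_tau_eq_one_of_sum_eq_zero_of_primitive hp2 hG hρ1 hρ2 hs1 hs2 hsρ hτ hT hprim χ hχ h0
  have hτ1' := char_tau_eq_one_of_sum_eq_zero_of_primitive hp2 hG hρ1 hρ2 hs1 hs2 hsρ hτ hT hprim χ' hχ' h0'
  have hσ2 : ∀ ψ : AddChar (Additive G) ℂ, ψ (Additive.ofMul s) = 1 ∨ ψ (Additive.ofMul s) = -1 := fun ψ =>
    mul_self_eq_one_iff.1 (by rw [← AddChar.map_add_eq_mul, ← ofMul_mul, hs2, ofMul_one, AddChar.map_zero_eq_one])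
  have hbij := coord_bijective hp2 hG hρ1 hρ2 hs1 hs2 hsρ hτ
  by_cases hs : χ (Additive.ofMul s) = χ' (Additive.ofMul s)
  · refine AddChar.ext _ _ fun x => ?_
    obtain ⟨⟨a, i, c⟩, hx⟩ := hbij.2 (Additive.toMul x)
    have hx' : x = Additive.ofMul (ρ ^ (a : ℕ) * (s ^ (i : ℕ) * τ ^ c.val)) := by
      dsimp only at hx
      rw [hx, ofMul_toMul]
    rw [hx', char_coord, char_coord, hχ, hχ', hs, hτ1, hτ1']
  · exfalso
    rcases hσ2 χ with h1 | h1 <;> rcases hσ2 χ' with h2 | h2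
    · exact hs (h1.trans h2.symm)
    · exact not_sum_eq_zero_and_of_quadratic hp2 hG hρ1 hρ2 hs1 hs2 hsρ hτ hT χ χ' hχ hχ' hτ1 hτ1' h1 h2 ⟨h0, h0'⟩
    · exact not_sum_eq_zero_and_of_quadratic hp2 hG hρ1 hρ2 hs1 hs2 hsρ hτ hT χ' χ hχ' hχ hτ1' hτ1 h2 h1 ⟨h0', h0⟩
    · exact hs (h1.trans h2.symm)

end Group

/-! ## §2 Abelian non-cyclic CM fields of degree `4p`: corank `≤ 1`, the dichotomy for simple varieties, the imprimitive types -/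

section Field

open NumberField
open Literature.AlgebraicTopology.SingularHomology
open Literature.AlgebraicGeometry.Motives (AbelianVariety CMType)
open Literature.AlgebraicGeometry.HodgeTheory
open Literature.AlgebraicGeometry.ComplexMultiplication (IsCMTypeRealisation isSimple_iff_isPrimitive
  isPrimitive_ringEquiv_complex_iff)
open Literature.AlgebraicGeometry.VanGeemen1994 (hodgeClassSpan)
open Literature.Barriers.HodgeConjecture (divisorClassesSpan)
open Literature.AlgebraicGeometry.Pohlmann1968
open _root_.CategoryTheory _root_.CategoryTheory.Limits

variable {K : Type} [Field K] [NumberField K] [IsCMField K] [IsAbelianGalois ℚ K] {p : ℕ}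

omit [IsCMField K] in
/-- `|Gal(K/ℚ)| = [K : ℚ]`. [folklore] -/
private theorem card_gal_eq_finrank : Fintype.card (K ≃ₐ[ℚ] K) = Module.finrank ℚ K := by
  obtain ⟨φ₀⟩ := (inferInstance : Nonempty (K →+* ℂ))
  rw [Fintype.card_congr (Equiv.ofBijective (embOf φ₀) (embOf_bijective φ₀)), NumberField.Embeddings.card]

/-- `ρ ≠ 1` on a CM field. [cite: Shimura1998, §18.2 Lemma (i)] -/
private theorem conjGal_ne_one₆₃ : (conjGal : K ≃ₐ[ℚ] K) ≠ 1 := by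
  intro h
  apply IsCMField.complexConj_ne_one K
  ext x
  have hx := AlgEquiv.congr_fun h x
  rw [conjGal_apply] at hx
  exact hx

/-- **The frame of a non-cyclic abelian CM field of degree `4p`**: `Gal(K/ℚ) ∋ ρ` (complex conjugation, `ρ ≠ 1 = ρ²`), an
involution `s ∉ {1, ρ}` and an element `τ` of order `p` — `Gal(K/ℚ) = ⟨ρ⟩ × ⟨s⟩ × ⟨τ⟩ ≅ ℤ/2 × ℤ/2p`.
[cite: Dodson1984, §3.2.1] [cite: Hazama2003CyclicCM, §4] -/
theorem exists_frame_of_not_isCyclic (hp : p.Prime) (hp2 : p ≠ 2) (hK : Module.finrank ℚ K = 4 * p)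
    (hnc : ¬ IsCyclic (K ≃ₐ[ℚ] K)) :
    Fintype.card (K ≃ₐ[ℚ] K) = 4 * p ∧ (conjGal : K ≃ₐ[ℚ] K) ≠ 1 ∧ (conjGal : K ≃ₐ[ℚ] K) * conjGal = 1 ∧
      ∃ s τ : K ≃ₐ[ℚ] K, s ≠ 1 ∧ s * s = 1 ∧ s ≠ conjGal ∧ orderOf τ = p := by
  haveI := Fact.mk hp
  have hG : Fintype.card (K ≃ₐ[ℚ] K) = 4 * p := card_gal_eq_finrank.trans hK
  have hρ1 : (conjGal : K ≃ₐ[ℚ] K) ≠ 1 := conjGal_ne_one₆₃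
  have hρ2 : (conjGal : K ≃ₐ[ℚ] K) * conjGal = 1 := conjGal_mul_conjGal
  obtain ⟨s, hs2, hs1, hsρ⟩ := exists_involution_ne hp2 hG hnc hρ1 hρ2
  obtain ⟨τ, hτ⟩ := exists_prime_orderOf_dvd_card (G := K ≃ₐ[ℚ] K) p (by rw [hG]; exact dvd_mul_left p 4)
  exact ⟨hG, hρ1, hρ2, s, τ, hs1, hs2, hsρ, hτ⟩

/-- **THEOREM (corank `≤ 1`).  Every PRIMITIVE CM type `Φ` of an abelian CM field `K` of degree `4p` (`p` an odd prime) with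
NON-CYCLIC Galois group has Kubota rank `≥ 2p = [K:ℚ]/2`**, i.e. `dim MT(A_Φ) ≥ dim A_Φ`: by §1 at most ONE odd character of
`Gal(K/ℚ)` vanishes on the type (Kubota's Lemma 2: the defect is the number of vanishing odd characters).  Dodson's examples
`ℤ/2 × ℤ/6` (`n = 6`) and Hazama's count for `ℤ/2 × ℤ/2p` are the degenerate (rank `2p`) instances. [cite: Kubota1965, §4 Lemma 2]
[cite: Hazama2003CyclicCM, Thm. 4.8 and Prop. 4.2, 4.3] [cite: Dodson1984, §3.2.1] [cite: Dodson1987, Thm. 1.0 (ii) and §1.1] -/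
theorem finrank_div_two_le_cmTypeRank_of_isPrimitive (hp : p.Prime) (hp2 : p ≠ 2) (hK : Module.finrank ℚ K = 4 * p)
    (hnc : ¬ IsCyclic (K ≃ₐ[ℚ] K)) (Φ : CMType K) (φ₀ : K →+* ℂ) (hprim : IsPrimitive (ℂ ≃+* ℂ) Φ.1 φ₀) :
    Module.finrank ℚ K / 2 ≤ cmTypeRank Φ := by
  classical
  haveI := Fact.mk hp
  obtain ⟨hG, hρ1, hρ2, s, τ, hs1, hs2, hsρ, hτ⟩ := exists_frame_of_not_isCyclic hp hp2 hK hnc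
  have hcomm : ∀ g h : K ≃ₐ[ℚ] K, g * h = h * g := fun g h => mul_comm g h
  have hρ : ∀ x, φ₀ ((conjGal : K ≃ₐ[ℚ] K) x) = starRingEnd ℂ (φ₀ x) := fun x =>
    IsCMField.complexEmbedding_complexConj K φ₀ x
  set T : Finset (K ≃ₐ[ℚ] K) := Finset.univ.filter fun g : K ≃ₐ[ℚ] K => embOf φ₀ g ∈ Φ.1 with hT
  have hset : ({g : K ≃ₐ[ℚ] K | embOf φ₀ g ∈ Φ.1} : Set (K ≃ₐ[ℚ] K)) = ↑T := by
    ext g; simp [hT]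
  have hcm := isCMTypeWith_gal hcomm Φ φ₀ conjGal hρ
  rw [hset] at hcm
  have hprim' : ∀ u : K ≃ₐ[ℚ] K, u ≠ 1 → ¬ IsStableUnder T u :=
    (CyclicTwoOddPrimes.isPrimitive_iff (φ₀ := φ₀) Φ φ₀).1 hprim
  -- at most ONE odd character vanishes on `T` (§1)
  have hsub : ({χ : AddChar (Additive (K ≃ₐ[ℚ] K)) ℂ | χ (Additive.ofMul (conjGal : K ≃ₐ[ℚ] K)) = -1 ∧
      ∑ g ∈ T, χ (Additive.ofMul g) = 0}).ncard ≤ 1 := by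
    rw [Set.ncard_le_one_iff (Set.toFinite _)]
    intro χ χ' hχ hχ'
    exact eq_of_sum_eq_zero_of_primitive hp2 hG hρ1 hρ2 hs1 hs2 hsρ hτ hcm hprim' χ χ' hχ.1 hχ'.1 hχ.2 hχ'.2
  -- Kubota's Lemma 2: `rank + #{vanishing odd} = #{odd} + 1`, `2 · #{odd} = |G| = 4p`
  have hdef : typeRank (K ≃ₐ[ℚ] K) (↑T : Set (K ≃ₐ[ℚ] K)) +
      ({χ : AddChar (Additive (K ≃ₐ[ℚ] K)) ℂ | χ (Additive.ofMul (conjGal : K ≃ₐ[ℚ] K)) = -1 ∧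
        ∑ g ∈ T, χ (Additive.ofMul g) = 0}).ncard =
      ({χ : AddChar (Additive (K ≃ₐ[ℚ] K)) ℂ | χ (Additive.ofMul (conjGal : K ≃ₐ[ℚ] K)) = -1}).ncard + 1 :=
    hcm.typeRank_add_ncard_oddCharacters_vanishing
  have hhalf : 2 * ({χ : AddChar (Additive (K ≃ₐ[ℚ] K)) ℂ | χ (Additive.ofMul (conjGal : K ≃ₐ[ℚ] K)) = -1}).ncard =
      4 * p := by
    have h := two_mul_ncard_oddCharacters_eq_card (G := K ≃ₐ[ℚ] K) hρ1 hρ2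
    rw [hG] at h
    exact h
  have hle : Module.finrank ℚ K / 2 ≤ typeRank (K ≃ₐ[ℚ] K) (↑T : Set (K ≃ₐ[ℚ] K)) := by
    rw [hK]; omega
  rw [cmTypeRank_eq_typeRank_gal hcomm Φ φ₀, hset]
  exact hle

/-- **Rank form: a primitive type has Kubota rank `2p` or `2p + 1`** (`dim MT(A) ∈ {dim A, dim A + 1}`), the latter meaning
nondegenerate. [cite: Kubota1965, §2 (p. 115) and §4 Lemma 2] [cite: Dodson1987, Thm. 1.0 (ii)] [cite: Hazama2003CyclicCM, Thm. 4.8] -/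
theorem cmTypeRank_eq_or_of_isPrimitive (hp : p.Prime) (hp2 : p ≠ 2) (hK : Module.finrank ℚ K = 4 * p)
    (hnc : ¬ IsCyclic (K ≃ₐ[ℚ] K)) (Φ : CMType K) (φ₀ : K →+* ℂ) (hprim : IsPrimitive (ℂ ≃+* ℂ) Φ.1 φ₀) :
    (cmTypeRank Φ = 2 * p ∧ ¬ IsNondegenerate Φ) ∨ (cmTypeRank Φ = 2 * p + 1 ∧ IsNondegenerate Φ) := by
  have h1 := finrank_div_two_le_cmTypeRank_of_isPrimitive hp hp2 hK hnc Φ φ₀ hprim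
  have h2 := cmTypeRank_le Φ
  have h3 : IsNondegenerate Φ ↔ cmTypeRank Φ = Module.finrank ℚ K / 2 + 1 := isNondegenerate_iff Φ
  rw [hK] at h1 h2 h3
  have h4 : 4 * p / 2 = 2 * p := by omega
  rw [h4] at h1 h2 h3
  by_cases hnd : IsNondegenerate Φ
  · exact Or.inr ⟨h3.1 hnd, hnd⟩
  · refine Or.inl ⟨?_, hnd⟩
    rw [h3] at hnd
    omega

variable {Φ : CMType K} {A : AbelianVariety ℂ} {ι : 𝓞 K →+* End A} {θ : K →+* Module.End ℂ (complexBetti A.X 1)}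

/-- **THE DICHOTOMY FOR SIMPLE ABELIAN VARIETIES WITH COMPLEX MULTIPLICATION BY AN ABELIAN, NON-CYCLIC CM FIELD OF DEGREE `4p`**
(Gordon 5.13 in dimension `2p`; every realisation `(A, ι, θ)` of a primitive type `Φ`).  EITHER (i) `Φ` is nondegenerate, and then
`B•(Aⁿ) ⊗ ℂ = D•(Aⁿ) ⊗ ℂ` and the Hodge conjecture hold for every power `Aⁿ`, UNCONDITIONALLY; OR (ii) `Φ` has rank `2p` exactly,
`K ⊇ k = ℚ(w)`, `w = √-d ∈ 𝓞_K` (`d ≥ 1`), `k` imaginary quadratic acting with multiplicities `(p, p)`, `(A, ι w)` is of WEIL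
TYPE `(p, d)`, `Bᵠ(A) ⊗ ℂ = Dᵠ(A) ⊗ ℂ` for `q ≠ p`, `Bᵖ(A) ⊗ ℂ = Dᵖ(A) ⊗ ℂ ⊔ W_k ⊗ ℂ`, and the Hodge conjecture for `A` AND ALL ITS
POWERS follows from the algebraicity of the rational `(p,p)` classes of that ONE Weil plane (Weil's question for one variety; NOT
claimed).  The tree's `CorankOne` theorems, made unconditional in their rank hypothesis by `finrank_div_two_le_cmTypeRank_of_isPrimitive`.
[cite: Gordon1999HodgeAVSurvey, 5.13 (i)–(ii) and Thm. 6.4 and 9.5] [cite: vanGeemen1994HodgeAV, 4.7 and Thm. 4.11 and Thm. 6.12]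
[cite: Milne2020HodgeClassesAV, Thm. 1] [cite: Hazama2003CyclicCM, Thm. 4.8] -/
theorem hodgeConjectureFor_pow_or_weilType_of_isPrimitive (hp : p.Prime) (hp2 : p ≠ 2) (hK : Module.finrank ℚ K = 4 * p)
    (hnc : ¬ IsCyclic (K ≃ₐ[ℚ] K)) (φ₀ : K →+* ℂ) (hprim : IsPrimitive (ℂ ≃+* ℂ) Φ.1 φ₀)
    (hA : IsCMTypeRealisation Φ A ι θ) :
    (IsNondegenerate Φ ∧
        (∀ n m : ℕ, hodgeClassSpan (⨁ fun _ : Fin n => A).dim (⨁ fun _ : Fin n => A).X m =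
          divisorClassesSpan (⨁ fun _ : Fin n => A).X (⨁ fun _ : Fin n => A).dim m) ∧
        ∀ n : ℕ, HodgeConjectureFor (⨁ fun _ : Fin n => A).dim (⨁ fun _ : Fin n => A).X) ∨
      (cmTypeRank Φ = 2 * p ∧ ¬ IsNondegenerate Φ ∧
        (∀ q : ℕ, q ≠ p → hodgeClassSpan A.dim A.X q = divisorClassesSpan A.X A.dim q) ∧
        ∃ (k : IntermediateField ℚ K) (w : 𝓞 K) (d : ℕ), Module.finrank ℚ k = 2 ∧ (w : K) ∈ k ∧
          (∀ t : k →+* ℂ, {φ : K →+* ℂ | φ.comp (algebraMap k K) = t ∧ φ ∈ Φ.1}.ncard =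
            {φ : K →+* ℂ | φ.comp (algebraMap k K) = t ∧ φ ∉ Φ.1}.ncard) ∧
          0 < d ∧ w ^ 2 = -(d : 𝓞 K) ∧ IsWeilType A (ι w) p d ∧ IsDivisorWeilGenerated A (ι w) p d ∧
          hodgeClassSpan A.dim A.X p = divisorClassesSpan A.X A.dim p ⊔ weilClassesOf A (ι w) p d ∧
          ((∀ c ∈ weilClassesOf A (ι w) p d, IsRationalClass c → IsOfHodgeType (2 * p) A.X (2 * p) p p c →
              c ∈ algebraicClasses A.X p) →
            HodgeConjectureFor A.dim A.X ∧
              ∀ n : ℕ, HodgeConjectureFor (⨁ fun _ : Fin n => A).dim (⨁ fun _ : Fin n => A).X)) := by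
  have hrank := finrank_div_two_le_cmTypeRank_of_isPrimitive hp hp2 hK hnc Φ φ₀ hprim
  have hdimK : A.dim = Module.finrank ℚ K / 2 := Motives.schemeDim_eq_holds hA.1
  rcases cmTypeRank_eq_or_of_isPrimitive hp hp2 hK hnc Φ φ₀ hprim with ⟨hr, hΦ⟩ | ⟨-, hΦ⟩
  · right
    refine ⟨hr, hΦ, fun q hq => ?_, ?_⟩
    · have hq' : 4 * q ≠ Module.finrank ℚ K := by rw [hK]; omega
      rw [hdimK]
      exact CorankOne.hodgeClassSpan_eq_divisorClassesSpan_of_ne hrank φ₀ hprim hA hq'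
    · obtain ⟨p', Δ, hp4, hΔ⟩ := CorankOne.exists_mem_pohlmannSets_diff_of_not_isNondegenerate hrank φ₀ hprim hΦ
      have hpp : p' = p := by rw [hK] at hp4; omega
      subst hpp
      obtain ⟨k, w, d, hk2, hwk, hmult, hd, hw2, hw⟩ := CorankOne.exists_sqrt_neg_of_mem_pohlmannSets_diff hrank φ₀ hprim hΔ
      have hWT := (CorankOne.cmEigenclasses_le_weilClassesOf_and_isWeilType hA hp4 hp.pos hΔ.1 hd hw2
        fun s hs => (hw s).1 hs).2
      refine ⟨k, w, d, hk2, hwk, hmult, hd, hw2, hWT, CorankOne.isDivisorWeilGenerated hrank φ₀ hprim hA hΔ hd hw2 hw,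
        ?_, fun hW => ⟨CorankOne.hodgeConjectureFor_of_weilClasses_algebraic hrank φ₀ hprim hA hΔ hd hw2 hw hW, fun n =>
          CorankOne.hodgeConjectureFor_pow_of_weilClasses_algebraic hrank φ₀ hprim hA hΔ hd hw2 hw hW n⟩⟩
      rw [hdimK]
      exact CorankOne.hodgeClassSpan_eq_divisorClassesSpan_sup_weilClassesOf hrank φ₀ hprim hA hΔ hd hw2 hw
  · exact Or.inl ⟨hΦ, fun n m => hΦ.hodgeClassSpan_pow_eq_divisorClassesSpan hA n m, fun n => hΦ.hodgeConjectureFor_pow hA n⟩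

/-- **The Hodge conjecture for ALL POWERS of every SIMPLE abelian variety with complex multiplication by an abelian non-cyclic CM
field of degree `4p`, MODULO the imaginary-quadratic rung of the Weil-type ladder in dimension `2p`** (for `p = 2` this rung is
Markman's theorem and the statement is the tree's octic theorem; here `p` odd). [cite: vanGeemen1994HodgeAV, 1.1 and Thm. 6.12]
[cite: Gordon1999HodgeAVSurvey, 9.5] [cite: Milne2020HodgeClassesAV, Thm. 1] -/
theorem hodgeConjectureFor_pow_of_isPrimitive_of_weilClasses (hp : p.Prime) (hp2 : p ≠ 2)
    (hK : Module.finrank ℚ K = 4 * p) (hnc : ¬ IsCyclic (K ≃ₐ[ℚ] K)) (φ₀ : K →+* ℂ)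
    (hprim : IsPrimitive (ℂ ≃+* ℂ) Φ.1 φ₀) (hA : IsCMTypeRealisation Φ A ι θ)
    (hW : ∀ (d : ℕ), 0 < d → ∀ (A' : AbelianVariety ℂ) (φ' : A' ⟶ A'), IsWeilType A' φ' p d →
      ∀ c ∈ weilClassesOf A' φ' p d, IsRationalClass c → IsOfHodgeType (2 * p) A'.X (2 * p) p p c →
        c ∈ algebraicClasses A'.X p) (n : ℕ) :
    HodgeConjectureFor (⨁ fun _ : Fin n => A).dim (⨁ fun _ : Fin n => A).X :=
  CorankOne.hodgeConjectureFor_pow_of_weilClassesImaginaryQuadratic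
    (finrank_div_two_le_cmTypeRank_of_isPrimitive hp hp2 hK hnc Φ φ₀ hprim) φ₀ hprim hA (by rw [hK]) hW n

/-- **Off the middle degree the Hodge classes of a simple such `A` are generated by divisors, unconditionally**: `Bᵠ(A) ⊗ ℂ =
Dᵠ(A) ⊗ ℂ` for every `q ≠ p = dim A / 2` (van Geemen 6.12's shape "`Bᵠ = Dᵠ` for `q ≠ n`"). [cite: vanGeemen1994HodgeAV, Thm. 6.12]
[cite: Gordon1999HodgeAVSurvey, 5.13] -/
theorem hodgeClassSpan_eq_divisorClassesSpan_of_ne_of_isPrimitive (hp : p.Prime) (hp2 : p ≠ 2)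
    (hK : Module.finrank ℚ K = 4 * p) (hnc : ¬ IsCyclic (K ≃ₐ[ℚ] K)) (φ₀ : K →+* ℂ)
    (hprim : IsPrimitive (ℂ ≃+* ℂ) Φ.1 φ₀) (hA : IsCMTypeRealisation Φ A ι θ) {q : ℕ} (hq : q ≠ p) :
    hodgeClassSpan A.dim A.X q = divisorClassesSpan A.X A.dim q := by
  have hdimK : A.dim = Module.finrank ℚ K / 2 := Motives.schemeDim_eq_holds hA.1
  have hq' : 4 * q ≠ Module.finrank ℚ K := by rw [hK]; omega
  rw [hdimK]
  exact CorankOne.hodgeClassSpan_eq_divisorClassesSpan_of_ne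
    (finrank_div_two_le_cmTypeRank_of_isPrimitive hp hp2 hK hnc Φ φ₀ hprim) φ₀ hprim hA hq'

end Field

/-! ## §3 The imprimitive types of a CM field of degree `4p` (any CM field, any prime `p`) -/

section Imprimitive

open NumberField
open Literature.AlgebraicTopology.SingularHomology
open Literature.AlgebraicGeometry.Motives (AbelianVariety CMType)
open Literature.AlgebraicGeometry.HodgeTheory
open Literature.AlgebraicGeometry.ComplexMultiplication (IsCMTypeRealisation isSimple_iff_isPrimitive
  isPrimitive_ringEquiv_complex_iff)
open Literature.AlgebraicGeometry.VanGeemen1994 (hodgeClassSpan)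
open Literature.Barriers.HodgeConjecture (divisorClassesSpan)
open Literature.AlgebraicGeometry.Pohlmann1968
open _root_.CategoryTheory _root_.CategoryTheory.Limits

variable {K : Type} [Field K] [NumberField K] [IsCMField K] {p : ℕ}

/-- **THE NONDEGENERATE CORE OF AN IMPRIMITIVE TYPE IN DEGREE `4p`.**  A non-primitive CM type `Φ` of a CM field `K` of degree `4p`
(`p` any prime) is induced from a PRIMITIVE type `Φ₁` of a proper CM subfield `K₁`, `[K₁ : ℚ] ∈ {2, 4, 2p}` (a CM field has even
degree dividing `4p`), and `Φ₁` is NONDEGENERATE: degree `2` (Kubota), degree `≤ 6` (Ribet's Examples 3.7), degree `2p` (the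
Tankeev–Ribet–Yanai prime theorem). [cite: Streng2010, Ch. I Lemma 3.5] [cite: Ribet1980, §3 Examples (3.7) (p. 87)]
[cite: Yanai1985, §4 Theorem (p. 171)] [cite: Shimura1998, §8.2 Prop. 26] -/
theorem exists_isNondegenerate_inducedCMType_eq_of_not_isPrimitive (hp : p.Prime) (hK : Module.finrank ℚ K = 4 * p)
    (Φ : CMType K) (φ₀ : K →+* ℂ) (hΦ : ¬ IsPrimitive (ℂ ≃+* ℂ) Φ.1 φ₀) :
    ∃ (K₁ : IntermediateField ℚ K) (Φ₁ : CMType K₁), IsCMField K₁ ∧ IsNondegenerate Φ₁ ∧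
      inducedCMType (algebraMap K₁ K) Φ₁ = Φ ∧
      (∀ s t : K₁ →+* ℂ, (∀ τ : ℂ ≃+* ℂ, (τ : ℂ →+* ℂ).comp s ∈ Φ₁.1 ↔ (τ : ℂ →+* ℂ).comp t ∈ Φ₁.1) → s = t) ∧
      2 ≤ Module.finrank K₁ K ∧
      (Module.finrank ℚ K₁ = 2 ∨ Module.finrank ℚ K₁ = 4 ∨ Module.finrank ℚ K₁ = 2 * p) := by
  obtain ⟨K₁, Φ₁, hCM, h₁, hp₁, hmin⟩ := exists_primitive_inducedCMType_eq_of_isCMField Φ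
  haveI := hCM
  have h2 := two_le_finrank_of_not_isPrimitive hmin φ₀ hΦ
  obtain ⟨s₀⟩ : Nonempty (K₁ →+* ℂ) := inferInstance
  have hpr₁ : IsPrimitive (ℂ ≃+* ℂ) Φ₁.1 s₀ := (isPrimitive_ringEquiv_complex_iff Φ₁ s₀).2 hp₁
  -- degrees: `[K₁:ℚ] · [K:K₁] = 4p`, `[K₁:ℚ]` even, `[K:K₁] ≥ 2`
  have hmul : Module.finrank ℚ K₁ * Module.finrank K₁ K = 4 * p := by rw [Module.finrank_mul_finrank, hK]
  have heven : 2 ∣ Module.finrank ℚ K₁ :=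
    ⟨Module.finrank ℚ (maximalRealSubfield K₁), by
      rw [← Module.finrank_mul_finrank ℚ (maximalRealSubfield K₁) K₁,
        Algebra.IsQuadraticExtension.finrank_eq_two (maximalRealSubfield K₁) K₁, mul_comm]⟩
  obtain ⟨e, he⟩ := heven
  have hem : e * Module.finrank K₁ K = 2 * p := by
    have h : 2 * (e * Module.finrank K₁ K) = 2 * (2 * p) := by rw [← mul_assoc, ← he, hmul]; ring
    omega
  have hedvd : e ∣ 2 * p := Dvd.intro _ hem
  obtain ⟨a, b, ha, hb, hab⟩ := dvd_mul.1 hedvd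
  have ha' : a = 1 ∨ a = 2 := by
    have hale : a ≤ 2 := Nat.le_of_dvd two_pos ha
    have hapos : 0 < a := Nat.pos_of_dvd_of_pos ha two_pos
    interval_cases a
    · exact Or.inl rfl
    · exact Or.inr rfl
  have hb' : b = 1 ∨ b = p := (Nat.dvd_prime hp).1 hb
  have hdeg : Module.finrank ℚ K₁ = 2 ∨ Module.finrank ℚ K₁ = 4 ∨ Module.finrank ℚ K₁ = 2 * p := by
    rcases ha' with rfl | rfl <;> rcases hb' with hb1 | hbp
    · left; rw [hb1] at hab; omega
    · right; right; rw [hbp] at hab; omega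
    · right; left; rw [hb1] at hab; omega
    · -- `e = 2p` would force `[K : K₁] = 1`
      exfalso
      rw [hbp] at hab
      rw [hab] at hem
      have hppos := hp.pos
      have h1 : Module.finrank K₁ K = 1 :=
        Nat.eq_of_mul_eq_mul_left (show 0 < 2 * p by omega) (hem.trans (mul_one _).symm)
      omega
  refine ⟨K₁, Φ₁, hCM, ?_, h₁, hp₁, h2, hdeg⟩
  rcases hdeg with hd | hd | hd
  · exact isNondegenerate_of_finrank_eq_two Φ₁ hd
  · exact isNondegenerate_of_isPrimitive_of_finrank_le_six Φ₁ (by omega) s₀ hpr₁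
  · exact isNondegenerate_of_isPrimitive_of_prime hp hd s₀ hpr₁

variable {Φ : CMType K} {A : AbelianVariety ℂ} {ι : 𝓞 K →+* End A} {θ : K →+* Module.End ℂ (complexBetti A.X 1)}

/-- **`Bᵐ(Aⁿ) ⊗ ℂ = Dᵐ(Aⁿ) ⊗ ℂ` FOR ALL `n, m`, FOR EVERY NON-PRIMITIVE CM TYPE OF A CM FIELD OF DEGREE `4p` (`p` ANY PRIME) AND EVERY
REALISATION** — Hazama's criterion for the type induced from the nondegenerate core (tree `…_inducedCMType`).
[cite: Gordon1999HodgeAVSurvey, Thm. 6.4 and §9.3] [cite: Yanai1985, §4 Theorem (p. 171)] [cite: Streng2010, Ch. I Lemma 3.5] -/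
theorem hodgeClassSpan_pow_eq_divisorClassesSpan_of_not_isPrimitive (hp : p.Prime) (hK : Module.finrank ℚ K = 4 * p)
    (φ₀ : K →+* ℂ) (hΦ : ¬ IsPrimitive (ℂ ≃+* ℂ) Φ.1 φ₀) (hA : IsCMTypeRealisation Φ A ι θ) (n m : ℕ) :
    hodgeClassSpan (⨁ fun _ : Fin n => A).dim (⨁ fun _ : Fin n => A).X m =
      divisorClassesSpan (⨁ fun _ : Fin n => A).X (⨁ fun _ : Fin n => A).dim m := by
  obtain ⟨K₁, Φ₁, hCM, hnd₁, h₁, -, -, -⟩ := exists_isNondegenerate_inducedCMType_eq_of_not_isPrimitive hp hK Φ φ₀ hΦ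
  haveI := hCM
  exact hnd₁.hodgeClassSpan_pow_eq_divisorClassesSpan_inducedCMType h₁ hA n m

/-- `Bᵐ ⊗ ℂ = Dᵐ ⊗ ℂ` for all `m` on an abelian variety gives the Hodge conjecture for it (Lefschetz `(1,1)`, cup products, tree
theorems). [cite: Gordon1999HodgeAVSurvey, §9.3] -/
private theorem hodgeConjectureFor_of_forall_hodgeClassSpan_eq₆₃b (B : AbelianVariety ℂ)
    (h : ∀ m : ℕ, hodgeClassSpan B.dim B.X m = divisorClassesSpan B.X B.dim m) : HodgeConjectureFor B.dim B.X :=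
  ⟨nonempty_hodgeModel_holds (Motives.AbelianVariety.isSmoothProjective_holds (A := B)),
    fun m _ hc hmm ↦ AbelianVariety.divisorClassesSpan_le_algebraicClasses B
      (fun b hb hb' ↦ lefschetzOneOne_rational_holds (Motives.AbelianVariety.isSmoothProjective_holds (A := B)) b hb hb') m
      ((h m) ▸ Submodule.subset_span ⟨hc, hmm⟩)⟩

omit [IsCMField K] in
/-- `A ∼ ⨁_{i<1} A`. [folklore] -/
private theorem isIsogenous_biproduct_fin_one₆₃b (B : AbelianVariety ℂ) :
    Motives.AbelianVariety.IsIsogenous B (⨁ fun _ : Fin 1 => B) :=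
  let e : B ≅ ⨁ fun _ : Fin 1 => B := (biproductUniqueIso (fun _ : Fin 1 => B)).symm
  ⟨e.hom, Motives.AbelianVariety.isIsogeny_hom_of_iso e⟩

/-- **THE HODGE CONJECTURE FOR EVERY POWER OF EVERY REALISATION OF A NON-PRIMITIVE CM TYPE OF A CM FIELD OF DEGREE `4p`** (`p` any
prime) — UNCONDITIONAL; for abelian `K` these are exactly the NON-SIMPLE abelian varieties with complex multiplication by `K`.
[cite: Gordon1999HodgeAVSurvey, Thm. 6.4 and §9.3] [cite: Shimura1998, §8.2 Prop. 26] -/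
theorem hodgeConjectureFor_pow_of_not_isPrimitive (hp : p.Prime) (hK : Module.finrank ℚ K = 4 * p) (φ₀ : K →+* ℂ)
    (hΦ : ¬ IsPrimitive (ℂ ≃+* ℂ) Φ.1 φ₀) (hA : IsCMTypeRealisation Φ A ι θ) (n : ℕ) :
    HodgeConjectureFor (⨁ fun _ : Fin n => A).dim (⨁ fun _ : Fin n => A).X :=
  hodgeConjectureFor_of_forall_hodgeClassSpan_eq₆₃b _
    (fun m ↦ hodgeClassSpan_pow_eq_divisorClassesSpan_of_not_isPrimitive hp hK φ₀ hΦ hA n m)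

/-- No power of such an `A` carries an exceptional Hodge class. [cite: Gordon1999HodgeAVSurvey, Thm. 6.4] -/
theorem not_exists_exceptional_pow_of_not_isPrimitive (hp : p.Prime) (hK : Module.finrank ℚ K = 4 * p) (φ₀ : K →+* ℂ)
    (hΦ : ¬ IsPrimitive (ℂ ≃+* ℂ) Φ.1 φ₀) (hA : IsCMTypeRealisation Φ A ι θ) (n m : ℕ) :
    ¬ ∃ c : complexBetti (⨁ fun _ : Fin n => A).X (2 * m), IsRationalClass c ∧
        IsOfHodgeType (⨁ fun _ : Fin n => A).dim (⨁ fun _ : Fin n => A).X (2 * m) m m c ∧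
        c ∉ divisorClassesSpan (⨁ fun _ : Fin n => A).X (⨁ fun _ : Fin n => A).dim m := by
  rintro ⟨c, hcQ, hcH, hcD⟩
  exact hcD ((hodgeClassSpan_pow_eq_divisorClassesSpan_of_not_isPrimitive hp hK φ₀ hΦ hA n m) ▸ Submodule.subset_span ⟨hcQ, hcH⟩)

/-- **… in particular for every NON-SIMPLE abelian variety with complex multiplication by a CM field of degree `4p`**, with all its
powers, and for the variety itself. [cite: Shimura1998, §8.2 Prop. 26] [cite: Gordon1999HodgeAVSurvey, Thm. 6.4 and §9.3] -/
theorem hodgeConjectureFor_pow_of_not_isSimple (hp : p.Prime) (hK : Module.finrank ℚ K = 4 * p)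
    (hA : IsCMTypeRealisation Φ A ι θ) (hns : ¬ A.IsSimple) (n : ℕ) :
    HodgeConjectureFor (⨁ fun _ : Fin n => A).dim (⨁ fun _ : Fin n => A).X ∧ HodgeConjectureFor A.dim A.X := by
  obtain ⟨φ₀⟩ : Nonempty (K →+* ℂ) := inferInstance
  have hΦ : ¬ IsPrimitive (ℂ ≃+* ℂ) Φ.1 φ₀ := fun h ↦ hns ((isSimple_iff_isPrimitive hA φ₀).2 h)
  exact ⟨hodgeConjectureFor_pow_of_not_isPrimitive hp hK φ₀ hΦ hA n,
    HodgeConjectureFor.of_isIsogenous (isIsogenous_biproduct_fin_one₆₃b A)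
      (hodgeConjectureFor_pow_of_not_isPrimitive hp hK φ₀ hΦ hA 1)⟩

end Imprimitive

/-! ## §4 All realisations: the trichotomy; the cyclotomic fields `ℚ(ζ₂₁), ℚ(ζ₂₈), ℚ(ζ₃₆), ℚ(ζ₄₂)` (`p = 3`) and
`ℚ(ζ₃₃), ℚ(ζ₄₄), ℚ(ζ₆₆)` (`p = 5`) -/

section Assembly

open NumberField
open Literature.AlgebraicTopology.SingularHomology
open Literature.AlgebraicGeometry.Motives (AbelianVariety CMType)
open Literature.AlgebraicGeometry.HodgeTheory
open Literature.AlgebraicGeometry.ComplexMultiplication (IsCMTypeRealisation isSimple_iff_isPrimitive)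
open Literature.AlgebraicGeometry.VanGeemen1994 (hodgeClassSpan)
open Literature.Barriers.HodgeConjecture (divisorClassesSpan)
open Literature.AlgebraicGeometry.Pohlmann1968
open _root_.CategoryTheory _root_.CategoryTheory.Limits

variable {K : Type} [Field K] [NumberField K] [IsCMField K] [IsAbelianGalois ℚ K] {p : ℕ}
  {Φ : CMType K} {A : AbelianVariety ℂ} {ι : 𝓞 K →+* End A} {θ : K →+* Module.End ℂ (complexBetti A.X 1)}

/-- **THE TRICHOTOMY FOR EVERY ABELIAN VARIETY WITH COMPLEX MULTIPLICATION BY AN ABELIAN, NON-CYCLIC CM FIELD OF DEGREE `4p`**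
(`p` an odd prime; ANY CM type `Φ`, ANY realisation `(A, ι, θ)`, `dim A = 2p`).  EITHER `B•(Aⁿ) ⊗ ℂ = D•(Aⁿ) ⊗ ℂ` and the Hodge
conjecture hold for EVERY power `Aⁿ`, UNCONDITIONALLY (the non-simple `A` — §3 — and the simple `A` of nondegenerate type); OR `A`
is SIMPLE of rank-`2p` (degenerate) type: of Weil type `(p, d)` for `w = √-d ∈ 𝓞_K` generating an imaginary quadratic `k ⊆ K` of
multiplicities `(p, p)`, with `Bᵠ(A) = Dᵠ(A)` (`⊗ ℂ`) for `q ≠ p`, `Bᵖ(A) ⊗ ℂ = Dᵖ(A) ⊗ ℂ ⊔ W_k ⊗ ℂ`, and the Hodge conjecture for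
`A` and all `Aⁿ` implied by the algebraicity of the rational `(p,p)` classes of the one Weil plane `W_k ⊗ ℂ` (NOT claimed).
[cite: Gordon1999HodgeAVSurvey, 5.13 and Thm. 6.4 and §9.3–9.5] [cite: vanGeemen1994HodgeAV, 4.7 and Thm. 6.12]
[cite: Hazama2003CyclicCM, Thm. 4.8] [cite: Dodson1984, §3.2.1] -/
theorem hodgeClassSpan_pow_eq_or_weilType (hp : p.Prime) (hp2 : p ≠ 2) (hK : Module.finrank ℚ K = 4 * p)
    (hnc : ¬ IsCyclic (K ≃ₐ[ℚ] K)) (hA : IsCMTypeRealisation Φ A ι θ) :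
    ((∀ n m : ℕ, hodgeClassSpan (⨁ fun _ : Fin n => A).dim (⨁ fun _ : Fin n => A).X m =
          divisorClassesSpan (⨁ fun _ : Fin n => A).X (⨁ fun _ : Fin n => A).dim m) ∧
        ∀ n : ℕ, HodgeConjectureFor (⨁ fun _ : Fin n => A).dim (⨁ fun _ : Fin n => A).X) ∨
      (A.IsSimple ∧ cmTypeRank Φ = 2 * p ∧ ¬ IsNondegenerate Φ ∧
        (∀ q : ℕ, q ≠ p → hodgeClassSpan A.dim A.X q = divisorClassesSpan A.X A.dim q) ∧
        ∃ (k : IntermediateField ℚ K) (w : 𝓞 K) (d : ℕ), Module.finrank ℚ k = 2 ∧ (w : K) ∈ k ∧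
          (∀ t : k →+* ℂ, {φ : K →+* ℂ | φ.comp (algebraMap k K) = t ∧ φ ∈ Φ.1}.ncard =
            {φ : K →+* ℂ | φ.comp (algebraMap k K) = t ∧ φ ∉ Φ.1}.ncard) ∧
          0 < d ∧ w ^ 2 = -(d : 𝓞 K) ∧ IsWeilType A (ι w) p d ∧ IsDivisorWeilGenerated A (ι w) p d ∧
          hodgeClassSpan A.dim A.X p = divisorClassesSpan A.X A.dim p ⊔ weilClassesOf A (ι w) p d ∧
          ((∀ c ∈ weilClassesOf A (ι w) p d, IsRationalClass c → IsOfHodgeType (2 * p) A.X (2 * p) p p c →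
              c ∈ algebraicClasses A.X p) →
            HodgeConjectureFor A.dim A.X ∧
              ∀ n : ℕ, HodgeConjectureFor (⨁ fun _ : Fin n => A).dim (⨁ fun _ : Fin n => A).X)) := by
  obtain ⟨φ₀⟩ : Nonempty (K →+* ℂ) := inferInstance
  by_cases hprim : IsPrimitive (ℂ ≃+* ℂ) Φ.1 φ₀
  · rcases hodgeConjectureFor_pow_or_weilType_of_isPrimitive hp hp2 hK hnc φ₀ hprim hA with ⟨-, hBD, hHC⟩ | ⟨hr, hΦ, hq, hW⟩
    · exact Or.inl ⟨hBD, hHC⟩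
    · exact Or.inr ⟨(isSimple_iff_isPrimitive hA φ₀).2 hprim, hr, hΦ, hq, hW⟩
  · exact Or.inl ⟨fun n m => hodgeClassSpan_pow_eq_divisorClassesSpan_of_not_isPrimitive hp hK φ₀ hprim hA n m, fun n =>
      hodgeConjectureFor_pow_of_not_isPrimitive hp hK φ₀ hprim hA n⟩

/-- **Unconditional part, stated alone: off the middle degree every Hodge class of EVERY abelian variety with complex multiplication
by such a field is a polynomial in divisor classes** — `Bᵠ(A) ⊗ ℂ = Dᵠ(A) ⊗ ℂ` for all `q ≠ p = dim A / 2`, any type, any realisation.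
[cite: vanGeemen1994HodgeAV, Thm. 6.12] [cite: Gordon1999HodgeAVSurvey, 5.13 and Thm. 6.4] -/
theorem hodgeClassSpan_eq_divisorClassesSpan_of_ne (hp : p.Prime) (hp2 : p ≠ 2) (hK : Module.finrank ℚ K = 4 * p)
    (hnc : ¬ IsCyclic (K ≃ₐ[ℚ] K)) (hA : IsCMTypeRealisation Φ A ι θ) {q : ℕ} (hq : q ≠ p) :
    hodgeClassSpan A.dim A.X q = divisorClassesSpan A.X A.dim q := by
  obtain ⟨φ₀⟩ : Nonempty (K →+* ℂ) := inferInstance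
  by_cases hprim : IsPrimitive (ℂ ≃+* ℂ) Φ.1 φ₀
  · exact hodgeClassSpan_eq_divisorClassesSpan_of_ne_of_isPrimitive hp hp2 hK hnc φ₀ hprim hA hq
  · -- imprimitive: `B•(Aⁿ) = D•(Aⁿ)` for all `n` descends to `A` (the core field `K₁ ⊆ K` is abelian over `ℚ`)
    obtain ⟨K₁, Φ₁, hCM, hnd₁, h₁, hsep, -, -⟩ :=
      exists_isNondegenerate_inducedCMType_eq_of_not_isPrimitive hp hK Φ φ₀ hprim
    haveI := hCM
    haveI : IsAbelianGalois ℚ K₁ := IsAbelianGalois.tower_bot ℚ K₁ K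
    have hdimK : A.dim = Module.finrank ℚ K / 2 := Motives.schemeDim_eq_holds hA.1
    rw [hdimK]
    exact (forall_pow_hodgeClassSpan_eq_iff_forall_hodgeClassSpan_eq_inducedCMType h₁ hsep hA).1
      (fun n m => hnd₁.hodgeClassSpan_pow_eq_divisorClassesSpan_inducedCMType h₁ hA n m) q

end Assembly

section Cyclotomic

open NumberField
open Literature.AlgebraicTopology.SingularHomology
open Literature.AlgebraicGeometry.Motives (AbelianVariety CMType)
open Literature.AlgebraicGeometry.HodgeTheory
open Literature.AlgebraicGeometry.ComplexMultiplication (IsCMTypeRealisation)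
open Literature.AlgebraicGeometry.VanGeemen1994 (hodgeClassSpan)
open Literature.Barriers.HodgeConjecture (divisorClassesSpan)
open Literature.AlgebraicGeometry.Pohlmann1968
open _root_.CategoryTheory _root_.CategoryTheory.Limits

variable {q p : ℕ} {L : Type} [Field L] [NumberField L]
  {Φ : CMType L} {A : AbelianVariety ℂ} {ι : 𝓞 L →+* End A} {θ : L →+* Module.End ℂ (complexBetti A.X 1)}

/-- For `L ≅ ℚ(ζ_q)`, `q > 2`, `(ℤ/q)ˣ` NOT cyclic: `L` is a CM field, abelian over `ℚ`, with NON-CYCLIC Galois group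
(`≅ (ℤ/q)ˣ`) and `[L : ℚ] = φ(q)`. [cite: Washington1997, Ch. 2 Thm. 2.5] -/
theorem cm_abelian_not_isCyclic_finrank_of_isCyclotomicExtension [NeZero q] (h2q : 2 < q) (hncq : ¬ IsCyclic (ZMod q)ˣ)
    (L : Type) [Field L] [NumberField L] [IsCyclotomicExtension {q} ℚ L] :
    IsCMField L ∧ IsAbelianGalois ℚ L ∧ ¬ IsCyclic (L ≃ₐ[ℚ] L) ∧ Module.finrank ℚ L = Nat.totient q := by
  have hirr : Irreducible (cyclotomic q ℚ) := cyclotomic.irreducible_rat (NeZero.pos q)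
  exact ⟨IsCyclotomicExtension.Rat.isCMField L (S := ({q} : Set ℕ)) ⟨q, rfl, h2q⟩,
    IsCyclotomicExtension.isAbelianGalois {q} ℚ L,
    fun h => hncq ((MulEquiv.isCyclic (IsCyclotomicExtension.autEquivPow L hirr)).1 h), IsCyclotomicExtension.finrank L hirr⟩

/-- **Corank `≤ 1` for `ℚ(ζ_q)`, `(ℤ/q)ˣ ≅ ℤ/2 × ℤ/2p`** (`q ∈ {21, 28, 36, 42}` for `p = 3`, `{33, 44, 66}` for `p = 5`): every
primitive CM type has Kubota rank `≥ 2p`. [cite: Kubota1965, §4 Lemma 2] [cite: Hazama2003CyclicCM, Thm. 4.8] [cite: Dodson1984, §3.2.1] -/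
theorem finrank_div_two_le_cmTypeRank_of_isCyclotomicExtension [NeZero q] [IsCyclotomicExtension {q} ℚ L] (h2q : 2 < q)
    (hncq : ¬ IsCyclic (ZMod q)ˣ) (hφ : Nat.totient q = 4 * p) (hp : p.Prime) (hp2 : p ≠ 2) (Φ : CMType L)
    (φ₀ : L →+* ℂ) (hprim : IsPrimitive (ℂ ≃+* ℂ) Φ.1 φ₀) : Module.finrank ℚ L / 2 ≤ cmTypeRank Φ := by
  obtain ⟨hcm, hab, hnc, hL⟩ := cm_abelian_not_isCyclic_finrank_of_isCyclotomicExtension h2q hncq L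
  haveI := hcm; haveI := hab
  exact finrank_div_two_le_cmTypeRank_of_isPrimitive hp hp2 (hL.trans hφ) hnc Φ φ₀ hprim

/-- **THE TRICHOTOMY FOR EVERY ABELIAN VARIETY WITH COMPLEX MULTIPLICATION BY `ℚ(ζ_q)`, `(ℤ/q)ˣ` NON-CYCLIC OF ORDER `4p`** (§4,
`hodgeClassSpan_pow_eq_or_weilType`). [cite: Gordon1999HodgeAVSurvey, 5.13 and Thm. 6.4 and §9.3–9.5]
[cite: vanGeemen1994HodgeAV, 4.7 and Thm. 6.12] [cite: Hazama2003CyclicCM, Thm. 4.8] -/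
theorem hodgeClassSpan_pow_eq_or_weilType_of_isCyclotomicExtension [NeZero q] [IsCyclotomicExtension {q} ℚ L]
    (h2q : 2 < q) (hncq : ¬ IsCyclic (ZMod q)ˣ) (hφ : Nat.totient q = 4 * p) (hp : p.Prime) (hp2 : p ≠ 2)
    (hA : IsCMTypeRealisation Φ A ι θ) :
    ((∀ n m : ℕ, hodgeClassSpan (⨁ fun _ : Fin n => A).dim (⨁ fun _ : Fin n => A).X m =
          divisorClassesSpan (⨁ fun _ : Fin n => A).X (⨁ fun _ : Fin n => A).dim m) ∧
        ∀ n : ℕ, HodgeConjectureFor (⨁ fun _ : Fin n => A).dim (⨁ fun _ : Fin n => A).X) ∨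
      (A.IsSimple ∧ cmTypeRank Φ = 2 * p ∧ ¬ IsNondegenerate Φ ∧
        (∀ m : ℕ, m ≠ p → hodgeClassSpan A.dim A.X m = divisorClassesSpan A.X A.dim m) ∧
        ∃ (k : IntermediateField ℚ L) (w : 𝓞 L) (d : ℕ), Module.finrank ℚ k = 2 ∧ (w : L) ∈ k ∧
          (∀ t : k →+* ℂ, {φ : L →+* ℂ | φ.comp (algebraMap k L) = t ∧ φ ∈ Φ.1}.ncard =
            {φ : L →+* ℂ | φ.comp (algebraMap k L) = t ∧ φ ∉ Φ.1}.ncard) ∧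
          0 < d ∧ w ^ 2 = -(d : 𝓞 L) ∧ IsWeilType A (ι w) p d ∧ IsDivisorWeilGenerated A (ι w) p d ∧
          hodgeClassSpan A.dim A.X p = divisorClassesSpan A.X A.dim p ⊔ weilClassesOf A (ι w) p d ∧
          ((∀ c ∈ weilClassesOf A (ι w) p d, IsRationalClass c → IsOfHodgeType (2 * p) A.X (2 * p) p p c →
              c ∈ algebraicClasses A.X p) →
            HodgeConjectureFor A.dim A.X ∧
              ∀ n : ℕ, HodgeConjectureFor (⨁ fun _ : Fin n => A).dim (⨁ fun _ : Fin n => A).X)) := by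
  obtain ⟨hcm, hab, hnc, hL⟩ := cm_abelian_not_isCyclic_finrank_of_isCyclotomicExtension h2q hncq L
  haveI := hcm; haveI := hab
  exact hodgeClassSpan_pow_eq_or_weilType hp hp2 (hL.trans hφ) hnc hA

/-- **`Bᵐ(A) ⊗ ℂ = Dᵐ(A) ⊗ ℂ` for all `m ≠ p`, for EVERY abelian variety with complex multiplication by such a `ℚ(ζ_q)`** —
unconditional. [cite: vanGeemen1994HodgeAV, Thm. 6.12] [cite: Gordon1999HodgeAVSurvey, 5.13 and Thm. 6.4] -/
theorem hodgeClassSpan_eq_divisorClassesSpan_of_ne_of_isCyclotomicExtension [NeZero q] [IsCyclotomicExtension {q} ℚ L]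
    (h2q : 2 < q) (hncq : ¬ IsCyclic (ZMod q)ˣ) (hφ : Nat.totient q = 4 * p) (hp : p.Prime) (hp2 : p ≠ 2)
    (hA : IsCMTypeRealisation Φ A ι θ) {m : ℕ} (hm : m ≠ p) :
    hodgeClassSpan A.dim A.X m = divisorClassesSpan A.X A.dim m := by
  obtain ⟨hcm, hab, hnc, hL⟩ := cm_abelian_not_isCyclic_finrank_of_isCyclotomicExtension h2q hncq L
  haveI := hcm; haveI := hab
  exact hodgeClassSpan_eq_divisorClassesSpan_of_ne hp hp2 (hL.trans hφ) hnc hA hm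

/-- **The Hodge conjecture for every power of every NON-SIMPLE abelian variety with complex multiplication by such a `ℚ(ζ_q)`** —
unconditional (§3). [cite: Gordon1999HodgeAVSurvey, Thm. 6.4 and §9.3] [cite: Shimura1998, §8.2 Prop. 26] -/
theorem hodgeConjectureFor_pow_of_not_isSimple_of_isCyclotomicExtension [NeZero q] [IsCyclotomicExtension {q} ℚ L]
    (h2q : 2 < q) (hφ : Nat.totient q = 4 * p) (hp : p.Prime) (hA : IsCMTypeRealisation Φ A ι θ) (hns : ¬ A.IsSimple)
    (n : ℕ) : HodgeConjectureFor (⨁ fun _ : Fin n => A).dim (⨁ fun _ : Fin n => A).X ∧ HodgeConjectureFor A.dim A.X := by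
  have hirr : Irreducible (cyclotomic q ℚ) := cyclotomic.irreducible_rat (NeZero.pos q)
  haveI := IsCyclotomicExtension.Rat.isCMField L (S := ({q} : Set ℕ)) ⟨q, rfl, h2q⟩
  exact hodgeConjectureFor_pow_of_not_isSimple hp ((IsCyclotomicExtension.finrank L hirr).trans hφ) hA hns n

/-! ### The levels: `(ℤ/q)ˣ` non-cyclic of order `12 = 4·3` (`q = 21, 28, 36, 42`) and `20 = 4·5` (`q = 33, 44, 66`) -/

/-- `(ℤ/21)ˣ ≅ ℤ/2 × ℤ/6` is not cyclic. [folklore] -/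
private theorem not_isCyclic_units_twentyOne : ¬ IsCyclic (ZMod 21)ˣ :=
  ZMod.not_isCyclic_units_of_mul_coprime 3 7 (by decide) (by norm_num) (by decide) (by norm_num) (by norm_num)

/-- `(ℤ/28)ˣ ≅ ℤ/2 × ℤ/6` is not cyclic. [folklore] -/
private theorem not_isCyclic_units_twentyEight : ¬ IsCyclic (ZMod 28)ˣ := fun h => by
  rcases (ZMod.isCyclic_units_four_mul_iff 7).1 h with h7 | h7 <;> omega

/-- `(ℤ/36)ˣ ≅ ℤ/2 × ℤ/6` is not cyclic. [folklore] -/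
private theorem not_isCyclic_units_thirtySix : ¬ IsCyclic (ZMod 36)ˣ := fun h => by
  rcases (ZMod.isCyclic_units_four_mul_iff 9).1 h with h9 | h9 <;> omega

/-- `(ℤ/42)ˣ ≅ (ℤ/21)ˣ` is not cyclic. [folklore] -/
private theorem not_isCyclic_units_fortyTwo : ¬ IsCyclic (ZMod 42)ˣ := fun h =>
  not_isCyclic_units_twentyOne ((ZMod.isCyclic_units_two_mul_iff_of_odd 21 (by decide)).1 h)

/-- `(ℤ/33)ˣ ≅ ℤ/2 × ℤ/10` is not cyclic. [folklore] -/
private theorem not_isCyclic_units_thirtyThree : ¬ IsCyclic (ZMod 33)ˣ :=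
  ZMod.not_isCyclic_units_of_mul_coprime 3 11 (by decide) (by norm_num) (by decide) (by norm_num) (by norm_num)

/-- `(ℤ/44)ˣ ≅ ℤ/2 × ℤ/10` is not cyclic. [folklore] -/
private theorem not_isCyclic_units_fortyFour : ¬ IsCyclic (ZMod 44)ˣ := fun h => by
  rcases (ZMod.isCyclic_units_four_mul_iff 11).1 h with h11 | h11 <;> omega

/-- `(ℤ/66)ˣ ≅ (ℤ/33)ˣ` is not cyclic. [folklore] -/
private theorem not_isCyclic_units_sixtySix : ¬ IsCyclic (ZMod 66)ˣ := fun h =>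
  not_isCyclic_units_thirtyThree ((ZMod.isCyclic_units_two_mul_iff_of_odd 33 (by decide)).1 h)

/-- **`ℚ(ζ₂₁)` (`φ = 12`, `(ℤ/21)ˣ ≅ ℤ/2 × ℤ/6`, `dim A = 6`)** — the field of Dodson's first non-cyclic degenerate examples and of
the tree's `DegenerateCMTypeCyclotomic21`: `Bᵐ(A) ⊗ ℂ = Dᵐ(A) ⊗ ℂ` for all `m ≠ 3`, for EVERY abelian variety with complex
multiplication by `ℚ(ζ₂₁)`, unconditionally; the trichotomy is `hodgeClassSpan_pow_eq_or_weilType_of_isCyclotomicExtension` at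
`q = 21`. [cite: Dodson1984, §3.2.1] [cite: Gordon1999HodgeAVSurvey, 5.13 and Thm. 6.4] [cite: vanGeemen1994HodgeAV, Thm. 6.12] -/
theorem hodgeClassSpan_eq_divisorClassesSpan_of_ne_twentyOne [IsCyclotomicExtension {21} ℚ L]
    (hA : IsCMTypeRealisation Φ A ι θ) {m : ℕ} (hm : m ≠ 3) :
    hodgeClassSpan A.dim A.X m = divisorClassesSpan A.X A.dim m :=
  hodgeClassSpan_eq_divisorClassesSpan_of_ne_of_isCyclotomicExtension (by norm_num) not_isCyclic_units_twentyOne (by decide)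
    (by norm_num) (by norm_num) hA hm

/-- **`ℚ(ζ₂₈)` (`φ = 12`, `dim A = 6`): `Bᵐ(A) ⊗ ℂ = Dᵐ(A) ⊗ ℂ` for `m ≠ 3`.** [cite: Gordon1999HodgeAVSurvey, 5.13 and Thm. 6.4]
[cite: vanGeemen1994HodgeAV, Thm. 6.12] -/
theorem hodgeClassSpan_eq_divisorClassesSpan_of_ne_twentyEight [IsCyclotomicExtension {28} ℚ L]
    (hA : IsCMTypeRealisation Φ A ι θ) {m : ℕ} (hm : m ≠ 3) :
    hodgeClassSpan A.dim A.X m = divisorClassesSpan A.X A.dim m :=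
  hodgeClassSpan_eq_divisorClassesSpan_of_ne_of_isCyclotomicExtension (by norm_num) not_isCyclic_units_twentyEight (by decide)
    (by norm_num) (by norm_num) hA hm

/-- **`ℚ(ζ₃₆)` (`φ = 12`, `dim A = 6`): `Bᵐ(A) ⊗ ℂ = Dᵐ(A) ⊗ ℂ` for `m ≠ 3`.** [cite: Gordon1999HodgeAVSurvey, 5.13 and Thm. 6.4]
[cite: vanGeemen1994HodgeAV, Thm. 6.12] -/
theorem hodgeClassSpan_eq_divisorClassesSpan_of_ne_thirtySix [IsCyclotomicExtension {36} ℚ L]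
    (hA : IsCMTypeRealisation Φ A ι θ) {m : ℕ} (hm : m ≠ 3) :
    hodgeClassSpan A.dim A.X m = divisorClassesSpan A.X A.dim m :=
  hodgeClassSpan_eq_divisorClassesSpan_of_ne_of_isCyclotomicExtension (by norm_num) not_isCyclic_units_thirtySix (by decide)
    (by norm_num) (by norm_num) hA hm

/-- **`ℚ(ζ₄₂) = ℚ(ζ₂₁)`: `Bᵐ(A) ⊗ ℂ = Dᵐ(A) ⊗ ℂ` for `m ≠ 3`.** [cite: Dodson1984, §3.2.1] [cite: Gordon1999HodgeAVSurvey, 5.13 and Thm. 6.4] -/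
theorem hodgeClassSpan_eq_divisorClassesSpan_of_ne_fortyTwo [IsCyclotomicExtension {42} ℚ L]
    (hA : IsCMTypeRealisation Φ A ι θ) {m : ℕ} (hm : m ≠ 3) :
    hodgeClassSpan A.dim A.X m = divisorClassesSpan A.X A.dim m :=
  hodgeClassSpan_eq_divisorClassesSpan_of_ne_of_isCyclotomicExtension (by norm_num) not_isCyclic_units_fortyTwo (by decide)
    (by norm_num) (by norm_num) hA hm

/-- **`ℚ(ζ₃₃)` (`φ = 20`, `(ℤ/33)ˣ ≅ ℤ/2 × ℤ/10`, `dim A = 10`): `Bᵐ(A) ⊗ ℂ = Dᵐ(A) ⊗ ℂ` for all `m ≠ 5`, for EVERY abelian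
variety with complex multiplication by `ℚ(ζ₃₃)`** — a level of `φ(N) ≤ 22` not reached by the `φ ≤ 16` tables; the trichotomy is
`hodgeClassSpan_pow_eq_or_weilType_of_isCyclotomicExtension` at `q = 33`. [cite: Gordon1999HodgeAVSurvey, 5.13 and Thm. 6.4]
[cite: vanGeemen1994HodgeAV, Thm. 6.12] [cite: Hazama2003CyclicCM, Thm. 4.8] -/
theorem hodgeClassSpan_eq_divisorClassesSpan_of_ne_thirtyThree [IsCyclotomicExtension {33} ℚ L]
    (hA : IsCMTypeRealisation Φ A ι θ) {m : ℕ} (hm : m ≠ 5) :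
    hodgeClassSpan A.dim A.X m = divisorClassesSpan A.X A.dim m :=
  hodgeClassSpan_eq_divisorClassesSpan_of_ne_of_isCyclotomicExtension (by norm_num) not_isCyclic_units_thirtyThree (by decide)
    (by norm_num) (by norm_num) hA hm

/-- **`ℚ(ζ₄₄)` (`φ = 20`, `dim A = 10`): `Bᵐ(A) ⊗ ℂ = Dᵐ(A) ⊗ ℂ` for `m ≠ 5`.** [cite: Gordon1999HodgeAVSurvey, 5.13 and Thm. 6.4]
[cite: vanGeemen1994HodgeAV, Thm. 6.12] -/
theorem hodgeClassSpan_eq_divisorClassesSpan_of_ne_fortyFour [IsCyclotomicExtension {44} ℚ L]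
    (hA : IsCMTypeRealisation Φ A ι θ) {m : ℕ} (hm : m ≠ 5) :
    hodgeClassSpan A.dim A.X m = divisorClassesSpan A.X A.dim m :=
  hodgeClassSpan_eq_divisorClassesSpan_of_ne_of_isCyclotomicExtension (by norm_num) not_isCyclic_units_fortyFour (by decide)
    (by norm_num) (by norm_num) hA hm

/-- **`ℚ(ζ₆₆) = ℚ(ζ₃₃)`: `Bᵐ(A) ⊗ ℂ = Dᵐ(A) ⊗ ℂ` for `m ≠ 5`.** [cite: Gordon1999HodgeAVSurvey, 5.13 and Thm. 6.4]
[cite: vanGeemen1994HodgeAV, Thm. 6.12] -/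
theorem hodgeClassSpan_eq_divisorClassesSpan_of_ne_sixtySix [IsCyclotomicExtension {66} ℚ L]
    (hA : IsCMTypeRealisation Φ A ι θ) {m : ℕ} (hm : m ≠ 5) :
    hodgeClassSpan A.dim A.X m = divisorClassesSpan A.X A.dim m :=
  hodgeClassSpan_eq_divisorClassesSpan_of_ne_of_isCyclotomicExtension (by norm_num) not_isCyclic_units_sixtySix (by decide)
    (by norm_num) (by norm_num) hA hm

/-- **`ℚ(ζ₃₃)`: the Hodge conjecture for all powers of every NON-SIMPLE abelian `10`-fold with complex multiplication by `ℚ(ζ₃₃)`**,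
unconditional. [cite: Gordon1999HodgeAVSurvey, Thm. 6.4 and §9.3] -/
theorem hodgeConjectureFor_pow_of_not_isSimple_thirtyThree [IsCyclotomicExtension {33} ℚ L] (hA : IsCMTypeRealisation Φ A ι θ)
    (hns : ¬ A.IsSimple) (n : ℕ) :
    HodgeConjectureFor (⨁ fun _ : Fin n => A).dim (⨁ fun _ : Fin n => A).X ∧ HodgeConjectureFor A.dim A.X :=
  hodgeConjectureFor_pow_of_not_isSimple_of_isCyclotomicExtension (q := 33) (p := 5) (by norm_num) (by decide) (by norm_num) hA
    hns n

/-- **`ℚ(ζ₄₄)`: the Hodge conjecture for all powers of every NON-SIMPLE abelian `10`-fold with complex multiplication by `ℚ(ζ₄₄)`**,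
unconditional. [cite: Gordon1999HodgeAVSurvey, Thm. 6.4 and §9.3] -/
theorem hodgeConjectureFor_pow_of_not_isSimple_fortyFour [IsCyclotomicExtension {44} ℚ L] (hA : IsCMTypeRealisation Φ A ι θ)
    (hns : ¬ A.IsSimple) (n : ℕ) :
    HodgeConjectureFor (⨁ fun _ : Fin n => A).dim (⨁ fun _ : Fin n => A).X ∧ HodgeConjectureFor A.dim A.X :=
  hodgeConjectureFor_pow_of_not_isSimple_of_isCyclotomicExtension (q := 44) (p := 5) (by norm_num) (by decide) (by norm_num) hA
    hns n

end Cyclotomic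

/-! ## §6 EXISTENCE (gen 63 append): Dodson's rank-`2p` type — `f = ((1,1),(0,0),…,(0,0))` on `⟨ρ⟩ × ℤ_{2p}`
(Thm. 3.2.1 with `(k, l) = (p, 2)`): PRIMITIVE DEGENERATE types, and simple abelian `2p`-folds of Weil type with
`Bᵖ ≠ Dᵖ`, EXIST for every abelian non-cyclic CM field of degree `4p` -/

section Existence

section Group

variable {G : Type*} [CommGroup G] [Fintype G] [DecidableEq G] {ρ s τ : G} {p : ℕ}

omit [Fintype G] [DecidableEq G] in
/-- `τ^{c} τ^{d} = τ^{c+d}` with exponents read in `ℤ/p` (`τ` of order `p`). [folklore] -/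
private theorem pow_val_mul_pow_val [NeZero p] (hτ : orderOf τ = p) (c d : ZMod p) :
    τ ^ c.val * τ ^ d.val = τ ^ (c + d).val := by
  have h : (c.val + d.val) % p = (c.val + d.val) % orderOf τ := by rw [hτ]
  rw [← pow_add, ZMod.val_add, h, pow_mod_orderOf]

omit [Fintype G] [DecidableEq G] in
/-- Multiplication in the coordinates `(a, i, c) ↦ ρ^a s^i τ^c` is coordinatewise addition. [folklore] -/
private theorem coord_mul_coord [NeZero p] (hρ2 : ρ * ρ = 1) (hs2 : s * s = 1) (hτ : orderOf τ = p)
    (a i a' i' : Fin 2) (c c' : ZMod p) :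
    ρ ^ (a : ℕ) * (s ^ (i : ℕ) * τ ^ c.val) * (ρ ^ (a' : ℕ) * (s ^ (i' : ℕ) * τ ^ c'.val)) =
      ρ ^ ((a + a' : Fin 2) : ℕ) * (s ^ ((i + i' : Fin 2) : ℕ) * τ ^ (c + c').val) := by
  have h2 : ∀ x : Fin 2, x = 0 ∨ x = 1 := by decide
  have hρa : ρ ^ (a : ℕ) * ρ ^ (a' : ℕ) = ρ ^ ((a + a' : Fin 2) : ℕ) := by
    rcases h2 a with rfl | rfl <;> rcases h2 a' with rfl | rfl <;> simp [hρ2]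
  have hsi : s ^ (i : ℕ) * s ^ (i' : ℕ) = s ^ ((i + i' : Fin 2) : ℕ) := by
    rcases h2 i with rfl | rfl <;> rcases h2 i' with rfl | rfl <;> simp [hs2]
  calc ρ ^ (a : ℕ) * (s ^ (i : ℕ) * τ ^ c.val) * (ρ ^ (a' : ℕ) * (s ^ (i' : ℕ) * τ ^ c'.val))
      = (ρ ^ (a : ℕ) * ρ ^ (a' : ℕ)) * ((s ^ (i : ℕ) * s ^ (i' : ℕ)) * (τ ^ c.val * τ ^ c'.val)) := by ac_rfl
    _ = ρ ^ ((a + a' : Fin 2) : ℕ) * (s ^ ((i + i' : Fin 2) : ℕ) * τ ^ (c + c').val) := by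
        rw [hρa, hsi, pow_val_mul_pow_val hτ]

/-- **DODSON'S TYPE EXISTS ON THE FRAME (group level).**  In `G = ⟨ρ⟩ × ⟨s⟩ × ⟨τ⟩` (`|G| = 4p`, `p` an odd prime) the set
`T_D = {1, sτ} ∪ {ρτ^c : c ≠ 0} ∪ {ρsτ^c : c ≠ 1}` — Dodson's `f = ((1,1),(0,0),…,(0,0))` on `⟨ρ⟩ × ℤ_{2p}`, `ℤ_{2p} = ⟨sτ⟩`,
`f = 1` exactly on `{(sτ)⁰, (sτ)¹} = {1, sτ}` — is a CM type with NO non-trivial stabiliser (primitive) on which the QUADRATIC odd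
character `χ` with kernel `⟨τ, ρs⟩` (`χ(ρ) = χ(s) = −1`, `χ(τ) = 1`) VANISHES: `Σ_c ε₀(c) = Σ_c ε₁(c) = 2 − p`.
[cite: Dodson1984, §3.2.1 Theorem (proof)] [cite: Kubota1965, §4 Lemma 2] [cite: Hazama2003CyclicCM, §4 (4.1) and Prop. 2.3] -/
theorem exists_isCMTypeWith_primitive_sum_eq_zero [hp : Fact p.Prime] (hp2 : p ≠ 2) (hG : Fintype.card G = 4 * p)
    (hρ1 : ρ ≠ 1) (hρ2 : ρ * ρ = 1) (hs1 : s ≠ 1) (hs2 : s * s = 1) (hsρ : s ≠ ρ) (hτ : orderOf τ = p) :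
    ∃ T : Finset G, IsCMTypeWith ρ (T : Set G) ∧ (∀ u : G, u ≠ 1 → ¬ IsStableUnder T u) ∧
      ∃ χ : AddChar (Additive G) ℂ, χ (Additive.ofMul ρ) = -1 ∧ χ (Additive.ofMul s) = -1 ∧ χ (Additive.ofMul τ) = 1 ∧
        ∑ t ∈ T, χ (Additive.ofMul t) = 0 := by
  haveI : Fact (1 < p) := ⟨hp.out.one_lt⟩
  -- arithmetic in `ℤ/p`, `p` an odd prime
  have h10 : (1 : ZMod p) ≠ 0 := one_ne_zero
  have h20 : (2 : ZMod p) ≠ 0 := by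
    intro h
    have h' : ((2 : ℕ) : ZMod p) = 0 := by exact_mod_cast h
    rw [ZMod.natCast_eq_zero_iff] at h'
    exact hp2 ((Nat.prime_dvd_prime_iff_eq hp.out Nat.prime_two).1 h')
  have h2fin : ∀ x : Fin 2, x = 0 ∨ x = 1 := by decide
  -- coordinates
  set e : Fin 2 × Fin 2 × ZMod p → G := fun z => ρ ^ (z.1 : ℕ) * (s ^ (z.2.1 : ℕ) * τ ^ z.2.2.val) with he
  have hbij : Function.Bijective e := coord_bijective hp2 hG hρ1 hρ2 hs1 hs2 hsρ hτ
  have hmul : ∀ (a i : Fin 2) (c : ZMod p) (a' i' : Fin 2) (c' : ZMod p),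
      e (a, i, c) * e (a', i', c') = e (a + a', i + i', c + c') := fun a i c a' i' c' => by
    simp only [he]; exact coord_mul_coord hρ2 hs2 hτ a i a' i' c c'
  have he000 : e (0, 0, 0) = 1 := by simp [he]
  have he100 : e (1, 0, 0) = ρ := by simp [he]
  have he010 : e (0, 1, 0) = s := by simp [he]
  have he001 : e (0, 0, 1) = τ := by simp [he, ZMod.val_one]
  have he110 : e (1, 1, 0) = ρ * s := by simp [he]
  have he00c : ∀ c : ZMod p, e (0, 0, c) = τ ^ c.val := fun c => by simp [he]
  have he01c : ∀ c : ZMod p, e (0, 1, c) = s * τ ^ c.val := fun c => by simp [he]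
  -- Dodson's set, in coordinates
  set D : Fin 2 × Fin 2 × ZMod p → Prop := fun z =>
    (z.1 = 0 ∧ z.2.1 = 0 ∧ z.2.2 = 0) ∨ (z.1 = 0 ∧ z.2.1 = 1 ∧ z.2.2 = 1) ∨ (z.1 = 1 ∧ z.2.1 = 0 ∧ z.2.2 ≠ 0) ∨
      (z.1 = 1 ∧ z.2.1 = 1 ∧ z.2.2 ≠ 1) with hD
  set T : Finset G := (Finset.univ.filter fun z => D z).image e with hT
  have hmem : ∀ z, e z ∈ T ↔ D z := fun z => by
    rw [hT, hbij.1.mem_finset_image, Finset.mem_filter]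
    exact ⟨fun h => h.2, fun h => ⟨Finset.mem_univ _, h⟩⟩
  have hD00 : ∀ x : ZMod p, D (0, 0, x) ↔ x = 0 := fun x => by simp [hD]
  have hD01 : ∀ x : ZMod p, D (0, 1, x) ↔ x = 1 := fun x => by simp [hD]
  have hD10 : ∀ x : ZMod p, D (1, 0, x) ↔ x ≠ 0 := fun x => by simp [hD]
  have hD11 : ∀ x : ZMod p, D (1, 1, x) ↔ x ≠ 1 := fun x => by simp [hD]
  -- (1) CM type
  have hcm : IsCMTypeWith ρ (T : Set G) := by
    refine ⟨fun x => ?_, fun g x => ?_, fun x => ?_⟩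
    · obtain ⟨⟨a, i, c⟩, rfl⟩ := hbij.2 x
      rw [smul_eq_mul, Finset.mem_coe, Finset.mem_coe, ← he100, hmul, hmem, hmem]
      rcases h2fin a with rfl | rfl <;> rcases h2fin i with rfl | rfl
      · rw [show ((1 : Fin 2) + 0 : Fin 2) = 1 from by decide, show ((0 : Fin 2) + 0 : Fin 2) = 0 from by decide, zero_add,
          hD00, hD10, not_not]
      · rw [show ((1 : Fin 2) + 0 : Fin 2) = 1 from by decide, show ((0 : Fin 2) + 1 : Fin 2) = 1 from by decide, zero_add,
          hD01, hD11, not_not]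
      · rw [show ((1 : Fin 2) + 1 : Fin 2) = 0 from by decide, show ((0 : Fin 2) + 0 : Fin 2) = 0 from by decide, zero_add,
          hD10, hD00]
      · rw [show ((1 : Fin 2) + 1 : Fin 2) = 0 from by decide, show ((0 : Fin 2) + 1 : Fin 2) = 1 from by decide, zero_add,
          hD11, hD01]
    · show g * (ρ * x) = ρ * (g * x)
      rw [mul_left_comm]
    · show ρ * (ρ * x) = x
      rw [← mul_assoc, hρ2, one_mul]
  -- (2) no non-trivial stabiliser
  have hprim : ∀ u : G, u ≠ 1 → ¬ IsStableUnder T u := by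
    intro u hu1 hst
    obtain ⟨⟨a', i', d⟩, rfl⟩ := hbij.2 u
    have H : ∀ (a i : Fin 2) (c : ZMod p), D (a, i, c) ↔ D (a' + a, i' + i, d + c) := fun a i c => by
      rw [← hmem, ← hmem, ← hmul]; exact hst _
    rcases h2fin a' with rfl | rfl <;> rcases h2fin i' with rfl | rfl
    · -- `u = τ^d`, `d ≠ 0`: `1 ∈ T` but `τ^d ∉ T`
      have hd : d ≠ 0 := by rintro rfl; exact hu1 he000
      have h := (H 0 0 0).1 ((hD00 0).2 rfl)
      rw [show ((0 : Fin 2) + 0 : Fin 2) = 0 from by decide, add_zero, hD00] at h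
      exact hd h
    · -- `u = sτ^d`: `1 ↦ sτ^d` forces `d = 1`, `sτ ↦ τ^{d+1}` forces `d + 1 = 0`: `2 = 0`
      have h1 := (H 0 0 0).1 ((hD00 0).2 rfl)
      rw [show ((0 : Fin 2) + 0 : Fin 2) = 0 from by decide, show ((1 : Fin 2) + 0 : Fin 2) = 1 from by decide, add_zero,
        hD01] at h1
      have h2 := (H 0 1 1).1 ((hD01 1).2 rfl)
      rw [show ((0 : Fin 2) + 0 : Fin 2) = 0 from by decide, show ((1 : Fin 2) + 1 : Fin 2) = 0 from by decide, hD00] at h2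
      exact h20 (by linear_combination h2 - h1)
    · -- `u = ρτ^d`: `ρτ, ρτ² ∈ T ↦ τ^{d+1}, τ^{d+2} ∈ T`: `d + 1 = 0 = d + 2`
      have h1 := (H 1 0 1).1 ((hD10 1).2 h10)
      rw [show ((1 : Fin 2) + 1 : Fin 2) = 0 from by decide, show ((0 : Fin 2) + 0 : Fin 2) = 0 from by decide, hD00] at h1
      have h2 := (H 1 0 2).1 ((hD10 2).2 h20)
      rw [show ((1 : Fin 2) + 1 : Fin 2) = 0 from by decide, show ((0 : Fin 2) + 0 : Fin 2) = 0 from by decide, hD00] at h2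
      exact h10 (by linear_combination h2 - h1)
    · -- `u = ρsτ^d`: `ρτ, ρτ² ∈ T ↦ sτ^{d+1}, sτ^{d+2} ∈ T`: `d + 1 = 1 = d + 2`
      have h1 := (H 1 0 1).1 ((hD10 1).2 h10)
      rw [show ((1 : Fin 2) + 1 : Fin 2) = 0 from by decide, show ((1 : Fin 2) + 0 : Fin 2) = 1 from by decide, hD01] at h1
      have h2 := (H 1 0 2).1 ((hD10 2).2 h20)
      rw [show ((1 : Fin 2) + 1 : Fin 2) = 0 from by decide, show ((1 : Fin 2) + 0 : Fin 2) = 1 from by decide, hD01] at h2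
      exact h10 (by linear_combination h2 - h1)
  -- (3) the quadratic odd character with kernel `H₀ = {τ^c} ∪ {ρsτ^c} = e{(a, a, c)}`
  have haa : ∀ a : Fin 2, a + a = 0 := by decide
  let H₀ : Subgroup G :=
    { carrier := {g | ∃ (a : Fin 2) (c : ZMod p), g = e (a, a, c)}
      mul_mem' := by
        rintro _ _ ⟨a, c, rfl⟩ ⟨b, d, rfl⟩
        exact ⟨a + b, c + d, by rw [hmul]⟩
      one_mem' := ⟨0, 0, he000.symm⟩
      inv_mem' := by
        rintro _ ⟨a, c, rfl⟩
        refine ⟨a, -c, inv_eq_of_mul_eq_one_right ?_⟩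
        rw [hmul, haa, add_neg_cancel, he000] }
  have hmemH : ∀ (a : Fin 2) (c : ZMod p), e (a, a, c) ∈ H₀ := fun a c => ⟨a, c, rfl⟩
  have hρH : ρ ∉ H₀ := by
    rintro ⟨a, c, h⟩
    have h' := hbij.1 (he100.trans h)
    simp only [Prod.mk.injEq] at h'
    exact absurd (h'.2.1.trans h'.1.symm) (by decide)
  have hρq : Additive.ofMul ((ρ : G) : G ⧸ H₀) ≠ 0 := by
    rw [Ne, ofMul_eq_zero, QuotientGroup.eq_one_iff]; exact hρH
  obtain ⟨ψ, hψ⟩ := AddChar.exists_apply_ne_zero.2 hρq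
  let χ : AddChar (Additive G) ℂ := ψ.compAddMonoidHom (MonoidHom.toAdditive (QuotientGroup.mk' H₀))
  have hχ_apply : ∀ g : G, χ (Additive.ofMul g) = ψ (Additive.ofMul ((g : G) : G ⧸ H₀)) := fun g => rfl
  have hχH : ∀ g ∈ H₀, χ (Additive.ofMul g) = 1 := fun g hg => by
    rw [hχ_apply, (QuotientGroup.eq_one_iff g).2 hg, ofMul_one, AddChar.map_zero_eq_one]
  have hχρ : χ (Additive.ofMul ρ) = -1 := by
    have hsq : χ (Additive.ofMul ρ) * χ (Additive.ofMul ρ) = 1 := by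
      rw [← AddChar.map_add_eq_mul, ← ofMul_mul, hρ2, ofMul_one, AddChar.map_zero_eq_one]
    exact (mul_self_eq_one_iff.1 hsq).resolve_left (by rw [hχ_apply]; exact hψ)
  have hχτ : χ (Additive.ofMul τ) = 1 := hχH τ (he001 ▸ hmemH 0 1)
  have hχρs : χ (Additive.ofMul (ρ * s)) = 1 := hχH (ρ * s) (he110 ▸ hmemH 1 0)
  have hχs : χ (Additive.ofMul s) = -1 := by
    rw [show s = ρ * (ρ * s) by rw [← mul_assoc, hρ2, one_mul], ofMul_mul, AddChar.map_add_eq_mul, hχρ, hχρs, mul_one]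
  -- (4) the character sum: `Σ_c (ε₀(c) − ε₁(c)) = (2 − p) − (2 − p) = 0`
  have hS : ∀ a : ZMod p, ∑ c : ZMod p, (if c = a then (1 : ℂ) else -1) = 2 - (p : ℂ) := fun a => by
    have h1 : ∀ c : ZMod p, (if c = a then (1 : ℂ) else -1) = (if c = a then (2 : ℂ) else 0) + (-1) := fun c => by
      split_ifs <;> norm_num
    simp_rw [h1]
    rw [Finset.sum_add_distrib, Finset.sum_ite_eq' Finset.univ a, if_pos (Finset.mem_univ a), Finset.sum_const,
      Finset.card_univ, ZMod.card, nsmul_eq_mul]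
    ring
  refine ⟨T, hcm, hprim, χ, hχρ, hχs, hχτ, ?_⟩
  rw [sum_char_eq_sum_sign hp2 hG hρ1 hρ2 hs1 hs2 hsρ hτ hcm χ hχρ, hχτ, hχs]
  have hm0 : ∀ c : ZMod p, (τ ^ c.val ∈ T) = (c = 0) := fun c => by rw [← he00c, hmem, hD00]
  have hm1 : ∀ c : ZMod p, (s * τ ^ c.val ∈ T) = (c = 1) := fun c => by rw [← he01c, hmem, hD01]
  simp_rw [hm0, hm1, one_pow, mul_one]
  push_cast
  have h2 : ∀ c : ZMod p, ((if c = 0 then (1 : ℂ) else -1) + -1 * (if c = 1 then (1 : ℂ) else -1)) =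
      (if c = 0 then (1 : ℂ) else -1) - (if c = 1 then (1 : ℂ) else -1) := fun c => by ring
  simp_rw [h2]
  rw [Finset.sum_sub_distrib, hS 0, hS 1, sub_self]

end Group

section Field

open scoped Classical
open NumberField
open _root_.CategoryTheory _root_.CategoryTheory.Limits
open Literature.AlgebraicTopology.SingularHomology
open Literature.AlgebraicGeometry.Motives (AbelianVariety CMType)
open Literature.AlgebraicGeometry.HodgeTheory
open Literature.AlgebraicGeometry.ComplexMultiplication (IsCMTypeRealisation isSimple_iff_isPrimitive)
open Literature.AlgebraicGeometry.VanGeemen1994 (hodgeClassSpan)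
open Literature.Barriers.HodgeConjecture (divisorClassesSpan)
open Literature.AlgebraicGeometry.Pohlmann1968

variable {K : Type} [Field K] [NumberField K] [IsCMField K] [IsAbelianGalois ℚ K] {p : ℕ}

/-- **THEOREM (existence; Dodson's Thm. 3.2.1 for `n = 2p`, `(k, l) = (p, 2)`, in every abelian non-cyclic CM field of degree `4p`).**
There is a CM type `Φ` of `K`, PRIMITIVE at every base embedding, DEGENERATE, of Kubota rank EXACTLY `2p` (so the bound
`finrank_div_two_le_cmTypeRank_of_isPrimitive` is sharp); every abelian variety `A` of type `(K; Φ)` is a SIMPLE `2p`-fold with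
`Bᵖ(A) ⊗ ℂ ≠ Dᵖ(A) ⊗ ℂ` (Hazama's criterion), `Bᵐ(A) ⊗ ℂ = Dᵐ(A) ⊗ ℂ` for `m ≠ p`, of Weil type `(p, d)` for some `w = √-d ∈ 𝓞_K` lying in
an imaginary quadratic subfield of multiplicities `(p, p)`, with `Bᵖ(A) ⊗ ℂ = Dᵖ(A) ⊗ ℂ ⊔ W ⊗ ℂ`. [cite: Dodson1984, §3.2.1 Theorem]
[cite: Hazama2003CyclicCM, Rem. 4.10 and Thm. 4.8] [cite: Gordon1999HodgeAVSurvey, 5.13 (ii) and 9.5] [cite: vanGeemen1994HodgeAV, 4.7 and Thm. 6.12] -/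
theorem exists_isPrimitive_cmTypeRank_eq (hp : p.Prime) (hp2 : p ≠ 2) (hK : Module.finrank ℚ K = 4 * p)
    (hnc : ¬ IsCyclic (K ≃ₐ[ℚ] K)) :
    ∃ Φ : CMType K, (∀ φh : K →+* ℂ, IsPrimitive (ℂ ≃+* ℂ) Φ.1 φh) ∧ ¬ IsNondegenerate Φ ∧ cmTypeRank Φ = 2 * p ∧
      ∀ (A : AbelianVariety ℂ) (ι : 𝓞 K →+* End A) (θ : K →+* Module.End ℂ (complexBetti A.X 1)),
        IsCMTypeRealisation Φ A ι θ →
          A.IsSimple ∧ A.dim = 2 * p ∧ hodgeClassSpan A.dim A.X p ≠ divisorClassesSpan A.X A.dim p ∧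
            (∀ m : ℕ, m ≠ p → hodgeClassSpan A.dim A.X m = divisorClassesSpan A.X A.dim m) ∧
            ∃ (k : IntermediateField ℚ K) (w : 𝓞 K) (d : ℕ), Module.finrank ℚ k = 2 ∧ (w : K) ∈ k ∧
              (∀ t : k →+* ℂ, {φ : K →+* ℂ | φ.comp (algebraMap k K) = t ∧ φ ∈ Φ.1}.ncard =
                {φ : K →+* ℂ | φ.comp (algebraMap k K) = t ∧ φ ∉ Φ.1}.ncard) ∧
              0 < d ∧ w ^ 2 = -(d : 𝓞 K) ∧ IsWeilType A (ι w) p d ∧ IsDivisorWeilGenerated A (ι w) p d ∧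
              hodgeClassSpan A.dim A.X p = divisorClassesSpan A.X A.dim p ⊔ weilClassesOf A (ι w) p d := by
  haveI := Fact.mk hp
  obtain ⟨hG, hρ1, hρ2, s, τ, hs1, hs2, hsρ, hτ⟩ := exists_frame_of_not_isCyclic hp hp2 hK hnc
  obtain ⟨φ₀⟩ : Nonempty (K →+* ℂ) := inferInstance
  have hρ : ∀ x, φ₀ ((conjGal : K ≃ₐ[ℚ] K) x) = starRingEnd ℂ (φ₀ x) := fun x =>
    IsCMField.complexEmbedding_complexConj K φ₀ x
  have hcomm : ∀ g h : K ≃ₐ[ℚ] K, g * h = h * g := fun g h => mul_comm g h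
  obtain ⟨T, hcm, hprimT, χ, hχρ, -, -, h0⟩ := exists_isCMTypeWith_primitive_sum_eq_zero hp2 hG hρ1 hρ2 hs1 hs2 hsρ hτ
  obtain ⟨Φ, hΦ⟩ := CyclicTwoOddPrimes.exists_cmType_of_isCMTypeWith (φ₀ := φ₀) hρ hcm
  have hprim' : ∀ u : K ≃ₐ[ℚ] K, u ≠ 1 →
      ¬ IsStableUnder (Finset.univ.filter fun g : K ≃ₐ[ℚ] K => embOf φ₀ g ∈ Φ.1) u := by rw [hΦ]; exact hprimT
  have hprim : ∀ φh : K →+* ℂ, IsPrimitive (ℂ ≃+* ℂ) Φ.1 φh := fun φh =>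
    (CyclicTwoOddPrimes.isPrimitive_iff (φ₀ := φ₀) Φ φh).2 hprim'
  have h0' : ∑ g ∈ Finset.univ.filter (fun g : K ≃ₐ[ℚ] K => embOf φ₀ g ∈ Φ.1), χ (Additive.ofMul g) = 0 := by
    rw [hΦ]; exact h0
  have hdeg : ¬ IsNondegenerate Φ := fun hnd =>
    (isNondegenerate_iff_forall_oddCharacters hcomm Φ φ₀ conjGal hρ).1 hnd χ hχρ h0'
  have hrank : cmTypeRank Φ = 2 * p := by
    rcases cmTypeRank_eq_or_of_isPrimitive hp hp2 hK hnc Φ φ₀ (hprim φ₀) with ⟨h, -⟩ | ⟨-, h⟩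
    · exact h
    · exact absurd h hdeg
  refine ⟨Φ, hprim, hdeg, hrank, fun A ι θ hA => ?_⟩
  have hS : A.IsSimple := (isSimple_iff_isPrimitive hA φ₀).2 (hprim φ₀)
  have hdimK : A.dim = Module.finrank ℚ K / 2 := Motives.schemeDim_eq_holds hA.1
  have hdim : A.dim = 2 * p := by rw [hdimK, hK]; omega
  rcases hodgeConjectureFor_pow_or_weilType_of_isPrimitive hp hp2 hK hnc φ₀ (hprim φ₀) hA with
    ⟨hnd, -, -⟩ | ⟨-, -, hoff, k, w, d, hk2, hwk, hmult, hd, hw2, hWT, hDW, hsup, -⟩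
  · exact absurd hnd hdeg
  -- Hazama's criterion: `Φ` degenerate and primitive ⟹ NOT all `Bᵐ(A) = Dᵐ(A)`; off degree `p` they agree, so `Bᵖ ≠ Dᵖ`
  have hne : hodgeClassSpan A.dim A.X p ≠ divisorClassesSpan A.X A.dim p := by
    intro hpeq
    have hall : ∀ m : ℕ, hodgeClassSpan (Module.finrank ℚ K / 2) A.X m = divisorClassesSpan A.X (Module.finrank ℚ K / 2) m := by
      intro m
      rw [← hdimK]
      by_cases hm : m = p
      · rw [hm]; exact hpeq
      · exact hoff m hm
    exact hdeg ((isNondegenerate_iff_forall_pow_hodgeClassSpan_eq φ₀ (hprim φ₀) hA).2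
      ((forall_pow_hodgeClassSpan_eq_iff_forall_hodgeClassSpan_eq hA).2 hall))
  exact ⟨hS, hdim, hne, hoff, k, w, d, hk2, hwk, hmult, hd, hw2, hWT, hDW, hsup⟩

/-- **Simple abelian `2p`-folds of Weil type with complex multiplication by `K` and `Bᵖ ≠ Dᵖ` EXIST** (Shimura's existence theorem
`exists_isCMTypeRealisation` applied to Dodson's type). [cite: Dodson1984, §3.2.1 Theorem] [cite: Shimura1998, §6.2 Thm. 3]
[cite: Gordon1999HodgeAVSurvey, 5.13 (ii)] -/
theorem exists_realisation_isSimple_weilType (hp : p.Prime) (hp2 : p ≠ 2) (hK : Module.finrank ℚ K = 4 * p)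
    (hnc : ¬ IsCyclic (K ≃ₐ[ℚ] K)) :
    ∃ (Φ : CMType K) (A : AbelianVariety ℂ) (ι : 𝓞 K →+* End A) (θ : K →+* Module.End ℂ (complexBetti A.X 1)),
      IsCMTypeRealisation Φ A ι θ ∧ (∀ φh : K →+* ℂ, IsPrimitive (ℂ ≃+* ℂ) Φ.1 φh) ∧ ¬ IsNondegenerate Φ ∧ cmTypeRank Φ = 2 * p ∧
        A.IsSimple ∧ A.dim = 2 * p ∧ hodgeClassSpan A.dim A.X p ≠ divisorClassesSpan A.X A.dim p ∧
        (∀ m : ℕ, m ≠ p → hodgeClassSpan A.dim A.X m = divisorClassesSpan A.X A.dim m) ∧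
        ∃ (w : 𝓞 K) (d : ℕ), 0 < d ∧ w ^ 2 = -(d : 𝓞 K) ∧ IsWeilType A (ι w) p d ∧
          hodgeClassSpan A.dim A.X p = divisorClassesSpan A.X A.dim p ⊔ weilClassesOf A (ι w) p d := by
  obtain ⟨Φ, hprim, hdeg, hrank, hall⟩ := exists_isPrimitive_cmTypeRank_eq hp hp2 hK hnc
  obtain ⟨A, ι, θ, hA⟩ := exists_isCMTypeRealisation Φ
  obtain ⟨hS, hdim, hne, hoff, -, w, d, -, -, -, hd, hw2, hWT, -, hsup⟩ := hall A ι θ hA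
  exact ⟨Φ, A, ι, θ, hA, hprim, hdeg, hrank, hS, hdim, hne, hoff, w, d, hd, hw2, hWT, hsup⟩

end Field

section CyclotomicExistence

open NumberField
open _root_.CategoryTheory _root_.CategoryTheory.Limits
open Literature.AlgebraicTopology.SingularHomology
open Literature.AlgebraicGeometry.Motives (AbelianVariety CMType)
open Literature.AlgebraicGeometry.HodgeTheory
open Literature.AlgebraicGeometry.ComplexMultiplication (IsCMTypeRealisation)
open Literature.AlgebraicGeometry.VanGeemen1994 (hodgeClassSpan)
open Literature.Barriers.HodgeConjecture (divisorClassesSpan)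
open Literature.AlgebraicGeometry.Pohlmann1968

variable {q p : ℕ}

/-- **`ℚ(ζ_q)`, `(ℤ/q)ˣ` non-cyclic of order `4p`: simple CM `2p`-folds of Weil type with `Bᵖ ≠ Dᵖ` exist** (the second branch of the
trichotomy is inhabited). [cite: Dodson1984, §3.2.1 Theorem] [cite: Gordon1999HodgeAVSurvey, 5.13 (ii)] -/
theorem exists_realisation_isSimple_weilType_of_isCyclotomicExtension [NeZero q] (h2q : 2 < q) (hncq : ¬ IsCyclic (ZMod q)ˣ)
    (hφ : Nat.totient q = 4 * p) (hp : p.Prime) (hp2 : p ≠ 2) (L : Type) [Field L] [NumberField L]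
    [IsCyclotomicExtension {q} ℚ L] :
    ∃ (Φ : CMType L) (A : AbelianVariety ℂ) (ι : 𝓞 L →+* End A) (θ : L →+* Module.End ℂ (complexBetti A.X 1)),
      IsCMTypeRealisation Φ A ι θ ∧ ¬ IsNondegenerate Φ ∧ cmTypeRank Φ = 2 * p ∧ A.IsSimple ∧ A.dim = 2 * p ∧
        hodgeClassSpan A.dim A.X p ≠ divisorClassesSpan A.X A.dim p ∧
        (∀ m : ℕ, m ≠ p → hodgeClassSpan A.dim A.X m = divisorClassesSpan A.X A.dim m) ∧
        ∃ (w : 𝓞 L) (d : ℕ), 0 < d ∧ w ^ 2 = -(d : 𝓞 L) ∧ IsWeilType A (ι w) p d := by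
  obtain ⟨hcm, hab, hnc, hL⟩ := cm_abelian_not_isCyclic_finrank_of_isCyclotomicExtension h2q hncq L
  haveI := hcm; haveI := hab
  obtain ⟨Φ, A, ι, θ, hA, -, hdeg, hrank, hS, hdim, hne, hoff, w, d, hd, hw2, hWT, -⟩ :=
    exists_realisation_isSimple_weilType hp hp2 (hL.trans hφ) hnc
  exact ⟨Φ, A, ι, θ, hA, hdeg, hrank, hS, hdim, hne, hoff, w, d, hd, hw2, hWT⟩

/-- **`ℚ(ζ₂₁)`: simple CM abelian SIXFOLDS of Weil type `(3, d)` with `B³ ≠ D³` exist** (Dodson's first non-cyclic examples; the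
tree's `DegenerateCMTypeCyclotomic21` from the character side). [cite: Dodson1984, §3.2.1 Theorem] [cite: Gordon1999HodgeAVSurvey, 5.13 (ii)] -/
theorem exists_realisation_isSimple_weilType_twentyOne (L : Type) [Field L] [NumberField L] [IsCyclotomicExtension {21} ℚ L] :
    ∃ (Φ : CMType L) (A : AbelianVariety ℂ) (ι : 𝓞 L →+* End A) (θ : L →+* Module.End ℂ (complexBetti A.X 1)),
      IsCMTypeRealisation Φ A ι θ ∧ ¬ IsNondegenerate Φ ∧ cmTypeRank Φ = 2 * 3 ∧ A.IsSimple ∧ A.dim = 2 * 3 ∧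
        hodgeClassSpan A.dim A.X 3 ≠ divisorClassesSpan A.X A.dim 3 ∧
        (∀ m : ℕ, m ≠ 3 → hodgeClassSpan A.dim A.X m = divisorClassesSpan A.X A.dim m) ∧
        ∃ (w : 𝓞 L) (d : ℕ), 0 < d ∧ w ^ 2 = -(d : 𝓞 L) ∧ IsWeilType A (ι w) 3 d :=
  exists_realisation_isSimple_weilType_of_isCyclotomicExtension (by norm_num) not_isCyclic_units_twentyOne (by decide)
    (by norm_num) (by norm_num) L

/-- **`ℚ(ζ₃₃)`: simple CM abelian `10`-FOLDS of Weil type `(5, d)` with `B⁵ ≠ D⁵` exist.** [cite: Dodson1984, §3.2.1 Theorem]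
[cite: Gordon1999HodgeAVSurvey, 5.13 (ii)] -/
theorem exists_realisation_isSimple_weilType_thirtyThree (L : Type) [Field L] [NumberField L] [IsCyclotomicExtension {33} ℚ L] :
    ∃ (Φ : CMType L) (A : AbelianVariety ℂ) (ι : 𝓞 L →+* End A) (θ : L →+* Module.End ℂ (complexBetti A.X 1)),
      IsCMTypeRealisation Φ A ι θ ∧ ¬ IsNondegenerate Φ ∧ cmTypeRank Φ = 2 * 5 ∧ A.IsSimple ∧ A.dim = 2 * 5 ∧
        hodgeClassSpan A.dim A.X 5 ≠ divisorClassesSpan A.X A.dim 5 ∧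
        (∀ m : ℕ, m ≠ 5 → hodgeClassSpan A.dim A.X m = divisorClassesSpan A.X A.dim m) ∧
        ∃ (w : 𝓞 L) (d : ℕ), 0 < d ∧ w ^ 2 = -(d : 𝓞 L) ∧ IsWeilType A (ι w) 5 d :=
  exists_realisation_isSimple_weilType_of_isCyclotomicExtension (by norm_num) not_isCyclic_units_thirtyThree (by decide)
    (by norm_num) (by norm_num) L

/-- **`ℚ(ζ₄₄)`: simple CM abelian `10`-FOLDS of Weil type `(5, d)` with `B⁵ ≠ D⁵` exist.** [cite: Dodson1984, §3.2.1 Theorem]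
[cite: Gordon1999HodgeAVSurvey, 5.13 (ii)] -/
theorem exists_realisation_isSimple_weilType_fortyFour (L : Type) [Field L] [NumberField L] [IsCyclotomicExtension {44} ℚ L] :
    ∃ (Φ : CMType L) (A : AbelianVariety ℂ) (ι : 𝓞 L →+* End A) (θ : L →+* Module.End ℂ (complexBetti A.X 1)),
      IsCMTypeRealisation Φ A ι θ ∧ ¬ IsNondegenerate Φ ∧ cmTypeRank Φ = 2 * 5 ∧ A.IsSimple ∧ A.dim = 2 * 5 ∧
        hodgeClassSpan A.dim A.X 5 ≠ divisorClassesSpan A.X A.dim 5 ∧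
        (∀ m : ℕ, m ≠ 5 → hodgeClassSpan A.dim A.X m = divisorClassesSpan A.X A.dim m) ∧
        ∃ (w : 𝓞 L) (d : ℕ), 0 < d ∧ w ^ 2 = -(d : 𝓞 L) ∧ IsWeilType A (ι w) 5 d :=
  exists_realisation_isSimple_weilType_of_isCyclotomicExtension (by norm_num) not_isCyclic_units_fortyFour (by decide)
    (by norm_num) (by norm_num) L

end CyclotomicExistence

end Existence

/-! ## §7 (gen 63 append) EVERY ABELIAN CM FIELD OF DEGREE `4p`: an abelian group of order `4p` (`p` odd) is cyclic (the lane's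
`CyclicTwoPowerTimesPrimeCMTypes`, `k = 1`: every type nondegenerate-or-induced, `B = D` and HC on all powers) or `ℤ/2 × ℤ/2p` (§§2–6) -/

section AbelianFourTimesPrime

open NumberField
open _root_.CategoryTheory _root_.CategoryTheory.Limits
open Literature.AlgebraicTopology.SingularHomology
open Literature.AlgebraicGeometry.Motives (AbelianVariety CMType)
open Literature.AlgebraicGeometry.HodgeTheory
open Literature.AlgebraicGeometry.ComplexMultiplication (IsCMTypeRealisation isSimple_iff_isPrimitive)
open Literature.AlgebraicGeometry.VanGeemen1994 (hodgeClassSpan)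
open Literature.Barriers.HodgeConjecture (divisorClassesSpan)
open Literature.AlgebraicGeometry.Pohlmann1968
open Literature.AlgebraicGeometry.ComplexMultiplication.CyclicTwoPowerTimesPrime (isNondegenerate_of_isPrimitive_of_isCyclic
  hodgeClassSpan_pow_eq_divisorClassesSpan_of_isCyclic hodgeConjectureFor_pow_of_isCyclic)

variable {K : Type} [Field K] [NumberField K] [IsCMField K] [IsAbelianGalois ℚ K] {p : ℕ}
  {Φ : CMType K} {A : AbelianVariety ℂ} {ι : 𝓞 K →+* End A} {θ : K →+* Module.End ℂ (complexBetti A.X 1)}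

/-- **Corank `≤ 1` for EVERY abelian CM field of degree `4p`** (`p` an odd prime): a primitive CM type has Kubota rank `≥ 2p` — in the
cyclic case it is even nondegenerate (rank `2p + 1`, the lane's `CyclicTwoPowerTimesPrime.isNondegenerate_of_isPrimitive_of_isCyclic`).
[cite: Kubota1965, §4 Lemma 2] [cite: Dodson1987, Thm. 1.0 (ii)] [cite: Hazama2003CyclicCM, Thm. 4.8] -/
theorem finrank_div_two_le_cmTypeRank_of_isPrimitive_of_finrank_eq (hp : p.Prime) (hp2 : p ≠ 2)
    (hK : Module.finrank ℚ K = 4 * p) (Φ : CMType K) (φ₀ : K →+* ℂ) (hprim : IsPrimitive (ℂ ≃+* ℂ) Φ.1 φ₀) :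
    Module.finrank ℚ K / 2 ≤ cmTypeRank Φ := by
  by_cases hcyc : IsCyclic (K ≃ₐ[ℚ] K)
  · have hK' : Module.finrank ℚ K = 2 ^ (1 + 1) * p := by rw [hK]; norm_num
    have h := isNondegenerate_of_isPrimitive_of_isCyclic hcyc hp hp2 hK' Φ φ₀ hprim
    rw [isNondegenerate_iff] at h
    omega
  · exact finrank_div_two_le_cmTypeRank_of_isPrimitive hp hp2 hK hcyc Φ φ₀ hprim

/-- **THE TRICHOTOMY FOR EVERY ABELIAN VARIETY WITH COMPLEX MULTIPLICATION BY AN ABELIAN CM FIELD OF DEGREE `4p`** (`p` an odd prime;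
ANY CM type, ANY realisation; NO cyclicity hypothesis): `B•(Aⁿ) ⊗ ℂ = D•(Aⁿ) ⊗ ℂ` and the Hodge conjecture for every power `Aⁿ`,
unconditionally — OR (only possible when `Gal(K/ℚ) ≅ ℤ/2 × ℤ/2p`) `A` is simple of a rank-`2p` type, of Weil type `(p, d)` over an imaginary
quadratic subfield, `Bᵠ(A) = Dᵠ(A)` (`⊗ ℂ`) for `q ≠ p`, `Bᵖ(A) ⊗ ℂ = Dᵖ ⊗ ℂ ⊔ W ⊗ ℂ`, HC for `A` and all `Aⁿ` implied by the algebraicity of the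
rational `(p,p)` classes of that one Weil plane. [cite: Gordon1999HodgeAVSurvey, 5.13 and Thm. 6.4 and §9.3–9.5] [cite: Kubota1965, §4 Lemma 2]
[cite: vanGeemen1994HodgeAV, 4.7 and Thm. 6.12] [cite: Hazama2003CyclicCM, Thm. 4.8] -/
theorem hodgeClassSpan_pow_eq_or_weilType_of_finrank_eq (hp : p.Prime) (hp2 : p ≠ 2) (hK : Module.finrank ℚ K = 4 * p)
    (hA : IsCMTypeRealisation Φ A ι θ) :
    ((∀ n m : ℕ, hodgeClassSpan (⨁ fun _ : Fin n => A).dim (⨁ fun _ : Fin n => A).X m =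
          divisorClassesSpan (⨁ fun _ : Fin n => A).X (⨁ fun _ : Fin n => A).dim m) ∧
        ∀ n : ℕ, HodgeConjectureFor (⨁ fun _ : Fin n => A).dim (⨁ fun _ : Fin n => A).X) ∨
      (¬ IsCyclic (K ≃ₐ[ℚ] K) ∧ A.IsSimple ∧ cmTypeRank Φ = 2 * p ∧ ¬ IsNondegenerate Φ ∧
        (∀ q : ℕ, q ≠ p → hodgeClassSpan A.dim A.X q = divisorClassesSpan A.X A.dim q) ∧
        ∃ (k : IntermediateField ℚ K) (w : 𝓞 K) (d : ℕ), Module.finrank ℚ k = 2 ∧ (w : K) ∈ k ∧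
          (∀ t : k →+* ℂ, {φ : K →+* ℂ | φ.comp (algebraMap k K) = t ∧ φ ∈ Φ.1}.ncard =
            {φ : K →+* ℂ | φ.comp (algebraMap k K) = t ∧ φ ∉ Φ.1}.ncard) ∧
          0 < d ∧ w ^ 2 = -(d : 𝓞 K) ∧ IsWeilType A (ι w) p d ∧ IsDivisorWeilGenerated A (ι w) p d ∧
          hodgeClassSpan A.dim A.X p = divisorClassesSpan A.X A.dim p ⊔ weilClassesOf A (ι w) p d ∧
          ((∀ c ∈ weilClassesOf A (ι w) p d, IsRationalClass c → IsOfHodgeType (2 * p) A.X (2 * p) p p c →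
              c ∈ algebraicClasses A.X p) →
            HodgeConjectureFor A.dim A.X ∧
              ∀ n : ℕ, HodgeConjectureFor (⨁ fun _ : Fin n => A).dim (⨁ fun _ : Fin n => A).X)) := by
  by_cases hcyc : IsCyclic (K ≃ₐ[ℚ] K)
  · have hK' : Module.finrank ℚ K = 2 ^ (1 + 1) * p := by rw [hK]; norm_num
    exact Or.inl ⟨fun n m => hodgeClassSpan_pow_eq_divisorClassesSpan_of_isCyclic hcyc hp hp2 hK' hA n m, fun n =>
      hodgeConjectureFor_pow_of_isCyclic hcyc hp hp2 hK' hA n⟩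
  · rcases hodgeClassSpan_pow_eq_or_weilType hp hp2 hK hcyc hA with h | h
    · exact Or.inl h
    · exact Or.inr ⟨hcyc, h⟩

/-- **`Bᵐ(A) ⊗ ℂ = Dᵐ(A) ⊗ ℂ` for all `m ≠ p`, for EVERY abelian variety with complex multiplication by ANY abelian CM field of degree `4p`**
— unconditional. [cite: vanGeemen1994HodgeAV, Thm. 6.12] [cite: Gordon1999HodgeAVSurvey, 5.13 and Thm. 6.4] -/
theorem hodgeClassSpan_eq_divisorClassesSpan_of_ne_of_finrank_eq (hp : p.Prime) (hp2 : p ≠ 2)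
    (hK : Module.finrank ℚ K = 4 * p) (hA : IsCMTypeRealisation Φ A ι θ) {m : ℕ} (hm : m ≠ p) :
    hodgeClassSpan A.dim A.X m = divisorClassesSpan A.X A.dim m := by
  by_cases hcyc : IsCyclic (K ≃ₐ[ℚ] K)
  · have hK' : Module.finrank ℚ K = 2 ^ (1 + 1) * p := by rw [hK]; norm_num
    have hdimK : A.dim = Module.finrank ℚ K / 2 := Motives.schemeDim_eq_holds hA.1
    rw [hdimK]
    exact (forall_pow_hodgeClassSpan_eq_iff_forall_hodgeClassSpan_eq hA).1
      (fun n m => hodgeClassSpan_pow_eq_divisorClassesSpan_of_isCyclic hcyc hp hp2 hK' hA n m) m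
  · exact hodgeClassSpan_eq_divisorClassesSpan_of_ne hp hp2 hK hcyc hA hm

/-- **The Hodge conjecture for EVERY abelian variety with complex multiplication by an abelian CM field of degree `4p` whose Galois group is
CYCLIC, or which is NOT SIMPLE, or whose type is nondegenerate — with all its powers, unconditionally** (the complement of the Weil-type
branch). [cite: Gordon1999HodgeAVSurvey, Thm. 6.4 and §9.3] [cite: Kubota1965, §4 Lemma 2] -/
theorem hodgeConjectureFor_pow_of_isCyclic_or_not_isSimple_or_isNondegenerate (hp : p.Prime) (hp2 : p ≠ 2)
    (hK : Module.finrank ℚ K = 4 * p) (hA : IsCMTypeRealisation Φ A ι θ)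
    (h : IsCyclic (K ≃ₐ[ℚ] K) ∨ ¬ A.IsSimple ∨ IsNondegenerate Φ) (n : ℕ) :
    HodgeConjectureFor (⨁ fun _ : Fin n => A).dim (⨁ fun _ : Fin n => A).X := by
  rcases hodgeClassSpan_pow_eq_or_weilType_of_finrank_eq hp hp2 hK hA with ⟨-, hHC⟩ | ⟨hnc, hS, -, hdeg, -⟩
  · exact hHC n
  · exfalso
    rcases h with h | h | h
    · exact hnc h
    · exact h hS
    · exact hdeg h

/-- **`ℚ(ζ_q)` for ANY `q` with `φ(q) = 4p`** (`q = 21, 28, 36, 42` and `13, 26, 53, …` for small `p`; in general every level of totient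
`4p`): the trichotomy, with no hypothesis on `(ℤ/q)ˣ`. [cite: Gordon1999HodgeAVSurvey, 5.13 and Thm. 6.4] [cite: Washington1997, Ch. 2 Thm. 2.5] -/
theorem hodgeClassSpan_pow_eq_or_weilType_of_isCyclotomicExtension_of_totient_eq {q : ℕ} [NeZero q] {L : Type} [Field L]
    [NumberField L] [IsCyclotomicExtension {q} ℚ L] {Ψ : CMType L} {B : AbelianVariety ℂ} {ι' : 𝓞 L →+* End B}
    {θ' : L →+* Module.End ℂ (complexBetti B.X 1)} (h2q : 2 < q) (hφ : Nat.totient q = 4 * p) (hp : p.Prime) (hp2 : p ≠ 2)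
    (hB : IsCMTypeRealisation Ψ B ι' θ') :
    ((∀ n m : ℕ, hodgeClassSpan (⨁ fun _ : Fin n => B).dim (⨁ fun _ : Fin n => B).X m =
          divisorClassesSpan (⨁ fun _ : Fin n => B).X (⨁ fun _ : Fin n => B).dim m) ∧
        ∀ n : ℕ, HodgeConjectureFor (⨁ fun _ : Fin n => B).dim (⨁ fun _ : Fin n => B).X) ∨
      (¬ IsCyclic (L ≃ₐ[ℚ] L) ∧ B.IsSimple ∧ cmTypeRank Ψ = 2 * p ∧ ¬ IsNondegenerate Ψ ∧
        (∀ m : ℕ, m ≠ p → hodgeClassSpan B.dim B.X m = divisorClassesSpan B.X B.dim m) ∧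
        ∃ (k : IntermediateField ℚ L) (w : 𝓞 L) (d : ℕ), Module.finrank ℚ k = 2 ∧ (w : L) ∈ k ∧
          (∀ t : k →+* ℂ, {φ : L →+* ℂ | φ.comp (algebraMap k L) = t ∧ φ ∈ Ψ.1}.ncard =
            {φ : L →+* ℂ | φ.comp (algebraMap k L) = t ∧ φ ∉ Ψ.1}.ncard) ∧
          0 < d ∧ w ^ 2 = -(d : 𝓞 L) ∧ IsWeilType B (ι' w) p d ∧ IsDivisorWeilGenerated B (ι' w) p d ∧
          hodgeClassSpan B.dim B.X p = divisorClassesSpan B.X B.dim p ⊔ weilClassesOf B (ι' w) p d ∧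
          ((∀ c ∈ weilClassesOf B (ι' w) p d, IsRationalClass c → IsOfHodgeType (2 * p) B.X (2 * p) p p c →
              c ∈ algebraicClasses B.X p) →
            HodgeConjectureFor B.dim B.X ∧
              ∀ n : ℕ, HodgeConjectureFor (⨁ fun _ : Fin n => B).dim (⨁ fun _ : Fin n => B).X)) := by
  have hirr : Irreducible (cyclotomic q ℚ) := cyclotomic.irreducible_rat (NeZero.pos q)
  haveI := IsCyclotomicExtension.Rat.isCMField L (S := ({q} : Set ℕ)) ⟨q, rfl, h2q⟩
  haveI := IsCyclotomicExtension.isAbelianGalois {q} ℚ L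
  exact hodgeClassSpan_pow_eq_or_weilType_of_finrank_eq hp hp2 ((IsCyclotomicExtension.finrank L hirr).trans hφ) hB

end AbelianFourTimesPrime

/-! ## §8 (gen 63 append) THE CENSUS for `ℤ/2 × ℤ/2p` (the analogue of Hazama's Thm. 4.8 (vi)): of the `4^p` CM types, `2^{p+1}` are
not primitive, `2·(C(2p,p) − 2^p)` are primitive and degenerate (rank `2p`), `4^p − 2·C(2p,p)` are nondegenerate -/

section Census

section Group

variable {G : Type*} [CommGroup G] [Fintype G] [DecidableEq G] {ρ s τ : G} {p : ℕ}

/-- A subset of `ℤ/p` stable under a non-zero translation is `∅` or everything (`ℤ/p` is a field: `d ≠ 0` generates). [folklore] -/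
private theorem eq_empty_or_univ_of_forall_mem_iff [hp : Fact p.Prime] (A : Finset (ZMod p)) {d : ZMod p} (hd : d ≠ 0)
    (h : ∀ c, c ∈ A ↔ d + c ∈ A) : A = ∅ ∨ A = Finset.univ := by
  have hn : ∀ (n : ℕ) (c : ZMod p), c ∈ A ↔ n • d + c ∈ A := by
    intro n
    induction n with
    | zero => intro c; rw [zero_nsmul, zero_add]
    | succ n ih => intro c; rw [h c, ih (d + c), succ_nsmul, add_assoc]
  have hall : ∀ x y : ZMod p, (x ∈ A ↔ y ∈ A) := fun x y => by
    have key : y = ((y - x) * d⁻¹).val • d + x := by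
      rw [nsmul_eq_mul, ZMod.natCast_zmod_val, inv_mul_cancel_right₀ hd, sub_add_cancel]
    rw [key]; exact hn _ x
  by_cases hA : A = ∅
  · exact Or.inl hA
  · right
    obtain ⟨x, hx⟩ := Finset.nonempty_iff_ne_empty.2 hA
    exact Finset.eq_univ_of_forall fun y => (hall x y).1 hx

/-- `Σ_c (±1 according as c ∈ A) = 2·|A| − p`. [folklore] -/
private theorem sum_sign_eq [NeZero p] (A : Finset (ZMod p)) :
    ∑ c : ZMod p, (if c ∈ A then (1 : ℂ) else -1) = 2 * (A.card : ℂ) - p := by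
  have h1 : ∀ c : ZMod p, (if c ∈ A then (1 : ℂ) else -1) = (if c ∈ A then (2 : ℂ) else 0) + (-1) := fun c => by
    split_ifs <;> norm_num
  simp_rw [h1]
  rw [Finset.sum_add_distrib, Finset.sum_ite_mem, Finset.univ_inter, Finset.sum_const, Finset.sum_const, Finset.card_univ,
    ZMod.card, nsmul_eq_mul, nsmul_eq_mul]
  ring

omit [DecidableEq G] in
/-- An odd character trivial on a given subgroup missing `ρ` (Pontryagin duality on `G ⧸ H₀`). [cite: Kubota1965, §4 Lemma 2 (proof)] -/
private theorem exists_oddChar_eq_one_of_not_mem (hρ2 : ρ * ρ = 1) (H₀ : Subgroup G) (hρH : ρ ∉ H₀) :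
    ∃ χ : AddChar (Additive G) ℂ, χ (Additive.ofMul ρ) = -1 ∧ ∀ g ∈ H₀, χ (Additive.ofMul g) = 1 := by
  have hρq : Additive.ofMul ((ρ : G) : G ⧸ H₀) ≠ 0 := by
    rw [Ne, ofMul_eq_zero, QuotientGroup.eq_one_iff]; exact hρH
  obtain ⟨ψ, hψ⟩ := AddChar.exists_apply_ne_zero.2 hρq
  let χ : AddChar (Additive G) ℂ := ψ.compAddMonoidHom (MonoidHom.toAdditive (QuotientGroup.mk' H₀))
  have hχ_apply : ∀ g : G, χ (Additive.ofMul g) = ψ (Additive.ofMul ((g : G) : G ⧸ H₀)) := fun g => rfl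
  refine ⟨χ, ?_, fun g hg => ?_⟩
  · have hsq : χ (Additive.ofMul ρ) * χ (Additive.ofMul ρ) = 1 := by
      rw [← AddChar.map_add_eq_mul, ← ofMul_mul, hρ2, ofMul_one, AddChar.map_zero_eq_one]
    exact (mul_self_eq_one_iff.1 hsq).resolve_left (by rw [hχ_apply]; exact hψ)
  · rw [hχ_apply, (QuotientGroup.eq_one_iff g).2 hg, ofMul_one, AddChar.map_zero_eq_one]

/-- **THE DICTIONARY `T ↦ (A₀, A₁)` (`A₀ = {c : τ^c ∈ T}`, `A₁ = {c : sτ^c ∈ T}`): every pair of subsets of `ℤ/p` comes from a CM type,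
which is unique; the type is NOT primitive iff `A₁ ∈ {A₀, A₀ᶜ}`; a primitive type is DEGENERATE (killed by an odd character) iff
`|A₀| = |A₁|` or `|A₀| + |A₁| = p`** — Hazama's `E(S)` for `ℤ/2 × ℤ/2p`. [cite: Hazama2003CyclicCM, §4 Prop. 4.1 and Thm. 4.8 (iii)–(vi)]
[cite: Kubota1965, §4 Lemma 2] -/
theorem census_dictionary [hp : Fact p.Prime] (hp2 : p ≠ 2) (hG : Fintype.card G = 4 * p) (hρ1 : ρ ≠ 1) (hρ2 : ρ * ρ = 1)
    (hs1 : s ≠ 1) (hs2 : s * s = 1) (hsρ : s ≠ ρ) (hτ : orderOf τ = p) :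
    (∀ A₀ A₁ : Finset (ZMod p), ∃ T : Finset G, IsCMTypeWith ρ (T : Set G) ∧
        (Finset.univ.filter fun c : ZMod p => τ ^ c.val ∈ T) = A₀ ∧ (Finset.univ.filter fun c : ZMod p => s * τ ^ c.val ∈ T) = A₁) ∧
    (∀ T T' : Finset G, IsCMTypeWith ρ (T : Set G) → IsCMTypeWith ρ (T' : Set G) →
        (∀ c : ZMod p, τ ^ c.val ∈ T ↔ τ ^ c.val ∈ T') → (∀ c : ZMod p, s * τ ^ c.val ∈ T ↔ s * τ ^ c.val ∈ T') → T = T') ∧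
    (∀ T : Finset G, IsCMTypeWith ρ (T : Set G) →
      ((∃ u : G, u ≠ 1 ∧ IsStableUnder T u) ↔
        ((Finset.univ.filter fun c : ZMod p => s * τ ^ c.val ∈ T) = (Finset.univ.filter fun c : ZMod p => τ ^ c.val ∈ T) ∨
          (Finset.univ.filter fun c : ZMod p => s * τ ^ c.val ∈ T) = (Finset.univ.filter fun c : ZMod p => τ ^ c.val ∈ T)ᶜ))) ∧
    (∀ T : Finset G, IsCMTypeWith ρ (T : Set G) → (∀ u : G, u ≠ 1 → ¬ IsStableUnder T u) →
      ((∃ χ : AddChar (Additive G) ℂ, χ (Additive.ofMul ρ) = -1 ∧ ∑ t ∈ T, χ (Additive.ofMul t) = 0) ↔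
        ((Finset.univ.filter fun c : ZMod p => τ ^ c.val ∈ T).card = (Finset.univ.filter fun c : ZMod p => s * τ ^ c.val ∈ T).card ∨
          (Finset.univ.filter fun c : ZMod p => τ ^ c.val ∈ T).card +
            (Finset.univ.filter fun c : ZMod p => s * τ ^ c.val ∈ T).card = p))) := by
  haveI : Fact (1 < p) := ⟨hp.out.one_lt⟩
  have h10 : (1 : ZMod p) ≠ 0 := one_ne_zero
  have h20 : (2 : ZMod p) ≠ 0 := by
    intro h
    have h' : ((2 : ℕ) : ZMod p) = 0 := by exact_mod_cast h
    rw [ZMod.natCast_eq_zero_iff] at h'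
    exact hp2 ((Nat.prime_dvd_prime_iff_eq hp.out Nat.prime_two).1 h')
  have h2fin : ∀ x : Fin 2, x = 0 ∨ x = 1 := by decide
  have haa : ∀ a : Fin 2, a + a = 0 := by decide
  have hρmemT : ∀ {T : Finset G}, IsCMTypeWith ρ (T : Set G) → ∀ g : G, ρ * g ∈ T ↔ g ∉ T := fun hT => rho_mul_mem_iff hT
  -- coordinates (§1, §6)
  set e : Fin 2 × Fin 2 × ZMod p → G := fun z => ρ ^ (z.1 : ℕ) * (s ^ (z.2.1 : ℕ) * τ ^ z.2.2.val) with he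
  have hbij : Function.Bijective e := coord_bijective hp2 hG hρ1 hρ2 hs1 hs2 hsρ hτ
  have hmul : ∀ (a i : Fin 2) (c : ZMod p) (a' i' : Fin 2) (c' : ZMod p),
      e (a, i, c) * e (a', i', c') = e (a + a', i + i', c + c') := fun a i c a' i' c' => by
    simp only [he]; exact coord_mul_coord hρ2 hs2 hτ a i a' i' c c'
  have he000 : e (0, 0, 0) = 1 := by simp [he]
  have he100 : e (1, 0, 0) = ρ := by simp [he]
  have he010 : e (0, 1, 0) = s := by simp [he]
  have he001 : e (0, 0, 1) = τ := by simp [he, ZMod.val_one]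
  have he110 : e (1, 1, 0) = ρ * s := by simp [he]
  have he00c : ∀ c : ZMod p, e (0, 0, c) = τ ^ c.val := fun c => by simp [he]
  have he01c : ∀ c : ZMod p, e (0, 1, c) = s * τ ^ c.val := fun c => by simp [he]
  have he10c : ∀ c : ZMod p, e (1, 0, c) = ρ * τ ^ c.val := fun c => by simp [he]
  have he11c : ∀ c : ZMod p, e (1, 1, c) = ρ * (s * τ ^ c.val) := fun c => by simp [he]
  -- membership of the four kinds in terms of `A₀ = {τ^c ∈ T}`, `A₁ = {sτ^c ∈ T}`
  have hρe : ∀ (i : Fin 2) (c : ZMod p), ρ * e (0, i, c) = e (1, i, c) := fun i c => by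
    rw [← he100, hmul, add_zero, zero_add, zero_add]
  have hfour : ∀ {T : Finset G}, IsCMTypeWith ρ (T : Set G) → ∀ (a i : Fin 2) (c : ZMod p),
      e (a, i, c) ∈ T ↔ (a = 0 ∧ e (0, i, c) ∈ T) ∨ (a = 1 ∧ e (0, i, c) ∉ T) := by
    intro T hT a i c
    rcases h2fin a with rfl | rfl
    · simp
    · rw [← hρe, hρmemT hT]
      simp
  refine ⟨fun A₀ A₁ => ?_, fun T T' hT hT' h0 h1 => ?_, fun T hT => ?_, fun T hT hprim => ?_⟩
  · -- (1) construction
    set D : Fin 2 × Fin 2 × ZMod p → Prop := fun z =>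
      (z.1 = 0 ∧ z.2.1 = 0 ∧ z.2.2 ∈ A₀) ∨ (z.1 = 0 ∧ z.2.1 = 1 ∧ z.2.2 ∈ A₁) ∨ (z.1 = 1 ∧ z.2.1 = 0 ∧ z.2.2 ∉ A₀) ∨
        (z.1 = 1 ∧ z.2.1 = 1 ∧ z.2.2 ∉ A₁) with hD
    set T : Finset G := (Finset.univ.filter fun z => D z).image e with hT
    have hmem : ∀ z, e z ∈ T ↔ D z := fun z => by
      rw [hT, hbij.1.mem_finset_image, Finset.mem_filter]
      exact ⟨fun h => h.2, fun h => ⟨Finset.mem_univ _, h⟩⟩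
    have hD00 : ∀ x : ZMod p, D (0, 0, x) ↔ x ∈ A₀ := fun x => by simp [hD]
    have hD01 : ∀ x : ZMod p, D (0, 1, x) ↔ x ∈ A₁ := fun x => by simp [hD]
    have hD10 : ∀ x : ZMod p, D (1, 0, x) ↔ x ∉ A₀ := fun x => by simp [hD]
    have hD11 : ∀ x : ZMod p, D (1, 1, x) ↔ x ∉ A₁ := fun x => by simp [hD]
    refine ⟨T, ⟨fun x => ?_, fun g x => ?_, fun x => ?_⟩, ?_, ?_⟩
    · obtain ⟨⟨a, i, c⟩, rfl⟩ := hbij.2 x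
      rw [smul_eq_mul, Finset.mem_coe, Finset.mem_coe, ← he100, hmul, hmem, hmem]
      rcases h2fin a with rfl | rfl <;> rcases h2fin i with rfl | rfl
      · rw [show ((1 : Fin 2) + 0 : Fin 2) = 1 from by decide, show ((0 : Fin 2) + 0 : Fin 2) = 0 from by decide, zero_add,
          hD00, hD10, not_not]
      · rw [show ((1 : Fin 2) + 0 : Fin 2) = 1 from by decide, show ((0 : Fin 2) + 1 : Fin 2) = 1 from by decide, zero_add,
          hD01, hD11, not_not]
      · rw [show ((1 : Fin 2) + 1 : Fin 2) = 0 from by decide, show ((0 : Fin 2) + 0 : Fin 2) = 0 from by decide, zero_add,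
          hD10, hD00]
      · rw [show ((1 : Fin 2) + 1 : Fin 2) = 0 from by decide, show ((0 : Fin 2) + 1 : Fin 2) = 1 from by decide, zero_add,
          hD11, hD01]
    · show g * (ρ * x) = ρ * (g * x)
      rw [mul_left_comm]
    · show ρ * (ρ * x) = x
      rw [← mul_assoc, hρ2, one_mul]
    · ext c; rw [Finset.mem_filter, ← he00c, hmem, hD00]; simp
    · ext c; rw [Finset.mem_filter, ← he01c, hmem, hD01]; simp
  · -- (2) uniqueness
    ext g
    obtain ⟨⟨a, i, c⟩, rfl⟩ := hbij.2 g
    have hi : e (0, i, c) ∈ T ↔ e (0, i, c) ∈ T' := by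
      rcases h2fin i with rfl | rfl
      · rw [he00c]; exact h0 c
      · rw [he01c]; exact h1 c
    rw [hfour hT, hfour hT', hi]
  · -- (3) stabilisers
    set A₀ := Finset.univ.filter fun c : ZMod p => τ ^ c.val ∈ T with hA₀
    set A₁ := Finset.univ.filter fun c : ZMod p => s * τ ^ c.val ∈ T with hA₁
    have hm0 : ∀ c : ZMod p, τ ^ c.val ∈ T ↔ c ∈ A₀ := fun c => by simp [hA₀]
    have hm1 : ∀ c : ZMod p, s * τ ^ c.val ∈ T ↔ c ∈ A₁ := fun c => by simp [hA₁]
    have hforms := exists_eq_coord hp2 hG hρ1 hρ2 hs1 hs2 hsρ hτ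
    have hR : ∀ g : G, (∃ c : ZMod p, g = τ ^ c.val ∨ g = s * τ ^ c.val) ∨
        ∃ c : ZMod p, ρ * g = τ ^ c.val ∨ ρ * g = s * τ ^ c.val := fun g => by
      obtain ⟨c, h | h⟩ := hforms g
      · exact Or.inl ⟨c, h⟩
      · exact Or.inr ⟨c, h⟩
    have k00 : ∀ c : ZMod p, e (0, 0, c) ∈ T ↔ c ∈ A₀ := fun c => by rw [he00c, hm0]
    have k01 : ∀ c : ZMod p, e (0, 1, c) ∈ T ↔ c ∈ A₁ := fun c => by rw [he01c, hm1]
    have k10 : ∀ c : ZMod p, e (1, 0, c) ∈ T ↔ c ∉ A₀ := fun c => by rw [← hρe, hρmemT hT, k00]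
    have k11 : ∀ c : ZMod p, e (1, 1, c) ∈ T ↔ c ∉ A₁ := fun c => by rw [← hρe, hρmemT hT, k01]
    have h2d : ∀ {d : ZMod p}, d ≠ 0 → d + d ≠ 0 := fun {d} hd h => by
      apply hd
      have h2 : (2 : ZMod p) * d = 0 := by rw [two_mul]; exact h
      exact (mul_eq_zero.1 h2).resolve_left h20
    constructor
    · rintro ⟨u, hu1, hst⟩
      obtain ⟨⟨a', i', d⟩, rfl⟩ := hbij.2 u
      rcases h2fin a' with rfl | rfl <;> rcases h2fin i' with rfl | rfl
      · -- `u = τ^d`, `d ≠ 0`: `A₀`, `A₁` are `d`-periodic, hence `∅` or everything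
        have hd : d ≠ 0 := by rintro rfl; exact hu1 he000
        have h0 : ∀ c, c ∈ A₀ ↔ d + c ∈ A₀ := fun c => by
          have h := hst (e (0, 0, c)); rw [hmul, add_zero] at h; rwa [k00, k00] at h
        have h1 : ∀ c, c ∈ A₁ ↔ d + c ∈ A₁ := fun c => by
          have h := hst (e (0, 1, c)); rw [hmul, add_zero, zero_add] at h; rwa [k01, k01] at h
        rcases eq_empty_or_univ_of_forall_mem_iff A₀ hd h0 with hA | hA <;>
          rcases eq_empty_or_univ_of_forall_mem_iff A₁ hd h1 with hB | hB
        · left; rw [hA, hB]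
        · right; rw [hA, hB]; simp
        · right; rw [hA, hB]; simp
        · left; rw [hA, hB]
      · -- `u = sτ^d`: `c ∈ A₀ ⟺ d + c ∈ A₁`, `c ∈ A₁ ⟺ d + c ∈ A₀`
        have h01 : ∀ c, c ∈ A₀ ↔ d + c ∈ A₁ := fun c => by
          have h := hst (e (0, 0, c)); rw [hmul, add_zero, add_zero] at h; rwa [k00, k01] at h
        have h10' : ∀ c, c ∈ A₁ ↔ d + c ∈ A₀ := fun c => by
          have h := hst (e (0, 1, c)); rw [hmul, add_zero, haa] at h; rwa [k01, k00] at h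
        by_cases hd : d = 0
        · left; ext c; rw [h10' c, hd, zero_add]
        · have h0 : ∀ c, c ∈ A₀ ↔ d + d + c ∈ A₀ := fun c => by rw [h01 c, h10' (d + c), add_assoc]
          have h1 : ∀ c, c ∈ A₁ ↔ d + d + c ∈ A₁ := fun c => by rw [h10' c, h01 (d + c), add_assoc]
          rcases eq_empty_or_univ_of_forall_mem_iff A₀ (h2d hd) h0 with hA | hA <;>
            rcases eq_empty_or_univ_of_forall_mem_iff A₁ (h2d hd) h1 with hB | hB
          · left; rw [hA, hB]
          · exfalso
            have h := (h10' 0).1 (by rw [hB]; exact Finset.mem_univ _)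
            rw [hA] at h; exact Finset.notMem_empty _ h
          · exfalso
            have h := (h01 0).1 (by rw [hA]; exact Finset.mem_univ _)
            rw [hB] at h; exact Finset.notMem_empty _ h
          · left; rw [hA, hB]
      · -- `u = ρτ^d`: `c ∈ A₀ ⟺ d + c ∉ A₀` — impossible
        exfalso
        have h0 : ∀ c, c ∈ A₀ ↔ d + c ∉ A₀ := fun c => by
          have h := hst (e (0, 0, c)); rw [hmul, add_zero, add_zero] at h; rwa [k00, k10] at h
        by_cases hd : d = 0
        · have h := h0 0; rw [hd, zero_add] at h; exact iff_not_self h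
        · have h00 : ∀ c, c ∈ A₀ ↔ d + d + c ∈ A₀ := fun c => by rw [h0 c, h0 (d + c), not_not, add_assoc]
          rcases eq_empty_or_univ_of_forall_mem_iff A₀ (h2d hd) h00 with hA | hA
          · have h := (h0 0).2 (by rw [hA]; exact Finset.notMem_empty _)
            rw [hA] at h; exact Finset.notMem_empty _ h
          · have h := (h0 0).1 (by rw [hA]; exact Finset.mem_univ _)
            rw [hA] at h; exact h (Finset.mem_univ _)
      · -- `u = ρsτ^d`: `c ∈ A₀ ⟺ d + c ∉ A₁`, `c ∈ A₁ ⟺ d + c ∉ A₀`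
        have h01 : ∀ c, c ∈ A₀ ↔ d + c ∉ A₁ := fun c => by
          have h := hst (e (0, 0, c)); rw [hmul, add_zero] at h; rwa [k00, k11] at h
        have h10' : ∀ c, c ∈ A₁ ↔ d + c ∉ A₀ := fun c => by
          have h := hst (e (0, 1, c)); rw [hmul, add_zero, haa] at h; rwa [k01, k10] at h
        by_cases hd : d = 0
        · right; ext c
          rw [Finset.mem_compl, h10' c, hd, zero_add]
        · have h0 : ∀ c, c ∈ A₀ ↔ d + d + c ∈ A₀ := fun c => by rw [h01 c, h10' (d + c), not_not, add_assoc]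
          have h1 : ∀ c, c ∈ A₁ ↔ d + d + c ∈ A₁ := fun c => by rw [h10' c, h01 (d + c), not_not, add_assoc]
          rcases eq_empty_or_univ_of_forall_mem_iff A₀ (h2d hd) h0 with hA | hA <;>
            rcases eq_empty_or_univ_of_forall_mem_iff A₁ (h2d hd) h1 with hB | hB
          · exfalso
            have h := (h01 0).2 (by rw [hB]; exact Finset.notMem_empty _)
            rw [hA] at h; exact Finset.notMem_empty _ h
          · right; rw [hA, hB]; simp
          · right; rw [hA, hB]; simp
          · exfalso
            have h := (h01 0).1 (by rw [hA]; exact Finset.mem_univ _)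
            rw [hB] at h; exact h (Finset.mem_univ _)
    · -- conversely `A₁ = A₀` gives `sT = T`, `A₁ = A₀ᶜ` gives `ρsT = T`
      rintro (h | h)
      · refine ⟨s, hs1, isStableUnder_of_forall hT (fun g => ∃ c : ZMod p, g = τ ^ c.val ∨ g = s * τ ^ c.val) hR
          fun r hr => ?_⟩
        have heq : ∀ c : ZMod p, s * τ ^ c.val ∈ T ↔ τ ^ c.val ∈ T := fun c => by rw [hm0, hm1, h]
        obtain ⟨c, rfl | rfl⟩ := hr
        · rw [heq]
        · rw [← mul_assoc, hs2, one_mul, heq]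
      · have hρs1 : ρ * s ≠ 1 := by
          intro h1; apply hsρ
          have := congrArg (ρ * ·) h1
          simp only [← mul_assoc, hρ2, one_mul, mul_one] at this
          exact this
        refine ⟨ρ * s, hρs1, isStableUnder_of_forall hT (fun g => ∃ c : ZMod p, g = τ ^ c.val ∨ g = s * τ ^ c.val) hR
          fun r hr => ?_⟩
        have heq : ∀ c : ZMod p, s * τ ^ c.val ∈ T ↔ τ ^ c.val ∉ T := fun c => by rw [hm0, hm1, h, Finset.mem_compl]
        obtain ⟨c, rfl | rfl⟩ := hr
        · rw [mul_assoc, hρmemT hT, heq, not_not]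
        · rw [mul_assoc, ← mul_assoc s s, hs2, one_mul, hρmemT hT, heq]
  · -- (4) degeneracy of a primitive type
    set A₀ := Finset.univ.filter fun c : ZMod p => τ ^ c.val ∈ T with hA₀
    set A₁ := Finset.univ.filter fun c : ZMod p => s * τ ^ c.val ∈ T with hA₁
    have hm0 : ∀ c : ZMod p, (τ ^ c.val ∈ T) = (c ∈ A₀) := fun c => by simp [hA₀]
    have hm1 : ∀ c : ZMod p, (s * τ ^ c.val ∈ T) = (c ∈ A₁) := fun c => by simp [hA₁]
    -- the character sum of an odd character trivial on `τ`, in terms of `|A₀|`, `|A₁|`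
    have hsum : ∀ χ : AddChar (Additive G) ℂ, χ (Additive.ofMul ρ) = -1 → χ (Additive.ofMul τ) = 1 →
        ∑ t ∈ T, χ (Additive.ofMul t) = (2 * (A₀.card : ℂ) - p) + χ (Additive.ofMul s) * (2 * (A₁.card : ℂ) - p) := by
      intro χ hχ hχτ
      rw [sum_char_eq_sum_sign hp2 hG hρ1 hρ2 hs1 hs2 hsρ hτ hT χ hχ, hχτ]
      simp_rw [hm0, hm1, one_pow, mul_one]
      push_cast
      rw [Finset.sum_add_distrib, ← Finset.mul_sum, sum_sign_eq, sum_sign_eq]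
    have hσ : ∀ χ : AddChar (Additive G) ℂ, χ (Additive.ofMul s) = 1 ∨ χ (Additive.ofMul s) = -1 := fun χ =>
      mul_self_eq_one_iff.1 (by rw [← AddChar.map_add_eq_mul, ← ofMul_mul, hs2, ofMul_one, AddChar.map_zero_eq_one])
    have hpC : (p : ℂ) ≠ 0 := Nat.cast_ne_zero.2 hp.out.ne_zero
    constructor
    · rintro ⟨χ, hχ, h0⟩
      have hχτ := char_tau_eq_one_of_sum_eq_zero_of_primitive hp2 hG hρ1 hρ2 hs1 hs2 hsρ hτ hT hprim χ hχ h0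
      rw [hsum χ hχ hχτ] at h0
      rcases hσ χ with h1 | h1 <;> rw [h1] at h0
      · right
        have h : ((A₀.card + A₁.card : ℕ) : ℂ) = (p : ℂ) := by push_cast; linear_combination h0 / 2
        exact_mod_cast h
      · left
        have h : ((A₀.card : ℕ) : ℂ) = (A₁.card : ℂ) := by linear_combination h0 / 2
        exact_mod_cast h
    · -- the two quadratic odd characters: kernels `⟨τ, s⟩ = e{(0, i, c)}` (`χ(s) = 1`) and `⟨τ, ρs⟩ = e{(a, a, c)}` (`χ(s) = −1`)
      intro hcard
      let Hp : Subgroup G :=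
        { carrier := {g | ∃ (i : Fin 2) (c : ZMod p), g = e (0, i, c)}
          mul_mem' := by
            rintro _ _ ⟨i, c, rfl⟩ ⟨j, d, rfl⟩
            exact ⟨i + j, c + d, by rw [hmul, add_zero]⟩
          one_mem' := ⟨0, 0, he000.symm⟩
          inv_mem' := by
            rintro _ ⟨i, c, rfl⟩
            refine ⟨i, -c, inv_eq_of_mul_eq_one_right ?_⟩
            rw [hmul, haa, haa, add_neg_cancel, he000] }
      let Hm : Subgroup G :=
        { carrier := {g | ∃ (a : Fin 2) (c : ZMod p), g = e (a, a, c)}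
          mul_mem' := by
            rintro _ _ ⟨a, c, rfl⟩ ⟨b, d, rfl⟩
            exact ⟨a + b, c + d, by rw [hmul]⟩
          one_mem' := ⟨0, 0, he000.symm⟩
          inv_mem' := by
            rintro _ ⟨a, c, rfl⟩
            refine ⟨a, -c, inv_eq_of_mul_eq_one_right ?_⟩
            rw [hmul, haa, add_neg_cancel, he000] }
      have hρp : ρ ∉ Hp := by
        rintro ⟨i, c, h⟩
        have h' := hbij.1 (he100.trans h)
        simp only [Prod.mk.injEq] at h'
        exact absurd h'.1 (by decide)
      have hρm : ρ ∉ Hm := by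
        rintro ⟨a, c, h⟩
        have h' := hbij.1 (he100.trans h)
        simp only [Prod.mk.injEq] at h'
        exact absurd (h'.2.1.trans h'.1.symm) (by decide)
      rcases hcard with h | h
      · -- `|A₀| = |A₁|`: the character with `χ(s) = −1`
        obtain ⟨χ, hχ, hχH⟩ := exists_oddChar_eq_one_of_not_mem hρ2 Hm hρm
        have hχτ : χ (Additive.ofMul τ) = 1 := hχH τ (he001 ▸ (⟨0, 1, rfl⟩ : e (0, 0, 1) ∈ Hm))
        have hχρs : χ (Additive.ofMul (ρ * s)) = 1 := hχH (ρ * s) (he110 ▸ (⟨1, 0, rfl⟩ : e (1, 1, 0) ∈ Hm))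
        have hχs : χ (Additive.ofMul s) = -1 := by
          rw [show s = ρ * (ρ * s) by rw [← mul_assoc, hρ2, one_mul], ofMul_mul, AddChar.map_add_eq_mul, hχ, hχρs, mul_one]
        refine ⟨χ, hχ, ?_⟩
        rw [hsum χ hχ hχτ, hχs, h]; ring
      · -- `|A₀| + |A₁| = p`: the character with `χ(s) = 1`
        obtain ⟨χ, hχ, hχH⟩ := exists_oddChar_eq_one_of_not_mem hρ2 Hp hρp
        have hχτ : χ (Additive.ofMul τ) = 1 := hχH τ (he001 ▸ (⟨0, 1, rfl⟩ : e (0, 0, 1) ∈ Hp))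
        have hχs : χ (Additive.ofMul s) = 1 := hχH s (he010 ▸ (⟨1, 0, rfl⟩ : e (0, 1, 0) ∈ Hp))
        refine ⟨χ, hχ, ?_⟩
        have hc : (A₁.card : ℂ) = p - A₀.card := by
          have : ((A₀.card + A₁.card : ℕ) : ℂ) = (p : ℂ) := by exact_mod_cast h
          push_cast at this; linear_combination this
        rw [hsum χ hχ hχτ, hχs, hc]; ring

end Group

section GroupCount

variable {G : Type*} [CommGroup G] [Fintype G] [DecidableEq G] {ρ s τ : G} {p : ℕ}

/-- `|{(A₀, A₁) : |A₀| + |A₁| = p}| = C(2p, p)` (`(A₀, A₁) ↦ A₀ ⊔ A₁ ⊆ ℤ/p ⊔ ℤ/p`). [folklore] -/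
private theorem card_filter_card_add_eq [NeZero p] :
    (Finset.univ.filter fun P : Finset (ZMod p) × Finset (ZMod p) => P.1.card + P.2.card = p).card = (2 * p).choose p := by
  set f : Finset (ZMod p) × Finset (ZMod p) → Finset (ZMod p ⊕ ZMod p) := fun P => P.1.disjSum P.2 with hf
  have hinj : Function.Injective f := fun P Q h => by
    have h1 := congrArg Finset.toLeft h
    have h2 := congrArg Finset.toRight h
    simp only [hf, Finset.toLeft_disjSum, Finset.toRight_disjSum] at h1 h2
    exact Prod.ext h1 h2
  rw [← Finset.card_image_of_injective _ hinj]
  have himg : (Finset.univ.filter fun P : Finset (ZMod p) × Finset (ZMod p) => P.1.card + P.2.card = p).image f =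
      Finset.univ.powersetCard p := by
    ext B
    simp only [Finset.mem_image, Finset.mem_filter, Finset.mem_univ, true_and, Finset.mem_powersetCard,
      Finset.subset_univ, hf]
    constructor
    · rintro ⟨P, hP, rfl⟩; rw [Finset.card_disjSum]; exact hP
    · intro hB
      exact ⟨(B.toLeft, B.toRight), by rw [Finset.card_toLeft_add_card_toRight]; exact hB, Finset.toLeft_disjSum_toRight⟩
  rw [himg, Finset.card_powersetCard, Finset.card_univ, Fintype.card_sum, ZMod.card, two_mul]

/-- `|{(A₀, A₁) : |A₀| = |A₁|}| = C(2p, p)` (`(A₀, A₁) ↦ A₀ᶜ ⊔ A₁`). [folklore] -/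
private theorem card_filter_card_eq [NeZero p] :
    (Finset.univ.filter fun P : Finset (ZMod p) × Finset (ZMod p) => P.1.card = P.2.card).card = (2 * p).choose p := by
  set f : Finset (ZMod p) × Finset (ZMod p) → Finset (ZMod p ⊕ ZMod p) := fun P => P.1ᶜ.disjSum P.2 with hf
  have hinj : Function.Injective f := fun P Q h => by
    have h1 := congrArg Finset.toLeft h
    have h2 := congrArg Finset.toRight h
    simp only [hf, Finset.toLeft_disjSum, Finset.toRight_disjSum, compl_inj_iff] at h1 h2
    exact Prod.ext h1 h2
  rw [← Finset.card_image_of_injective _ hinj]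
  have himg : (Finset.univ.filter fun P : Finset (ZMod p) × Finset (ZMod p) => P.1.card = P.2.card).image f =
      Finset.univ.powersetCard p := by
    ext B
    simp only [Finset.mem_image, Finset.mem_filter, Finset.mem_univ, true_and, Finset.mem_powersetCard,
      Finset.subset_univ, hf]
    constructor
    · rintro ⟨P, hP, rfl⟩
      have h1 := Finset.card_add_card_compl P.1
      rw [ZMod.card] at h1
      rw [Finset.card_disjSum]; omega
    · intro hB
      have h1 := Finset.card_add_card_compl B.toLeft
      have h2 : B.toLeft.card + B.toRight.card = p := by rw [Finset.card_toLeft_add_card_toRight]; exact hB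
      rw [ZMod.card] at h1
      exact ⟨(B.toLeftᶜ, B.toRight), show B.toLeftᶜ.card = B.toRight.card by omega,
        show B.toLeftᶜᶜ.disjSum B.toRight = B by rw [compl_compl, Finset.toLeft_disjSum_toRight]⟩
  rw [himg, Finset.card_powersetCard, Finset.card_univ, Fintype.card_sum, ZMod.card, two_mul]

/-- `|{(A, A)}| = 2^p = |{(A, Aᶜ)}|`. [folklore] -/
private theorem card_filter_snd_eq [NeZero p] :
    (Finset.univ.filter fun P : Finset (ZMod p) × Finset (ZMod p) => P.2 = P.1).card = 2 ^ p ∧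
      (Finset.univ.filter fun P : Finset (ZMod p) × Finset (ZMod p) => P.2 = P.1ᶜ).card = 2 ^ p := by
  have hU : (Finset.univ : Finset (Finset (ZMod p))).card = 2 ^ p := by
    rw [Finset.card_univ, Fintype.card_finset, ZMod.card]
  constructor
  · have h : (Finset.univ.filter fun P : Finset (ZMod p) × Finset (ZMod p) => P.2 = P.1) =
        Finset.univ.image fun A : Finset (ZMod p) => (A, A) := by
      ext ⟨A, B⟩
      simp only [Finset.mem_filter, Finset.mem_univ, true_and, Finset.mem_image, Prod.mk.injEq]
      exact ⟨fun h => ⟨A, rfl, h.symm⟩, fun ⟨C, h1, h2⟩ => h2.symm.trans h1⟩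
    rw [h, Finset.card_image_of_injective _ fun A B hAB => congrArg Prod.fst hAB, hU]
  · have h : (Finset.univ.filter fun P : Finset (ZMod p) × Finset (ZMod p) => P.2 = P.1ᶜ) =
        Finset.univ.image fun A : Finset (ZMod p) => (A, Aᶜ) := by
      ext ⟨A, B⟩
      simp only [Finset.mem_filter, Finset.mem_univ, true_and, Finset.mem_image, Prod.mk.injEq]
      exact ⟨fun h => ⟨A, rfl, h.symm⟩, fun ⟨C, h1, h2⟩ => by rw [← h2, h1]⟩
    rw [h, Finset.card_image_of_injective _ fun A B hAB => congrArg Prod.fst hAB, hU]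

/-- **The three pair counts behind the census**: all pairs `4^p`; `A₁ ∈ {A₀, A₀ᶜ}` (not primitive) `2^{p+1}`;
`A₁ ∉ {A₀, A₀ᶜ}` with `|A₀| = |A₁|` or `|A₀| + |A₁| = p` (primitive degenerate) `2·(C(2p,p) − 2^p)`, `p` odd. [folklore] -/
private theorem card_pairs [hp : Fact p.Prime] (hp2 : p ≠ 2) :
    (Finset.univ : Finset (Finset (ZMod p) × Finset (ZMod p))).card = 4 ^ p ∧
    (Finset.univ.filter fun P : Finset (ZMod p) × Finset (ZMod p) => P.2 = P.1 ∨ P.2 = P.1ᶜ).card = 2 ^ (p + 1) ∧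
    (Finset.univ.filter fun P : Finset (ZMod p) × Finset (ZMod p) =>
        ¬ (P.2 = P.1 ∨ P.2 = P.1ᶜ) ∧ (P.1.card = P.2.card ∨ P.1.card + P.2.card = p)).card = 2 * ((2 * p).choose p - 2 ^ p) := by
  have hodd : ¬ 2 ∣ p := fun h => hp2 ((Nat.prime_dvd_prime_iff_eq Nat.prime_two hp.out).1 h).symm
  obtain ⟨hD₁, hD₂⟩ := card_filter_snd_eq (p := p)
  have hE := card_filter_card_eq (p := p)
  have hF := card_filter_card_add_eq (p := p)
  -- pointwise facts
  have hcc : ∀ A : Finset (ZMod p), A.card + Aᶜ.card = p := fun A => by rw [Finset.card_add_card_compl, ZMod.card]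
  have hne : ∀ A : Finset (ZMod p), A ≠ Aᶜ := fun A h => by
    have h0 : (0 : ZMod p) ∈ A ↔ (0 : ZMod p) ∈ Aᶜ := by rw [← h]
    rw [Finset.mem_compl] at h0; exact iff_not_self h0
  refine ⟨?_, ?_, ?_⟩
  · rw [Finset.card_univ, Fintype.card_prod, Fintype.card_finset, ZMod.card, ← mul_pow]; norm_num
  · rw [Finset.filter_or, Finset.card_union_of_disjoint (Finset.disjoint_filter.2 fun P _ h1 h2 => hne P.1 (h1.symm.trans h2)),
      hD₁, hD₂, pow_succ]; ring
  · -- `Q' ⟺ (E ∧ ¬D₁) ∨ (F ∧ ¬D₂)`, a disjoint union with `D₁ ⊆ E`, `D₂ ⊆ F`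
    have hcongr : (Finset.univ.filter fun P : Finset (ZMod p) × Finset (ZMod p) =>
        ¬ (P.2 = P.1 ∨ P.2 = P.1ᶜ) ∧ (P.1.card = P.2.card ∨ P.1.card + P.2.card = p)) =
        Finset.univ.filter fun P : Finset (ZMod p) × Finset (ZMod p) =>
          (P.1.card = P.2.card ∧ ¬ P.2 = P.1) ∨ (P.1.card + P.2.card = p ∧ ¬ P.2 = P.1ᶜ) := by
      refine Finset.filter_congr fun P _ => ?_
      have h1 : P.2 = P.1 → P.1.card = P.2.card := fun h => by rw [h]
      have h2 : P.2 = P.1ᶜ → P.1.card + P.2.card = p := fun h => by rw [h]; exact hcc P.1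
      have h3 : ¬ (P.1.card = P.2.card ∧ P.1.card + P.2.card = p) := fun ⟨ha, hb⟩ => by omega
      tauto
    have hsd₁ : (Finset.univ.filter fun P : Finset (ZMod p) × Finset (ZMod p) => P.1.card = P.2.card ∧ ¬ P.2 = P.1) =
        (Finset.univ.filter fun P : Finset (ZMod p) × Finset (ZMod p) => P.1.card = P.2.card) \
          Finset.univ.filter fun P : Finset (ZMod p) × Finset (ZMod p) => P.2 = P.1 := by
      ext P; simp
    have hsd₂ : (Finset.univ.filter fun P : Finset (ZMod p) × Finset (ZMod p) => P.1.card + P.2.card = p ∧ ¬ P.2 = P.1ᶜ) =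
        (Finset.univ.filter fun P : Finset (ZMod p) × Finset (ZMod p) => P.1.card + P.2.card = p) \
          Finset.univ.filter fun P : Finset (ZMod p) × Finset (ZMod p) => P.2 = P.1ᶜ := by
      ext P; simp
    have hsub₁ : (Finset.univ.filter fun P : Finset (ZMod p) × Finset (ZMod p) => P.2 = P.1) ⊆
        Finset.univ.filter fun P : Finset (ZMod p) × Finset (ZMod p) => P.1.card = P.2.card := by
      intro P; simp only [Finset.mem_filter, Finset.mem_univ, true_and]; intro h; rw [h]
    have hsub₂ : (Finset.univ.filter fun P : Finset (ZMod p) × Finset (ZMod p) => P.2 = P.1ᶜ) ⊆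
        Finset.univ.filter fun P : Finset (ZMod p) × Finset (ZMod p) => P.1.card + P.2.card = p := by
      intro P; simp only [Finset.mem_filter, Finset.mem_univ, true_and]; intro h; rw [h]; exact hcc P.1
    have hle₁ := Finset.card_le_card hsub₁
    have hle₂ := Finset.card_le_card hsub₂
    rw [hcongr, Finset.filter_or,
      Finset.card_union_of_disjoint (Finset.disjoint_filter.2 fun P _ h1 h2 => by obtain ⟨ha, -⟩ := h1; obtain ⟨hb, -⟩ := h2; omega),
      hsd₁, hsd₂, Finset.card_sdiff_of_subset hsub₁, Finset.card_sdiff_of_subset hsub₂, hE, hF, hD₁, hD₂]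
    rw [hE, hD₁] at hle₁
    omega

/-- **THE GROUP-LEVEL CENSUS for `⟨ρ⟩ × ⟨s⟩ × ⟨τ⟩`**: `4^p` CM types; `2^{p+1}` with a non-trivial stabiliser (not primitive);
`2·(C(2p,p) − 2^p)` primitive and killed by an odd character (degenerate). [cite: Hazama2003CyclicCM, Thm. 4.8 (vi) (the `ℤ/2pq` analogue)]
[cite: Kubota1965, §4 Lemma 2] -/
theorem census_card [hp : Fact p.Prime] (hp2 : p ≠ 2) (hG : Fintype.card G = 4 * p) (hρ1 : ρ ≠ 1) (hρ2 : ρ * ρ = 1)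
    (hs1 : s ≠ 1) (hs2 : s * s = 1) (hsρ : s ≠ ρ) (hτ : orderOf τ = p) :
    {T : Finset G | IsCMTypeWith ρ (T : Set G)}.ncard = 4 ^ p ∧
    {T : Finset G | IsCMTypeWith ρ (T : Set G) ∧ ∃ u : G, u ≠ 1 ∧ IsStableUnder T u}.ncard = 2 ^ (p + 1) ∧
    {T : Finset G | IsCMTypeWith ρ (T : Set G) ∧ (∀ u : G, u ≠ 1 → ¬ IsStableUnder T u) ∧
        ∃ χ : AddChar (Additive G) ℂ, χ (Additive.ofMul ρ) = -1 ∧ ∑ t ∈ T, χ (Additive.ofMul t) = 0}.ncard =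
      2 * ((2 * p).choose p - 2 ^ p) := by
  obtain ⟨hcons, huniq, hstab, hdeg⟩ := census_dictionary hp2 hG hρ1 hρ2 hs1 hs2 hsρ hτ
  obtain ⟨c_all, c_np, c_pd⟩ := card_pairs (p := p) hp2
  -- the dictionary `Ψ`
  set Ψ : Finset G → Finset (ZMod p) × Finset (ZMod p) := fun T =>
    (Finset.univ.filter fun c : ZMod p => τ ^ c.val ∈ T, Finset.univ.filter fun c : ZMod p => s * τ ^ c.val ∈ T) with hΨ
  have hinj : Set.InjOn Ψ {T : Finset G | IsCMTypeWith ρ (T : Set G)} := by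
    intro T hT T' hT' h
    simp only [hΨ, Prod.mk.injEq] at h
    refine huniq T T' hT hT' (fun c => ?_) (fun c => ?_)
    · have := congrArg (c ∈ ·) h.1; simpa using this
    · have := congrArg (c ∈ ·) h.2; simpa using this
  -- transport of a count through `Ψ`
  have htrans : ∀ (Q : Finset G → Prop) (Q' : Finset (ZMod p) × Finset (ZMod p) → Prop) [DecidablePred Q'],
      (∀ T : Finset G, IsCMTypeWith ρ (T : Set G) → (Q T ↔ Q' (Ψ T))) →
      {T : Finset G | IsCMTypeWith ρ (T : Set G) ∧ Q T}.ncard = (Finset.univ.filter Q').card := by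
    intro Q Q' _ hQ
    have hinj' : Set.InjOn Ψ {T : Finset G | IsCMTypeWith ρ (T : Set G) ∧ Q T} := fun T hT T' hT' h => hinj hT.1 hT'.1 h
    rw [← hinj'.ncard_image, ← Set.ncard_coe_finset]
    congr 1
    ext P
    rw [Set.mem_image, Finset.mem_coe, Finset.mem_filter]
    constructor
    · rintro ⟨T, ⟨hT, hQT⟩, rfl⟩; exact ⟨Finset.mem_univ _, (hQ T hT).1 hQT⟩
    · rintro ⟨-, hP⟩
      obtain ⟨T, hT, h0, h1⟩ := hcons P.1 P.2
      have hΨT : Ψ T = P := Prod.ext h0 h1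
      exact ⟨T, ⟨hT, (hQ T hT).2 (hΨT ▸ hP)⟩, hΨT⟩
  refine ⟨?_, ?_, ?_⟩
  · have h := htrans (fun _ => True) (fun _ => True) fun _ _ => Iff.rfl
    simp only [and_true, Finset.filter_true] at h
    rw [h, c_all]
  · rw [← c_np]
    exact htrans _ _ fun T hT => hstab T hT
  · rw [← c_pd]
    refine htrans _ _ fun T hT => ?_
    rw [← hstab T hT]
    constructor
    · rintro ⟨hprim, hχ⟩
      have hprim' : ¬ ∃ u : G, u ≠ 1 ∧ IsStableUnder T u := fun ⟨u, hu, hst⟩ => hprim u hu hst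
      exact ⟨hprim', (hdeg T hT hprim).1 hχ⟩
    · rintro ⟨hprim', hc⟩
      have hprim : ∀ u : G, u ≠ 1 → ¬ IsStableUnder T u := fun u hu hst => hprim' ⟨u, hu, hst⟩
      exact ⟨hprim, (hdeg T hT hprim).2 hc⟩

end GroupCount

section FieldCount

open scoped Classical
open NumberField
open Literature.AlgebraicGeometry.Motives (CMType)
open Literature.AlgebraicGeometry.Pohlmann1968

variable {K : Type} [Field K] [NumberField K] [IsCMField K] [IsAbelianGalois ℚ K] {p : ℕ}

omit [IsCMField K] in
/-- Transport of counts from `K` to `Gal(K/ℚ)` (`Φ ↦ {g : σ_g ∈ Φ}`, a bijection onto the group-level CM types; the tree's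
`CyclicPrimeSquare.ncard_cmType_sep_eq`, re-proved here to keep the import cone). [cite: Shimura1998, §8.1 and §18.2 Lemma (i)] -/
private theorem ncard_cmType_eq {ρ : K ≃ₐ[ℚ] K} {φ₀ : K →+* ℂ} (hρ : ∀ x, φ₀ (ρ x) = starRingEnd ℂ (φ₀ x))
    (P : CMType K → Prop) (Q : Finset (K ≃ₐ[ℚ] K) → Prop)
    (hPQ : ∀ Φ : CMType K, P Φ ↔ Q (Finset.univ.filter fun g : K ≃ₐ[ℚ] K => embOf φ₀ g ∈ Φ.1)) :
    {Φ : CMType K | P Φ}.ncard = {ΦG : Finset (K ≃ₐ[ℚ] K) | IsCMTypeWith ρ (ΦG : Set (K ≃ₐ[ℚ] K)) ∧ Q ΦG}.ncard := by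
  set F : CMType K → Finset (K ≃ₐ[ℚ] K) := fun Φ => Finset.univ.filter fun g : K ≃ₐ[ℚ] K => embOf φ₀ g ∈ Φ.1 with hF
  have hinj : Function.Injective F := by
    intro Φ Ψ h
    apply Subtype.ext
    ext φ
    obtain ⟨g, rfl⟩ := (embOf_bijective φ₀).2 φ
    have := congrArg (fun S : Finset (K ≃ₐ[ℚ] K) => g ∈ S) h
    simpa [hF] using this
  have himage : F '' {Φ : CMType K | P Φ} = {ΦG : Finset (K ≃ₐ[ℚ] K) | IsCMTypeWith ρ (ΦG : Set (K ≃ₐ[ℚ] K)) ∧ Q ΦG} := by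
    ext ΦG
    simp only [Set.mem_image, Set.mem_setOf_eq]
    constructor
    · rintro ⟨Φ, hP, rfl⟩
      exact ⟨CyclicTwoOddPrimes.isCMTypeWith_galType hρ Φ, (hPQ Φ).1 hP⟩
    · rintro ⟨hcm, hQ⟩
      obtain ⟨Φ, hΦ⟩ := CyclicTwoOddPrimes.exists_cmType_of_isCMTypeWith (φ₀ := φ₀) hρ hcm
      refine ⟨Φ, ?_, hΦ⟩
      rw [hPQ Φ]
      change Q (F Φ)
      rw [show F Φ = ΦG from hΦ]
      exact hQ
  rw [← himage, Set.ncard_image_of_injective _ hinj]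

/-- **THE CENSUS OF THE CM TYPES OF AN ABELIAN NON-CYCLIC CM FIELD OF DEGREE `4p`** (`p` an odd prime): `4^p` CM types; `2^{p+1}` NOT
primitive (their abelian varieties are not simple; `B = D` and HC on all powers, §3); `2·(C(2p,p) − 2^p)` PRIMITIVE AND DEGENERATE (rank
`2p`: simple `2p`-folds of Weil type with `Bᵖ ≠ Dᵖ`, §§2, 6); the remaining `4^p − 2·C(2p,p)` are NONDEGENERATE (HC on all powers).
For `p = 3` (`ℚ(ζ₂₁), ℚ(ζ₂₈), ℚ(ζ₃₆)`): `64 = 16 + 24 + 24`; for `p = 5` (`ℚ(ζ₃₃), ℚ(ζ₄₄)`): `1024 = 64 + 440 + 520`.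
[cite: Hazama2003CyclicCM, Thm. 4.8 (vi) (the `ℤ/2pq` analogue)] [cite: Kubota1965, §4 Lemma 2] [cite: Dodson1984, §3.2.1] -/
theorem census (hp : p.Prime) (hp2 : p ≠ 2) (hK : Module.finrank ℚ K = 4 * p) (hnc : ¬ IsCyclic (K ≃ₐ[ℚ] K))
    (φ₀ : K →+* ℂ) :
    (Set.univ : Set (CMType K)).ncard = 4 ^ p ∧
    {Φ : CMType K | ¬ IsPrimitive (ℂ ≃+* ℂ) Φ.1 φ₀}.ncard = 2 ^ (p + 1) ∧
    {Φ : CMType K | IsPrimitive (ℂ ≃+* ℂ) Φ.1 φ₀ ∧ ¬ IsNondegenerate Φ}.ncard = 2 * ((2 * p).choose p - 2 ^ p) ∧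
    {Φ : CMType K | IsNondegenerate Φ}.ncard + 2 * (2 * p).choose p = 4 ^ p := by
  haveI := Fact.mk hp
  obtain ⟨hG, hρ1, hρ2, s, τ, hs1, hs2, hsρ, hτ⟩ := exists_frame_of_not_isCyclic hp hp2 hK hnc
  have hρ : ∀ x, φ₀ ((conjGal : K ≃ₐ[ℚ] K) x) = starRingEnd ℂ (φ₀ x) := fun x =>
    IsCMField.complexEmbedding_complexConj K φ₀ x
  have hcomm : ∀ g h : K ≃ₐ[ℚ] K, g * h = h * g := fun g h => mul_comm g h
  obtain ⟨c_all, c_np, c_pd⟩ := census_card hp2 hG hρ1 hρ2 hs1 hs2 hsρ hτ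
  -- dictionaries between the field-level and the group-level predicates
  have hprimQ : ∀ Φ : CMType K, ¬ IsPrimitive (ℂ ≃+* ℂ) Φ.1 φ₀ ↔
      ∃ u : K ≃ₐ[ℚ] K, u ≠ 1 ∧ IsStableUnder (Finset.univ.filter fun g : K ≃ₐ[ℚ] K => embOf φ₀ g ∈ Φ.1) u := fun Φ => by
    rw [CyclicTwoOddPrimes.isPrimitive_iff (φ₀ := φ₀) Φ φ₀]
    push Not
    exact Iff.rfl
  have hdegQ : ∀ Φ : CMType K, ¬ IsNondegenerate Φ ↔ ∃ χ : AddChar (Additive (K ≃ₐ[ℚ] K)) ℂ,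
      χ (Additive.ofMul (conjGal : K ≃ₐ[ℚ] K)) = -1 ∧
        ∑ g ∈ Finset.univ.filter (fun g : K ≃ₐ[ℚ] K => embOf φ₀ g ∈ Φ.1), χ (Additive.ofMul g) = 0 := fun Φ => by
    rw [isNondegenerate_iff_forall_oddCharacters hcomm Φ φ₀ conjGal hρ]
    push Not
    exact Iff.rfl
  have h1 : (Set.univ : Set (CMType K)).ncard = 4 ^ p := by
    have h := ncard_cmType_eq hρ (fun _ => True) (fun _ => True) fun _ => Iff.rfl
    simp only [Set.setOf_true, and_true] at h
    rw [h, c_all]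
  have h2 : {Φ : CMType K | ¬ IsPrimitive (ℂ ≃+* ℂ) Φ.1 φ₀}.ncard = 2 ^ (p + 1) := by
    rw [← c_np]; exact ncard_cmType_eq hρ _ _ hprimQ
  have h3 : {Φ : CMType K | IsPrimitive (ℂ ≃+* ℂ) Φ.1 φ₀ ∧ ¬ IsNondegenerate Φ}.ncard = 2 * ((2 * p).choose p - 2 ^ p) := by
    rw [← c_pd]
    refine ncard_cmType_eq hρ _ _ fun Φ => ?_
    rw [CyclicTwoOddPrimes.isPrimitive_iff (φ₀ := φ₀) Φ φ₀, hdegQ]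
  refine ⟨h1, h2, h3, ?_⟩
  -- the partition: all = ¬primitive ⊔ (primitive ∧ degenerate) ⊔ nondegenerate (nondegenerate ⟹ primitive, Kubota)
  haveI : Finite (CMType K) :=
    Finite.of_injective (fun Φ : CMType K => (Φ.1 : Set (K →+* ℂ))) fun a b h => Subtype.ext h
  have hsplit : (Set.univ : Set (CMType K)) = {Φ | ¬ IsPrimitive (ℂ ≃+* ℂ) Φ.1 φ₀} ∪
      ({Φ : CMType K | IsPrimitive (ℂ ≃+* ℂ) Φ.1 φ₀ ∧ ¬ IsNondegenerate Φ} ∪ {Φ : CMType K | IsNondegenerate Φ}) := by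
    ext Φ
    simp only [Set.mem_univ, Set.mem_union, Set.mem_setOf_eq, true_iff]
    by_cases hP : IsPrimitive (ℂ ≃+* ℂ) Φ.1 φ₀
    · by_cases hN : IsNondegenerate Φ
      · exact Or.inr (Or.inr hN)
      · exact Or.inr (Or.inl ⟨hP, hN⟩)
    · exact Or.inl hP
  have hd1 : Disjoint {Φ : CMType K | ¬ IsPrimitive (ℂ ≃+* ℂ) Φ.1 φ₀}
      ({Φ : CMType K | IsPrimitive (ℂ ≃+* ℂ) Φ.1 φ₀ ∧ ¬ IsNondegenerate Φ} ∪ {Φ : CMType K | IsNondegenerate Φ}) := by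
    rw [Set.disjoint_left]
    rintro Φ hΦ (⟨hP, -⟩ | hN)
    · exact hΦ hP
    · exact hΦ (hN.isPrimitive φ₀)
  have hd2 : Disjoint {Φ : CMType K | IsPrimitive (ℂ ≃+* ℂ) Φ.1 φ₀ ∧ ¬ IsNondegenerate Φ} {Φ : CMType K | IsNondegenerate Φ} := by
    rw [Set.disjoint_left]
    rintro Φ ⟨-, hN⟩ hN'
    exact hN hN'
  have hsum := h1
  rw [hsplit, Set.ncard_union_eq hd1 (Set.toFinite _) (Set.toFinite _), Set.ncard_union_eq hd2 (Set.toFinite _) (Set.toFinite _),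
    h2, h3] at hsum
  -- `2^{p+1} + 2 (C − 2^p) + N = 4^p` with `2^p ≤ C`
  have hle : 2 ^ p ≤ (2 * p).choose p := by
    rw [← Nat.sum_range_choose p, two_mul, Nat.add_choose_eq, Finset.Nat.sum_antidiagonal_eq_sum_range_succ_mk]
    refine Finset.sum_le_sum fun i _ => ?_
    exact Nat.le_mul_of_pos_right _ (Nat.choose_pos (Nat.sub_le p i))
  omega

/-- **`ℚ(ζ_q)`, `(ℤ/q)ˣ` non-cyclic of order `4p`: the census.** [cite: Hazama2003CyclicCM, Thm. 4.8 (vi) (analogue)] [cite: Kubota1965, §4 Lemma 2] -/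
theorem census_of_isCyclotomicExtension {q : ℕ} [NeZero q] (h2q : 2 < q) (hncq : ¬ IsCyclic (ZMod q)ˣ) (hφ : Nat.totient q = 4 * p)
    (hp : p.Prime) (hp2 : p ≠ 2) (L : Type) [Field L] [NumberField L] [IsCyclotomicExtension {q} ℚ L] (φ₀ : L →+* ℂ) :
    (Set.univ : Set (CMType L)).ncard = 4 ^ p ∧
    {Φ : CMType L | ¬ IsPrimitive (ℂ ≃+* ℂ) Φ.1 φ₀}.ncard = 2 ^ (p + 1) ∧
    {Φ : CMType L | IsPrimitive (ℂ ≃+* ℂ) Φ.1 φ₀ ∧ ¬ IsNondegenerate Φ}.ncard = 2 * ((2 * p).choose p - 2 ^ p) ∧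
    {Φ : CMType L | IsNondegenerate Φ}.ncard + 2 * (2 * p).choose p = 4 ^ p := by
  obtain ⟨hcm, hab, hnc, hL⟩ := cm_abelian_not_isCyclic_finrank_of_isCyclotomicExtension h2q hncq L
  haveI := hcm; haveI := hab
  exact census hp hp2 (hL.trans hφ) hnc φ₀

/-- **`ℚ(ζ₂₁)`: `64` CM types — `16` not primitive, `24` primitive degenerate (rank `6`; simple CM sixfolds of Weil type with `B³ ≠ D³`),
`24` nondegenerate.**  (The tree's `DegenerateCMTypeCyclotomic21` reaches the degenerate ones from the character side.)
[cite: Dodson1984, §3.2.1] [cite: Hazama2003CyclicCM, Thm. 4.8 (vi) (analogue)] -/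
theorem census_twentyOne (L : Type) [Field L] [NumberField L] [IsCyclotomicExtension {21} ℚ L] (φ₀ : L →+* ℂ) :
    (Set.univ : Set (CMType L)).ncard = 64 ∧ {Φ : CMType L | ¬ IsPrimitive (ℂ ≃+* ℂ) Φ.1 φ₀}.ncard = 16 ∧
    {Φ : CMType L | IsPrimitive (ℂ ≃+* ℂ) Φ.1 φ₀ ∧ ¬ IsNondegenerate Φ}.ncard = 24 ∧ {Φ : CMType L | IsNondegenerate Φ}.ncard = 24 := by
  obtain ⟨h1, h2, h3, h4⟩ := census_of_isCyclotomicExtension (p := 3) (by norm_num) not_isCyclic_units_twentyOne (by decide)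
    (by norm_num) (by norm_num) L φ₀
  have hc : (2 * 3).choose 3 = 20 := by decide
  rw [hc] at h3 h4
  norm_num at h3 h4
  exact ⟨by rw [h1]; norm_num, by rw [h2]; norm_num, h3, by omega⟩

/-- **`ℚ(ζ₃₃)`: `1024` CM types — `64` not primitive, `440` primitive degenerate (rank `10`; simple CM `10`-folds of Weil type with
`B⁵ ≠ D⁵`), `520` nondegenerate.** [cite: Hazama2003CyclicCM, Thm. 4.8 (vi) (analogue)] [cite: Kubota1965, §4 Lemma 2] -/
theorem census_thirtyThree (L : Type) [Field L] [NumberField L] [IsCyclotomicExtension {33} ℚ L] (φ₀ : L →+* ℂ) :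
    (Set.univ : Set (CMType L)).ncard = 1024 ∧ {Φ : CMType L | ¬ IsPrimitive (ℂ ≃+* ℂ) Φ.1 φ₀}.ncard = 64 ∧
    {Φ : CMType L | IsPrimitive (ℂ ≃+* ℂ) Φ.1 φ₀ ∧ ¬ IsNondegenerate Φ}.ncard = 440 ∧ {Φ : CMType L | IsNondegenerate Φ}.ncard = 520 := by
  obtain ⟨h1, h2, h3, h4⟩ := census_of_isCyclotomicExtension (p := 5) (by norm_num) not_isCyclic_units_thirtyThree (by decide)
    (by norm_num) (by norm_num) L φ₀
  have hc : (2 * 5).choose 5 = 252 := by decide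
  rw [hc] at h3 h4
  norm_num at h3 h4
  exact ⟨by rw [h1]; norm_num, by rw [h2]; norm_num, h3, by omega⟩

/-- **`ℚ(ζ₄₄)`: the same census as `ℚ(ζ₃₃)`** (`1024 = 64 + 440 + 520`). [cite: Hazama2003CyclicCM, Thm. 4.8 (vi) (analogue)] -/
theorem census_fortyFour (L : Type) [Field L] [NumberField L] [IsCyclotomicExtension {44} ℚ L] (φ₀ : L →+* ℂ) :
    (Set.univ : Set (CMType L)).ncard = 1024 ∧ {Φ : CMType L | ¬ IsPrimitive (ℂ ≃+* ℂ) Φ.1 φ₀}.ncard = 64 ∧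
    {Φ : CMType L | IsPrimitive (ℂ ≃+* ℂ) Φ.1 φ₀ ∧ ¬ IsNondegenerate Φ}.ncard = 440 ∧ {Φ : CMType L | IsNondegenerate Φ}.ncard = 520 := by
  obtain ⟨h1, h2, h3, h4⟩ := census_of_isCyclotomicExtension (p := 5) (by norm_num) not_isCyclic_units_fortyFour (by decide)
    (by norm_num) (by norm_num) L φ₀
  have hc : (2 * 5).choose 5 = 252 := by decide
  rw [hc] at h3 h4
  norm_num at h3 h4
  exact ⟨by rw [h1]; norm_num, by rw [h2]; norm_num, h3, by omega⟩

end FieldCount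

end Census

end Literature.AlgebraicGeometry.ComplexMultiplication.NonCyclicFourTimesPrime

end
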